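import Summits.Langlands.Langlands.Theses.SkinnerWilesDefectOne
import Summits.Langlands.Langlands.Theorems.EisensteinProModularSeed.Negative.OrientedFrame
import Summits.Langlands.Langlands.Theorems.EisensteinProModularSeed.Negative.BorelAndEisenstein
import Summits.Langlands.Langlands.Theorems.SkinnerWilesDefectOneEisensteinProModularSeedRestrictTwistGaloisPackageNu
import Summits.Langlands.Langlands.Theorems.SkinnerWilesDefectOneEisensteinProModularSeedDistinguishedDescendsQ
import Summits.Langlands.Langlands.Theorems.SkinnerWilesDefectOneEisensteinProModularSeedInertSupplyPrimeSq
import Summits.Langlands.Langlands.Theorems.SkinnerWilesDefectOneEisensteinProModularSeedEisensteinPackageQ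
import Literature.NumberTheory.EllipticCurves.OrdinaryReductionTateModule
import Literature.NumberTheory.Automorphic.CaraianiNewtonResidualImageModularity
import Summits.Langlands.Langlands.Theorems.SkinnerWilesDefectOneEisensteinProModularSeedCousinGaloisPackage
import Summits.Langlands.Langlands.Theorems.SkinnerWilesDefectOneEisensteinProModularSeedCousinAutomorphic
import Literature.NumberTheory.EllipticCurves.EisensteinNewformLevelRaising
import Literature.NumberTheory.EllipticCurves.FramedTateGaloisRep
import Literature.NumberTheory.Automorphic.BCDTModularity
import Literature.FieldTheory.AlgClosed.PadicAlgClEquivComplex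
import Literature.NumberTheory.Automorphic.TotallyRealModularityLargeImage
import Literature.NumberTheory.EllipticCurves.Isogeny
import Summits.Langlands.Langlands.Theorems.SkinnerWilesDefectOneEisensteinProModularSeedQuadraticBaseChangeTwist
import Summits.Langlands.Langlands.Theorems.SkinnerWilesDefectOneEisensteinProModularSeedCuspidalCohomologicalPoint
import Summits.Langlands.Langlands.Theorems.SkinnerWilesDefectOneSeedOfQuadraticBaseChangeS4Rewire
import Summits.Langlands.Langlands.Theorems.SkinnerWilesDefectOneSeedOfQuadraticBaseChangeInertSupplyAll
import Summits.Langlands.Langlands.Theorems.SkinnerWilesDefectOneSeedOfQuadraticBaseChangeEisensteinPackageQOdd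
import Summits.Langlands.Langlands.Theorems.SkinnerWilesDefectOneEisensteinProModularSeedTwistGaloisTransport
-- (re-enable when the farm has built it) import Summits.Langlands.Langlands.Theorems.SkinnerWilesDefectOneEisensteinProModularSeedTwistAutomorphicTransport

/-!
# Line `descend-raise-basechange` — skeleton v6 (= v5 + the WIDE-COUSIN graft: S7e/S7f) (continuation lead prover-line-stmt-Langlands-12920-c1-0, 2026-08-16)

v6 (same seat, after wave 1 landed S7c p103537 / S7d p106056): the twisted-cousin regime is widened once more to `HasWideCousin` — Caraiani–Newton
Cor. 6.1.1 AS PRINTED (non-CM `E/F` with `ρ̄_{E,3}|_{G_{F(ζ₃)}}` OR `ρ̄_{E,5}|_{G_{F(ζ₅)}}` absolutely irreducible, `ModPImageAbsIrreducibleOverCyclotomic`)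
instead of `SL₂(𝔽₃) ⊆ im ρ̄_{E,3}`, and `5 ≤ p` replaced by the two local hypotheses the Galois package uses at each `v ∣ p` (`e(v ∣ p) < p - 1`,
`ω|_{I_v} ≠ 1`), so that `p = 3` elliptic-type data over fields with `3` unramified are covered too.  Two NEW registered stubs, theorem-grade:
S7e `stub_cousinGaloisPackageWide` (= landed S7a minus two derived `have`s; same two Serre facts) and S7f `stub_cousinAutomorphicWide` (= landed
S7b with the printed Cor. 6.1.1 as an ELEVENTH named fact `CaraianiNewton2023_cor611_nonCM_printed`, stated inline by the worker, unfolded in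
`S.lineFacts` until the gate relocates it); glue `seed_of_wideCousin` = S7e → S7c → S7f → S7d → S5, kernel-checked; heart S6'''' `stub_genuineCoreSeed`
= the crux on `¬ DescendsOdd ∧ ¬ HasTwistedCousin ∧ ¬ HasWideCousin` (registered with the regime predicates BY NAME — the gate's stub registry
truncates at 3900 chars).  (v5 paragraph:)

v5 (continuation seat c1, 2026-08-16): the cousin regime is widened to cousins UP TO A FINITE-ORDER TWIST (`HasTwistedCousin`:
`ρ₀ = ν·ρ₀'` entrywise with `ν : Γ_F → ℚ̄_pˣ` continuous of finite order, unramified at the residually-unramified places `≠ q`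
of `ρ₀`, and a `HasCousin`-cousin `(E, P, Q, q)` of `ρ₀'`), by two NEW registered stubs, both theorem-grade and fact-free:
S7c `stub_twistGaloisTransport` (frame algebra: `r = ν ⊗ r'`, `r₀ = ν·r₀'`, same oriented frames with exponent `m·n`,
level set `S' = S ∪ {q} ∪ {residually ramified places of ρ₀}`) and S7d `stub_twistAutomorphicTransport` (`πF ⊗ (χ_ν ∘ det)`
via the tree's proved `exists_heckeCharacter_of_finiteOrder` / `HasArchParameter.twist` / `satakeFrobCompatibleAt_twist`, the
twist half of the S4 rewire p94876); glue `seed_of_twistedCousin` = S7a(ρ₀') → S7c → S7b → S7d → S5, kernel-checked; the heart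
becomes S6''' `stub_genuineResidueSeed` = the crux verbatim on `¬ DescendsOdd ∧ ¬ HasTwistedCousin` (S6'' minus the
twist-needing elliptic data), with the lead's EXHAUSTION-OF-SOURCES note in its docstring (base change gives descended or
`F`-dihedral residual image, the latter mixed-oriented at split `p` / non-ordinary at inert `p`; automorphic induction is never
SW-ordinary; Caraiani–Newton curves are (twisted) cousins).  After wave 1 BOTH landed (S7c p103537, S7d p106056; fact-free), so the sorries are:
`stub_quadraticBaseChangeGalois` (route crux), `stub_lineFacts` (ten named facts), S6''' (the heart).
(v4e title:) Line `descend-raise-basechange` — FINAL skeleton v4e (= v4d with S7a/S7b closed once their modules are built) (odd-descended chain for EVERY odd `p` + cousin graft + base-change rewire) (line lead prover-line-stmt-Langlands-12920-0, 2026-08-16)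

v4d (final, 2026-08-16 ~13:00Z): (i) ROUTE-CHOICE REWIRE honoured — S4's three base-change named facts are PROMOTED to the route
crux `QuadraticBaseChangeGalois` (stmt-Langlands-15156); S4 is now discharged from the registered `stub_quadraticBaseChangeGalois` (the route
crux BY NAME) via the landed p94876, no base-change fact left in the cone; (ii) the odd-descended chain runs for EVERY ODD `p` using the
item-15158 provers' `inertSupplyPrimeSq_all` / `eisensteinPackageQ_odd` (Billerey–Menares 2016 Thm 2.2 in its odd-`l` form,
`BillereyMenares2016_thm22_exists_newform_odd`), so `DescendsOdd` is `p ≠ 2 ∧ …`; (iii) `stub_lineFacts` = TEN facts; (iv) sorries =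
`stub_quadraticBaseChangeGalois` (route crux), `stub_lineFacts`, `stub_cousinGaloisPackage`/`stub_cousinAutomorphic` (LANDED p96064/p95253,
sorried only until the farm builds their modules), `stub_genuineNonCousinSeed` (the heart: genuine pairs for every odd `p` with no
twist-free cousin).

v4b (after wave 3): S7a LANDED p96064 (conditional on 2 Serre facts, p96063), S7b fact p95252 ACCEPTED, S7b main p95253 pending;
S2' module now built ⟹ closed below by the landed theorem; sorries = S7a (farm build pending), S7b (pending), stub_lineFacts, S6''.

v4 (wave 3): the genuine regime is split along the planners' docking instruction ("graft the geometric line's stubs here"):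
`HasCousin` (big-image-cousin's twist-free cousin datum) ⟹ S7a `stub_cousinGaloisPackage` + S7b `stub_cousinAutomorphic` + the LANDED S5
⟹ Concl (`seed_of_cousin`); the conceded residue is S6'' `stub_genuineNonCousinSeed` = crux on ¬DescendsOdd ∧ ¬HasCousin.

v3b (after wave 2): EVERY stub of the widened line has LANDED through the gate — S0 p92288, S1' p92220 (unconditional), S2' p94046
(conditional on 5 named facts), S3-Nu p90619 (unconditional), S4 p90411 (conditional on 3), S5 p87504 (conditional on 2); the only `sorry`s left
are `stub_lineFacts` (the ten named facts, literature debt) and `stub_genuineRegimeSeed` (the genuine regime = the heart of the crux).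


v3 = the line WIDENED from the Billerey–Menares window to ALL odd-descended pairs with `p ≥ 5`
(no Serre-weight window, no Mazur corner), after wave 1 landed S1–S3 and the disprover's gen-3 attack (Disproof §8G:
the Mazur-corner "orphan" `(1, ω)/ℚ(√-7)/p = 7` is seeded at level `7·ℓ`, `ℓ ≡ -1 (mod 7)` inert) pointed at the mechanism:
Billerey–Menares 2016 (arXiv:1309.3717 = Math. Res. Lett. 23), Thm 2.2 — for `ρ̄ = 1 ⊕ εχ^b`, ANY `0 ≤ b ≤ l-2`, with THEIR weight
`k ∈ {l (b = 0), l+1 (b = 1), b+1 (b ≥ 2)}`, `ρ̄` arises from an eigenform in `S_k(Γ₀(NM), ε₀)` for every prime `M ∤ Nl` with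
`λ ∣ (B_{k,ε₀}/2k)(ε₀(M)M^k - 1)` (constant terms of `E - α_M E` at all cusps + Deligne–Serre; read at page level, p. 7).  For a
level-raising prime `M` whose Frobenius is a COMPLEX CONJUGATION in the finite extension cut out by `(η̄, ω mod p², F)` — which is
what S1 already produces — one has `η̄(Frob_M) = η̄(c) = -1` and `M ≡ -1 (mod p²)`, hence `ε₀(M)M^k ≡ η̄(M)·M ≡ 1 (mod λ)` in EVERY
case `b`, and in the one case where `B_{k,ε₀}/2k` is not `λ`-integral (`ε₀ = 1`, `(p-1) ∣ k`, i.e. `b = p-2`, von Staudt–Clausen;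
for `ε₀ ≠ 1` of conductor prime to `p` the quotient `B_{k,ε₀}/k` is `p`-integral, Carlitz 1959 / Washington Ch. 5) the extra `p`
from `M^{p-1} ≡ 1 (mod p²)` restores the divisibility; the form is `p`-ordinary (`a_p ≡ 1 + ε(p)p^{k-1} ≡ 1`) of weight `k ≥ 3`
and level prime to `p`, so Hida *MFG* Thm 3.26 (2) gives the inertial shape `(ε^{k-1} ∗; 0 1)` with UNRAMIFIED unit root `≡ 1`,
and `p`-distinguishedness (now an explicit hypothesis DIST over `ℚ`, supplied from the crux's `IsPDistinguishedAt` by the new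
stub S0) orients the Ribet frame exactly as in the landed S2.  The seed's conclusion allows ANY parallel weight `k' ≥ 2`, so no
weight lowering (Hida family / Ash–Stevens) is needed: S3-Nu (landed p90619) takes `k` as a parameter.

STUBS v3 (registered by `ledger skeleton check`; sorried = open):
* S0  `stub_distinguishedDescendsQ` (NEW, provable now, size S/M: `IsPDistinguishedAt ρ₀ v` at `v ∣ p` + the descent relation ⟹
  `η̄ ≠ 1` on a decomposition group above `p` in `Γ_ℚ`, global spelling `∃ 𝔓 ∣ p, ∃ σ, σ𝔓 ⊆ 𝔓 ∧ η̄(σ) ≠ 1`; tools landed in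
  `…RestrictTwistGaloisPackageAux2` (`exists_conj_absGaloisRestrict_adicCompletion`, `exists_primesAbove_restrict_decomp`)).
* S1' `stub_inertSupplyPrimeSq` (NEW, replaces S1 `stub_inertBMPrimeSupply` [landed p85724, kept in the tree]: same Chebotarev-on-
  the-class-of-`c` construction, output `M` prime `≠ p`, INERT in `F`, `η̄` unramified at `M`, `η̄(Frob_M) ≡ -1`, `M ≡ -1 (mod p²)`;
  no Mazur-corner hypothesis; provable now with the landed machinery `exists_inert_prime` / `ImaginaryQuadraticCyclotomicProofs`).
* S2' `stub_eisensteinPackageQ` (NEW, replaces S2 `stub_levelRaisedEisensteinNewformQ` [landed p88130, conditional]: same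
  conclusion VERBATIM, hypotheses: `η̄` odd + DIST + (`M` prime `≠ p`, `η̄` unramified at `M`, `η̄(Frob_M) ≡ -1`, `M ≡ -1 (mod p²)`);
  theorem-grade: BM16 Thm 2.2 (new named fact) + the landed facts Hida2000_thm326_{exists_galoisRep, ordinary, inertia_of_level},
  Gelbart1975_exists_cuspidalRepData_LAlgebraic + the landed proof files …LevelRaisedEisensteinNewformQ{Frame,Inertia,Glue}).
* S3-Nu `stub_restrictTwistGaloisPackageNu` — CLOSED (p90619).
* S4 `stub_quadraticBaseChangeTwist` — proof file p90411 pending (conditional on 3 named facts; registered here in the v2a text).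
* S5 `stub_cuspidalCohomologicalPoint` — proof file p87504 pending (conditional on 2 named facts; v2a text).
* S6' `stub_genuineRegimeSeed` — OPEN: the crux VERBATIM on `¬ DescendsOdd` = (`p = 3`) ∨ (the residual ratio `χ̄_b/χ̄_a` does not
  extend to an odd continuous unit-valued character of `Γ_ℚ`, i.e. GENUINE pairs).  This is the heart (Disproof §7D/§8F); the
  elliptic-type part of it is the territory of `big-image-cousin` (whose K1 is false as typed at `p = 7`, Disproof §8G — repair:
  `p = 5` / `2` non-split), the rest has no mechanism in any card.  Lead's hand-back candidate (`promote-stub`).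
Composition: `by_cases DescendsOdd F p O ρ₀`; inside `seed_of_descendsOdd` = S1' → S0 → S2' → S3-Nu → S4 → S5 (consumes only
`hunr`, `hmod`, `p`-distinguishedness from the crux's hypotheses — Disproof §3 `crux_of_pairSeed`); outside S6'.
Named-fact obligations (D-0014): S2'/S4/S5 land CONDITIONALLY; their facts are folded into a registered `stub_lineFacts` at
integration (v3b), as `stub_lineFactsBM` was in v2a.

Earlier versions: v1 = planner's skeleton (tree `Lines/descend-raise-basechange.lean`), v2a = after wave 1
(tree `Lines/descend_raise_basechange.lean`, commit 567d8dc13f87): S1/S2/S3-Nu closed on the BM window.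
-/

set_option linter.dupNamespace false
set_option linter.unusedVariables false

noncomputable section

namespace Summit.Langlands.Langlands.Cruxes.EisensteinProModularSeed.DescendRaiseBasechange

open Summit.Langlands.Langlands.Theses.SkinnerWilesDefectOne
open Literature.NumberTheory.Automorphic Literature.NumberTheory.GaloisRepresentations
open Literature.NumberTheory.Automorphic.BigHeckeGLn
open NumberField IsDedekindDomain IsLocalRing Filter Field

/-! ## 0. Vocabulary used only by the readable statements and the glue (never by the registered stubs) -/

/-- The `p`-adic cyclotomic character of `ℚ` as an element of `ℚ̄_p` (the crux's spelling of the local clause with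
`K = ℚ`): `cyc p τ = ε(τ)`, so `Valued.v (η τ - cyc p τ) < 1` reads `η̄(τ) = ω̄(τ)`. [folklore] -/
def cyc (p : ℕ) [Fact p.Prime] (τ : absoluteGaloisGroup ℚ) : PadicAlgCl p :=
  algebraMap (Padic p) (PadicAlgCl p)
    (((GaloisRep.cyclotomicCharacter ℚ p τ).val : PadicInt p) : Padic p)

/-- **The regime of the widened line** (`DescendsOdd F p O ρ₀`): `p` odd and the residual RATIO `χ̄_b/χ̄_a` of `ρ₀`
extends to `Γ_ℚ` as an ODD character — witnessed by a continuous unit-valued `η : Γ_ℚ → ℚ̄_pˣ` (only `η̄` matters) with the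
DESCENT relation `η̄(σ|_ℚ)·χ̄_a(σ) = χ̄_b(σ)` on `Γ_F` and `η̄(c) = -1` at complex conjugations.  (For a `Gal(F/ℚ)`-invariant
ratio exactly one of its two extensions is odd, so this is "the ratio descends"; no Serre-weight window, no Mazur corner.) [folklore] -/
def DescendsOdd (F : Type) [Field F] [NumberField F] (p : ℕ) [Fact p.Prime]
    (O : ValuationSubring (PadicAlgCl p))
    (ρ₀ : absoluteGaloisGroup F →* Matrix.GeneralLinearGroup (Fin 2) O) : Prop :=
  p ≠ 2 ∧ ∃ η : absoluteGaloisGroup ℚ →ₜ* (PadicAlgCl p)ˣ,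
    (∀ τ, Valued.v ((η τ : (PadicAlgCl p)ˣ) : PadicAlgCl p) = 1) ∧
    (∀ σ : Field.absoluteGaloisGroup F,
      Valued.v (((η (Literature.NumberTheory.GaloisRepresentations.absGaloisRestrict ℚ F σ) : (PadicAlgCl p)ˣ) : PadicAlgCl p) *
          ((ρ₀ σ).val 0 0 : PadicAlgCl p) - ((ρ₀ σ).val 1 1 : PadicAlgCl p)) < 1) ∧
    (∀ c : Field.absoluteGaloisGroup ℚ, Literature.NumberTheory.GaloisRepresentations.IsComplexConjugation (Rat.castHom ℝ) c →
      Valued.v (((η c : (PadicAlgCl p)ˣ) : PadicAlgCl p) + 1) < 1)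

/-! ## 1. The statements of the stubs (`S.stub_*`; S4/S5 in the v2a texts; S3-Nu closed) -/

/-- **STUB S0 — `distinguishedDescendsQ` (NEW in v3; provable now, size S/M).**  For a residually upper-triangular
integral model `ρ₀` of a continuous `ρ : Γ_F → GL₂(ℚ̄_p)`, `p`-distinguished at every `v ∣ p`, and a unit-valued `η : Γ_ℚ → ℚ̄_pˣ`
with the DESCENT relation `η̄(σ|_ℚ)χ̄_a(σ) = χ̄_b(σ)`: at the place `w = (p)` of `ℚ` there are a prime `𝔓 ∣ w` of `\bar ℤ` and an
element `σ` of its decomposition group (`σ𝔓 ⊆ 𝔓`) with `η̄(σ) ≠ 1`.  Proof: pick `v ∣ p` in `F` (exists: `p` is not a unit) and a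
distinguished `σ₀ ∈ Γ_{F_v}` (`isPDistinguishedAt_iff`): `χ̄_a ≠ χ̄_b` at `g = res σ₀`, so `η̄(g|_ℚ) ≠ 1` by DESCENT (the residual
diagonal entries are units since `ρ₀` is residually Borel); the image of `Γ_{F_v} → Γ_F → Γ_ℚ` lies in a decomposition group of a
prime above `p` (landed `RestrictTwist.exists_conj_absGaloisRestrict_adicCompletion` / `exists_primesAbove_restrict_decomp` in
`…RestrictTwistGaloisPackageAux2`), conjugate into `w.primesAbove`. [folklore] -/
def S.stub_distinguishedDescendsQ : Prop :=
    ∀ (F : Type) [Field F] [NumberField F] (p : ℕ) [Fact p.Prime] (O : ValuationSubring (PadicAlgCl p)),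
      O = (Valued.v : Valuation (PadicAlgCl p) NNReal).valuationSubring →
      ∀ (ρ : Literature.NumberTheory.GaloisRepresentations.FramedGaloisRep F (PadicAlgCl p) 2)
        (ρ₀ : Field.absoluteGaloisGroup F →* Matrix.GeneralLinearGroup (Fin 2) O),
      ρ.HasUpperTriangularIntegralModel ρ₀ →
      (∀ v : IsDedekindDomain.HeightOneSpectrum (NumberField.RingOfIntegers F), (p : NumberField.RingOfIntegers F) ∈ v.asIdeal →
        Literature.NumberTheory.GaloisRepresentations.IsPDistinguishedAt ρ₀ v) →
      ∀ (η : Field.absoluteGaloisGroup ℚ →ₜ* (PadicAlgCl p)ˣ),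
      (∀ τ, Valued.v ((η τ : (PadicAlgCl p)ˣ) : PadicAlgCl p) = 1) →
      (∀ σ : Field.absoluteGaloisGroup F,
        Valued.v (((η (Literature.NumberTheory.GaloisRepresentations.absGaloisRestrict ℚ F σ) : (PadicAlgCl p)ˣ) : PadicAlgCl p) *
            ((ρ₀ σ).val 0 0 : PadicAlgCl p) - ((ρ₀ σ).val 1 1 : PadicAlgCl p)) < 1) →
      ∀ w : IsDedekindDomain.HeightOneSpectrum (NumberField.RingOfIntegers ℚ), (p : NumberField.RingOfIntegers ℚ) ∈ w.asIdeal →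
        ∃ 𝔓 ∈ w.primesAbove, ∃ σ : Field.absoluteGaloisGroup ℚ, (∀ x ∈ 𝔓, σ • x ∈ 𝔓) ∧
          ¬ Valued.v (((η σ : (PadicAlgCl p)ˣ) : PadicAlgCl p) - 1) < 1

/-- **STUB S1' — `inertSupplyPrimeSq` (NEW in v3, replaces S1; provable now with the landed S1 machinery).**  For `F`
imaginary quadratic, `p ≥ 5` and a continuous unit-valued `η : Γ_ℚ → ℚ̄_pˣ` with ODD reduction, there is a prime `M ≠ p`, INERT in
`F`, at which `η̄` is unramified, with `η̄(Frob_M) ≡ -1` at every arithmetic Frobenius above `M` and `M ≡ -1 (mod p²)`.  Proof (as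
in the landed `stub_inertBMPrimeSupply`, Case A, with `ω mod p²` in place of `ω mod p`): `η̄` has open kernel, so the field `K` cut
out by `(η̄, Gal(ℚ(ζ_{p²})/ℚ), F)` is finite Galois; a complex conjugation `c` has `η̄(c) = -1` (ODD), acts as `-1` on `ζ_{p²}` and
non-trivially on `F` (totally complex); Chebotarev / Frobenius density in the class of `c|_K` (`chebotarev_artinRep_holds`,
`absoluteGaloisGroup.frobenius_dense`) gives infinitely many `M` with `Frob_M ∼ c`: unramified for `η̄`, `η̄(Frob_M) = -1`,
`M ≡ -1 (mod p²)`, inert in `F` (`exists_place_inert_of_not_mem_range`, `Rat.isPrime_span_natCast_of_unique_place`); discard `M = p`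
and the ramified ones.  [BillereyMenares2016 Thm 2.2 (the use); Tate GCFT §2.4 (Chebotarev)] -/
def S.stub_inertSupplyPrimeSqAll : Prop :=

    ∀ (F : Type) [Field F] [NumberField F], NumberField.IsTotallyComplex F → Module.finrank ℚ F = 2 →
      ∀ (p : ℕ) [Fact p.Prime],
      ∀ (η : Field.absoluteGaloisGroup ℚ →ₜ* (PadicAlgCl p)ˣ),
      (∀ τ, Valued.v ((η τ : (PadicAlgCl p)ˣ) : PadicAlgCl p) = 1) →
      (∀ c : Field.absoluteGaloisGroup ℚ, Literature.NumberTheory.GaloisRepresentations.IsComplexConjugation (Rat.castHom ℝ) c →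
        Valued.v (((η c : (PadicAlgCl p)ˣ) : PadicAlgCl p) + 1) < 1) →
      ∃ M : ℕ, M.Prime ∧ M ≠ p ∧ (Ideal.span {(M : NumberField.RingOfIntegers F)}).IsPrime ∧
        (∀ w : IsDedekindDomain.HeightOneSpectrum (NumberField.RingOfIntegers ℚ), (M : NumberField.RingOfIntegers ℚ) ∈ w.asIdeal → ∀ 𝔓 ∈ w.primesAbove,
          ∀ σ ∈ 𝔓.inertia (Field.absoluteGaloisGroup ℚ),
            Valued.v (((η σ : (PadicAlgCl p)ˣ) : PadicAlgCl p) - 1) < 1) ∧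
        (∀ w : IsDedekindDomain.HeightOneSpectrum (NumberField.RingOfIntegers ℚ), (M : NumberField.RingOfIntegers ℚ) ∈ w.asIdeal → ∀ 𝔓 ∈ w.primesAbove,
          ∀ σ : Field.absoluteGaloisGroup ℚ, IsArithFrobAt (NumberField.RingOfIntegers ℚ) σ 𝔓 →
            Valued.v (((η σ : (PadicAlgCl p)ˣ) : PadicAlgCl p) + 1) < 1) ∧
        M % (p ^ 2) = p ^ 2 - 1

/-- **STUB S2' — `eisensteinPackageQ` (NEW in v3, replaces S2; theorem-grade in print, lands CONDITIONALLY on named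
facts).**  For `p ≥ 5`, `O = 𝒪_{ℚ̄_p}`, a continuous unit-valued `η : Γ_ℚ → ℚ̄_pˣ` with ODD reduction which is NON-TRIVIAL ON A
DECOMPOSITION GROUP AT `p` (DIST), and a prime `M ≠ p` with `η̄` unramified at `M`, `η̄(Frob_M) ≡ -1` and `M ≡ -1 (mod p²)`:
the SAME conclusion as the landed S2 — `k ≥ 2`, an irreducible `ρ' : Γ_ℚ → GL₂(ℚ̄_p)` with an integral model `ρ'₀` of ORDERED
residual diagonal `(1, η̄)`, an ORIENTED ordinary frame at `p` of inertial type `(ε^{k-1}, 1)`, the level property off `Mp`, and the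
modularity clause (regular L-algebraic cuspidal `π` on `GL₂(𝔸_ℚ)`, a.e. `SatakeFrobCompatibleAt`).  Intended proof: `η̄|_{I_p} = ω^b`,
`0 ≤ b ≤ p-2` (local Kronecker–Weber, as in the landed `exists_weight_of_window` minus the window); BM16 weight `k := p (b=0),
p+1 (b=1), b+1 (b≥2)` (so `k ≥ 3`, `k-1 ≡ b mod (p-1)`); `ε := η̄ω^{-b}` unramified at `p`, `ε₀` its Teichmüller lift, `N = cond ε₀`
prime to `p`; Billerey–Menares 2016 Thm 2.2: `1 ⊕ η̄ = 1 ⊕ εχ^{k-1}` arises from an eigenform in `S_k(Γ₀(NM), ε₀)` because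
`λ ∣ (B_{k,ε₀}/2k)(ε₀(M)M^k - 1)` — `ε₀(M)M^k ≡ η̄(M)M ≡ (-1)(-1) = 1`, `B_{k,ε₀}/2k` is `λ`-integral unless `ε₀ = 1 ∧ (p-1) ∣ k`
(⟺ `b = p-2`, von Staudt–Clausen; Carlitz/Washington for `ε₀ ≠ 1`, conductor prime to `p`), where `M^{p-1} ≡ 1 (mod p²)` supplies
the missing `p`; pass to the NEWFORM `g` of level `N' ∈ {N, NM}` (`N' = N·M` unless `1 ⊕ η̄` is strongly modular); `a_p(g) ≡ 1 +
ε(p)p^{k-1} ≡ 1` (`k ≥ 3`): `p`-ordinary with unit root `≡ 1`; then VERBATIM the landed S2 proof: `ρ' = ρ_{g,ι}` (Hida 3.26(1)),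
ordinary frame (Hida 3.26(2)), Ribet frame with ordered diagonal `(1, η̄)` (`exists_residually_borel_frame`), ORIENTED because the
unit root `≡ 1 = (ρ'₀)₀₀` and DIST gives a residually distinguished `σ₀` (`Negative.oriented_of_unitRoot_congr_toLocal`), (lev) by
Hida 3.26(3)(a), (mod) by Gelbart.  [BillereyMenares2016 = arXiv:1309.3717 Thm 2.2 p. 7; Hida2000 Thm 3.26; Ribet1976; Gelbart1975;
Carlitz1959 / Washington Ch. 5 (integrality of `B_{k,χ}/k`); von Staudt–Clausen] -/
def S.stub_eisensteinPackageQOdd : Prop :=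

    Literature.NumberTheory.EllipticCurves.BillereyMenares2016_thm22_exists_newform_odd → Literature.NumberTheory.EllipticCurves.Hida2000_thm326_exists_galoisRep →
    Literature.NumberTheory.EllipticCurves.Hida2000_thm326_ordinary_unitRoot → Literature.NumberTheory.EllipticCurves.Hida2000_thm326_inertia_of_level →
    Literature.NumberTheory.EllipticCurves.Gelbart1975_exists_cuspidalRepData_LAlgebraic →
    ∀ (p : ℕ) [Fact p.Prime], p ≠ 2 → ∀ (O : ValuationSubring (PadicAlgCl p)),
      O = (Valued.v : Valuation (PadicAlgCl p) NNReal).valuationSubring →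
      ∀ (η : Field.absoluteGaloisGroup ℚ →ₜ* (PadicAlgCl p)ˣ) (M : ℕ),
      (∀ τ, Valued.v ((η τ : (PadicAlgCl p)ˣ) : PadicAlgCl p) = 1) →
      (∀ c : Field.absoluteGaloisGroup ℚ, Literature.NumberTheory.GaloisRepresentations.IsComplexConjugation (Rat.castHom ℝ) c →
        Valued.v (((η c : (PadicAlgCl p)ˣ) : PadicAlgCl p) + 1) < 1) →
      (∀ w : IsDedekindDomain.HeightOneSpectrum (NumberField.RingOfIntegers ℚ), (p : NumberField.RingOfIntegers ℚ) ∈ w.asIdeal →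
        ∃ 𝔓 ∈ w.primesAbove, ∃ σ : Field.absoluteGaloisGroup ℚ, (∀ x ∈ 𝔓, σ • x ∈ 𝔓) ∧
          ¬ Valued.v (((η σ : (PadicAlgCl p)ˣ) : PadicAlgCl p) - 1) < 1) →
      M.Prime → M ≠ p →
      (∀ w : IsDedekindDomain.HeightOneSpectrum (NumberField.RingOfIntegers ℚ), (M : NumberField.RingOfIntegers ℚ) ∈ w.asIdeal → ∀ 𝔓 ∈ w.primesAbove,
        ∀ σ ∈ 𝔓.inertia (Field.absoluteGaloisGroup ℚ),
          Valued.v (((η σ : (PadicAlgCl p)ˣ) : PadicAlgCl p) - 1) < 1) →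
      (∀ w : IsDedekindDomain.HeightOneSpectrum (NumberField.RingOfIntegers ℚ), (M : NumberField.RingOfIntegers ℚ) ∈ w.asIdeal → ∀ 𝔓 ∈ w.primesAbove,
        ∀ σ : Field.absoluteGaloisGroup ℚ, IsArithFrobAt (NumberField.RingOfIntegers ℚ) σ 𝔓 →
          Valued.v (((η σ : (PadicAlgCl p)ˣ) : PadicAlgCl p) + 1) < 1) →
      M % (p ^ 2) = p ^ 2 - 1 →
      ∃ (k : ℕ) (ρ' : Literature.NumberTheory.GaloisRepresentations.FramedGaloisRep ℚ (PadicAlgCl p) 2)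
        (ρ'₀ : Field.absoluteGaloisGroup ℚ →* Matrix.GeneralLinearGroup (Fin 2) O),
        2 ≤ k ∧ ρ'.toGaloisRep.IsIrreducible ∧ ρ'.HasUpperTriangularIntegralModel ρ'₀ ∧
        (∀ g, ((ρ'₀ g).val 0 0 - 1 : O) ∈ IsLocalRing.maximalIdeal O ∧
          Valued.v (((ρ'₀ g).val 1 1 : PadicAlgCl p) - ((η g : (PadicAlgCl p)ˣ) : PadicAlgCl p)) < 1) ∧
        (∀ w : IsDedekindDomain.HeightOneSpectrum (NumberField.RingOfIntegers ℚ), (p : NumberField.RingOfIntegers ℚ) ∈ w.asIdeal →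
          ∃ Q : Matrix.GeneralLinearGroup (Fin 2) (PadicAlgCl p),
            Valued.v (Q.val 0 0) ≤ Valued.v (Q.val 1 0) ∧
            ∀ σ, (Q⁻¹ * ρ'.toLocal w σ * Q).val 1 0 = 0 ∧
              (σ ∈ Literature.NumberTheory.GaloisRepresentations.absInertia (w.adicCompletion ℚ) →
                (Q⁻¹ * ρ'.toLocal w σ * Q).val 1 1 = 1 ∧
                (Q⁻¹ * ρ'.toLocal w σ * Q).val 0 0 =
                  algebraMap (Padic p) (PadicAlgCl p)
                    (((Literature.NumberTheory.GaloisRepresentations.GaloisRep.cyclotomicCharacter (w.adicCompletion ℚ) p σ).val : PadicInt p) :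
                      Padic p) ^ (k - 1))) ∧
        (∀ w : IsDedekindDomain.HeightOneSpectrum (NumberField.RingOfIntegers ℚ), (M : NumberField.RingOfIntegers ℚ) ∉ w.asIdeal → (p : NumberField.RingOfIntegers ℚ) ∉ w.asIdeal →
          ∀ 𝔓 ∈ w.primesAbove, ∀ σ ∈ 𝔓.inertia (Field.absoluteGaloisGroup ℚ),
            Valued.v (((η σ : (PadicAlgCl p)ˣ) : PadicAlgCl p) - 1) < 1 → ρ' σ = 1) ∧
        ∀ hcpt : Literature.NumberTheory.Automorphic.isCompact_glFiniteIntegralLevel 2 ℚ,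
          ∃ (ι : PadicAlgCl p ≃+* ℂ) (π : Literature.NumberTheory.Automorphic.CuspidalAutomorphicRepData 2 ℚ hcpt) (T : Literature.NumberTheory.Automorphic.InfinityType ℚ 2),
            π.1.HasInfinityType T ∧ T.IsLAlgebraic ∧ T.IsRegular ∧
            ∀ᶠ w in Filter.cofinite, Summit.Langlands.SatakeFrobCompatibleAt ι π.1 ρ' w

/-- **STUB 3 — `restrictTwistGaloisPackage` (Galois-side transport; size M on paper / L in Lean; PROVABLE NOW).**
`F` imaginary quadratic, any `p`, `O = 𝒪_{ℚ̄_p}`; `(ρ, ρ₀)` a continuous `Γ_F → GL₂(ℚ̄_p)` with residually upper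
triangular integral model, unramified a.e., `p`-distinguished at every `v ∣ p` (the crux's data, minus irreducibility
and ordinarity — NOT used); `(η, M, k, ρ', ρ'₀)` as output by STUB 2 (unit-valued continuous `η`, DESCENT relation
`η̄(σ|_ℚ) χ̄_a(σ) = χ̄_b(σ)`, `M` a rational prime INERT in `F`, `k ≥ 2`, `ρ'` irreducible with integral model of
ordered residual diagonal `(1, η̄)`, the oriented ordinary clause over `ℚ_p` with `m = 1`, and (lev)).  THEN, with
`ν :=` the Teichmüller lift of `χ̄_a` (continuous, of finite order `n`, unramified exactly where `χ̄_a` is) and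
`r := ν ⊗ ρ'|_{Γ_F}` (restriction along `absGaloisRestrict ℚ F`; framed by `(r σ) = ν(σ) • ρ'(σ|_ℚ)`),
`r₀ := ν ⊗ ρ'₀|_{Γ_F}`, `q := M𝒪_F` and `S := {v ∣ p} ∪ {q} ∪ {v : χ̄_a or χ̄_b ramified at v}`: `r` is IRREDUCIBLE
(if not, Clifford theory for the index-2 subgroup `Γ_F ⊲ Γ_ℚ` makes `ρ' ≅ Ind_F^ℚ ψ`, so `{ψ̄, ψ̄^c} = {1, χ̄_b/χ̄_a}`
forces `χ̄_b/χ̄_a = 1` on `Γ_F`, against distinguishedness at any `v ∣ p`); `r₀` is an integral model of `r` with the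
SAME ordered residual diagonal as `ρ₀` (`ν̄ · 1 = χ̄_a`, `ν̄ · η̄|_F = χ̄_b`); `r` is oriented-ordinary of the parallel
weight `k` with exponent `m := n` at every `v ∣ p` (the frame `Q` of (ord) transported along `Γ_{F_v} → Γ_F → Γ_ℚ`,
which lands in a decomposition group at `p` conjugate to the image of `Γ_{ℚ_p}` by an element `τ`; conjugating by the
integral residually-Borel matrix `ρ'₀(τ)` keeps the orientation — Disproof §2 `orientation_mul_of_residuallyBorel`, or
directly `Negative.oriented_of_unitRoot_congr` with unit root `≡ ν̄ = χ̄_a` and distinguishedness; `θ₂ = ν` on inertia,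
`θ₂^n = 1`, `θ₁^n = ε^{(k-1)n}`; compatibility of the cyclotomic characters of `ℚ`, `ℚ_p`, `F_v` under the restriction
maps); `S` is finite (`{residually ramified} ⊆ {ρ ramified}`, finite by `hunr`), contains the places above `p`, `r` is
UNRAMIFIED outside `S` (at `v ∉ S`: `v ∤ pM` since `q` is the ONLY place above the inert `M`, and for `σ ∈ I_v`,
`ν(σ) = 1` and `η̄(σ|_ℚ) = (χ̄_b/χ̄_a)(σ) = 1`, so `ρ'(σ|_ℚ) = 1` by (lev) — `σ|_ℚ` lies in an inertia group of `Γ_ℚ`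
above `v ∩ ℚ`), and the crux's LEVEL CLAUSE holds for `S` (a place `v ≠ q`, `v ∤ p` with both residual characters
unramified is not in `S` by definition).  WHY IT MIGHT FAIL: only Lean depth — Teichmüller lifts `κˣ → Oˣ` for
`O = 𝒪_{ℚ̄_p}` (Hensel for prime-to-`p` roots of unity), continuity/finite image of residual characters of a continuous
`ρ`, index-2 image of `absGaloisRestrict ℚ F`, inertia groups under `absGaloisRestrict`; all folklore.
[SkinnerWiles1999 §1; Ribet1976 §2 (lattices); Serre, Abelian ℓ-adic representations I §2.1; Curtis–Reiner §11
(Clifford); triage r1-2 normal form `ε₁ = 1, ν̄ = χ̄_a`] -/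
def S.stub_restrictTwistGaloisPackageNu : Prop :=
  ∀ (F : Type) [Field F] [NumberField F], IsTotallyComplex F → Module.finrank ℚ F = 2 →
    ∀ (p : ℕ) [Fact p.Prime] (O : ValuationSubring (PadicAlgCl p)),
    O = (Valued.v : Valuation (PadicAlgCl p) NNReal).valuationSubring →
    ∀ (ρ : FramedGaloisRep F (PadicAlgCl p) 2)
      (ρ₀ : absoluteGaloisGroup F →* Matrix.GeneralLinearGroup (Fin 2) O),
    (∀ᶠ v in cofinite, ρ.IsUnramifiedAt v) → ρ.HasUpperTriangularIntegralModel ρ₀ →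
    (∀ v : HeightOneSpectrum (𝓞 F), (p : 𝓞 F) ∈ v.asIdeal → IsPDistinguishedAt ρ₀ v) →
    ∀ (η : absoluteGaloisGroup ℚ →ₜ* (PadicAlgCl p)ˣ) (M k : ℕ)
      (ρ' : FramedGaloisRep ℚ (PadicAlgCl p) 2)
      (ρ'₀ : absoluteGaloisGroup ℚ →* Matrix.GeneralLinearGroup (Fin 2) O),
    (∀ τ, Valued.v ((η τ : (PadicAlgCl p)ˣ) : PadicAlgCl p) = 1) →
    (∀ σ : absoluteGaloisGroup F,
      Valued.v (((η (absGaloisRestrict ℚ F σ) : (PadicAlgCl p)ˣ) : PadicAlgCl p) *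
          ((ρ₀ σ).val 0 0 : PadicAlgCl p) - ((ρ₀ σ).val 1 1 : PadicAlgCl p)) < 1) →
    M.Prime → (Ideal.span {(M : 𝓞 F)}).IsPrime → 2 ≤ k →
    ρ'.toGaloisRep.IsIrreducible → ρ'.HasUpperTriangularIntegralModel ρ'₀ →
    (∀ g, ((ρ'₀ g).val 0 0 - 1 : O) ∈ maximalIdeal O ∧
      Valued.v (((ρ'₀ g).val 1 1 : PadicAlgCl p) - ((η g : (PadicAlgCl p)ˣ) : PadicAlgCl p)) < 1) →
    (∀ w : HeightOneSpectrum (𝓞 ℚ), (p : 𝓞 ℚ) ∈ w.asIdeal →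
      ∃ Q : Matrix.GeneralLinearGroup (Fin 2) (PadicAlgCl p),
        Valued.v (Q.val 0 0) ≤ Valued.v (Q.val 1 0) ∧
        ∀ σ, (Q⁻¹ * ρ'.toLocal w σ * Q).val 1 0 = 0 ∧
          (σ ∈ absInertia (w.adicCompletion ℚ) →
            (Q⁻¹ * ρ'.toLocal w σ * Q).val 1 1 = 1 ∧
            (Q⁻¹ * ρ'.toLocal w σ * Q).val 0 0 =
              algebraMap (Padic p) (PadicAlgCl p)
                (((GaloisRep.cyclotomicCharacter (w.adicCompletion ℚ) p σ).val : PadicInt p) :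
                  Padic p) ^ (k - 1))) →
    (∀ w : HeightOneSpectrum (𝓞 ℚ), (M : 𝓞 ℚ) ∉ w.asIdeal → (p : 𝓞 ℚ) ∉ w.asIdeal →
      ∀ 𝔓 ∈ w.primesAbove, ∀ σ ∈ 𝔓.inertia (absoluteGaloisGroup ℚ),
        Valued.v (((η σ : (PadicAlgCl p)ˣ) : PadicAlgCl p) - 1) < 1 → ρ' σ = 1) →
    ∃ (r : FramedGaloisRep F (PadicAlgCl p) 2)
      (r₀ : absoluteGaloisGroup F →* Matrix.GeneralLinearGroup (Fin 2) O)
      (ν : absoluteGaloisGroup F →ₜ* (PadicAlgCl p)ˣ) (q : HeightOneSpectrum (𝓞 F))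
      (S : Set (HeightOneSpectrum (𝓞 F))),
      (∃ n : ℕ, 0 < n ∧ ∀ σ, ν σ ^ n = 1) ∧
      (∀ σ, (r σ).val = ((ν σ : (PadicAlgCl p)ˣ) : PadicAlgCl p) • (ρ' (absGaloisRestrict ℚ F σ)).val) ∧
      r.toGaloisRep.IsIrreducible ∧ r.HasUpperTriangularIntegralModel r₀ ∧
      (∀ g, ((r₀ g).val 0 0 - (ρ₀ g).val 0 0 : O) ∈ maximalIdeal O ∧
        ((r₀ g).val 1 1 - (ρ₀ g).val 1 1 : O) ∈ maximalIdeal O) ∧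
      (∃ k' : ℕ, 2 ≤ k' ∧ ∃ m : ℕ, 0 < m ∧ ∀ v : HeightOneSpectrum (𝓞 F), (p : 𝓞 F) ∈ v.asIdeal →
        ∃ Q : Matrix.GeneralLinearGroup (Fin 2) (PadicAlgCl p),
          Valued.v (Q.val 0 0) ≤ Valued.v (Q.val 1 0) ∧
          ∀ σ, (Q⁻¹ * r.toLocal v σ * Q).val 1 0 = 0 ∧
            (σ ∈ absInertia (v.adicCompletion F) →
              (Q⁻¹ * r.toLocal v σ * Q).val 1 1 ^ m = 1 ∧
              (Q⁻¹ * r.toLocal v σ * Q).val 0 0 ^ m =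
                algebraMap (Padic p) (PadicAlgCl p)
                  (((GaloisRep.cyclotomicCharacter (v.adicCompletion F) p σ).val : PadicInt p) :
                    Padic p) ^ ((k' - 1) * m))) ∧
      S.Finite ∧ (∀ v : HeightOneSpectrum (𝓞 F), (p : 𝓞 F) ∈ v.asIdeal → v ∈ S) ∧
      (∀ v ∉ S, r.IsUnramifiedAt v) ∧
      (∀ v ∉ S, ∀ 𝔓 ∈ v.primesAbove, ∀ σ ∈ 𝔓.inertia (absoluteGaloisGroup F), ν σ = 1) ∧
      (∀ v : HeightOneSpectrum (𝓞 F), v ≠ q → (p : 𝓞 F) ∉ v.asIdeal →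
        (∀ 𝔓 ∈ v.primesAbove, ∀ σ ∈ 𝔓.inertia (absoluteGaloisGroup F),
          ((ρ₀ σ).val 0 0 - 1 : O) ∈ maximalIdeal O ∧ ((ρ₀ σ).val 1 1 - 1 : O) ∈ maximalIdeal O) →
        v ∉ S)

/-- **STUB 4 — `quadraticBaseChangeTwist` (Langlands' quadratic base change for `GL₂` with local–global
compatibility away from `p`, plus a finite-order twist; theorem-grade in print, size XL in Lean — the tree has cyclic
base change only as the NAMED weak-lifting fact `ArthurClozel1989_weakLifting_cuspidal`).**  `F` imaginary quadratic,
`p` any prime, `ι : ℚ̄_p ≃ ℂ`; `π` a cuspidal automorphic representation of `GL₂(𝔸_ℚ)` with a REGULAR L-ALGEBRAIC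
infinity type, Satake–Frobenius compatible with a continuous `ρ' : Γ_ℚ → GL₂(ℚ̄_p)` at all but finitely many places;
`ν : Γ_F → ℚ̄_pˣ` continuous of finite order; `r := ν ⊗ ρ'|_{Γ_F}` IRREDUCIBLE; `S ⊇ {v ∣ p}` finite with `r`
unramified outside `S`.  THEN there is a cuspidal automorphic `Π` on `GL₂(𝔸_F)` with a regular L-algebraic infinity type
such that `SatakeFrobCompatibleAt ι Π r v` at EVERY `v ∉ S` (so `Π_v` is unramified wherever `r` is, `v ∤ p`).
Intended proof: `ρ'` is irreducible (as `r` is), hence `ρ' ≅ ρ_{π,ι}` (Chebotarev + Brauer–Nesbitt from a.e.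
compatibility); `π ≇ π ⊗ ε_F` (else `tr ρ'` vanishes on the inert Frobenii, `ρ' ≅ ρ' ⊗ ε_F`, `ρ'|_{Γ_F}` reducible);
so the base change `BC_{F/ℚ}(π)` is CUSPIDAL (Langlands1980; ArthurClozelAMS120 Ch. 3 Thm 4.2 (a) = the
tree's named fact `ArthurClozel1989_weakLifting_cuspidal`), regular L-algebraic (`InfinityType.baseChange`), and `Π := BC(π) ⊗ ν_𝔸`
(`ν_𝔸` the finite-order Hecke character of `ν` by class field theory, `twistByFiniteOrderChar`) has Galois representation
`r`; local–global compatibility at every `v ∤ p` (Carayol for `π`, compatibility of local base change with restriction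
of `L`-parameters, LLC for `GL₂`) gives: `r` unramified at `v` ⇒ `Π_v` unramified with Satake parameter matching
`r(Frob_v)` in the normalisation of `SatakeFrobCompatibleAt` (at an inert `v`, Frobenius `= Frob_w^2` and Satake
parameters square: the tree's `hasFrobCharpolyAt_restrictField_fin_two` bookkeeping).  WHY IT MIGHT FAIL: it is the
STRONG (all places `∤ p`) form of base change that is needed at the finitely many `v ∉ S` below ramified places of `π`
where `r` is nevertheless unramified (`ℓ ∣ d_F` with `ε`-type ramification, or ramification killed by the twist) — in
print for `GL₂` (Langlands 1980 proves the local identities everywhere), but not vendored.  [Langlands1980 (Base change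
for GL(2)); ArthurClozelAMS120 Ch. 3 Thms 4.2, 5.1; Carayol1986; BuzzardGeeLMS2014 §3 (normalisations)] -/
def S.stub_quadraticBaseChangeTwist : Prop :=  -- (v4d: fact-free; discharged from the route crux QuadraticBaseChangeGalois)
  ∀ (F : Type) [Field F] [NumberField F], IsTotallyComplex F → Module.finrank ℚ F = 2 →
    ∀ (p : ℕ) [Fact p.Prime] (hcptQ : isCompact_glFiniteIntegralLevel 2 ℚ) (ι : PadicAlgCl p ≃+* ℂ)
      (π : CuspidalAutomorphicRepData 2 ℚ hcptQ) (T : InfinityType ℚ 2),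
    π.1.HasInfinityType T → T.IsLAlgebraic → T.IsRegular →
    ∀ (ρ' : FramedGaloisRep ℚ (PadicAlgCl p) 2),
    (∀ᶠ w in cofinite, Summit.Langlands.SatakeFrobCompatibleAt ι π.1 ρ' w) →
    ∀ (ν : absoluteGaloisGroup F →ₜ* (PadicAlgCl p)ˣ), (∃ n : ℕ, 0 < n ∧ ∀ σ, ν σ ^ n = 1) →
    ∀ (r : FramedGaloisRep F (PadicAlgCl p) 2),
    (∀ σ, (r σ).val = ((ν σ : (PadicAlgCl p)ˣ) : PadicAlgCl p) • (ρ' (absGaloisRestrict ℚ F σ)).val) →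
    r.toGaloisRep.IsIrreducible →
    ∀ (S : Set (HeightOneSpectrum (𝓞 F))), S.Finite →
    (∀ v : HeightOneSpectrum (𝓞 F), (p : 𝓞 F) ∈ v.asIdeal → v ∈ S) →
    (∀ v ∉ S, r.IsUnramifiedAt v) →
    (∀ v ∉ S, ∀ 𝔓 ∈ v.primesAbove, ∀ σ ∈ 𝔓.inertia (absoluteGaloisGroup F), ν σ = 1) →
    ∀ hcptF : isCompact_glFiniteIntegralLevel 2 F,
      ∃ (πF : CuspidalAutomorphicRepData 2 F hcptF) (T' : InfinityType F 2),
        πF.1.HasInfinityType T' ∧ T'.IsLAlgebraic ∧ T'.IsRegular ∧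
        ∀ v ∉ S, Summit.Langlands.SatakeFrobCompatibleAt ι πF.1 r v

/-- **STUB 5 — `cuspidalCohomologicalPoint` (the DICTIONARY D1, classical ⇒ `p`-adic point; shared by every line of
this crux and, reversed, by the exit crux; theorem-grade in print, size L–XL in Lean).**  `F` imaginary quadratic, `p`
any prime, `ι : ℚ̄_p ≃ ℂ`; `Π` a CUSPIDAL automorphic representation of `GL₂(𝔸_F)` with a REGULAR L-ALGEBRAIC
infinity type; `S ⊇ {v ∣ p}` a finite set of finite places; `r : Γ_F → GL₂(ℚ̄_p)` continuous with
`SatakeFrobCompatibleAt ι Π r v` for every `v ∉ S` (so `Π_v` and `r` are unramified off `S` and the arithmetic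
Frobenius of `r` at `v` has characteristic polynomial `∏ (X - ι⁻¹(α_j⁻¹))`).  THEN there is a tame level
`𝒰 : TameLevel 2 F p` with `𝒰.bad = S` such that `r` is `p`-adically automorphic of level `𝒰`: a CONTINUOUS ring map
`x : 𝕋(𝒰) → ℚ̄_p` with `charpoly r(Frob_v) = X² - x(T_{v,1})X + q_v x(T_{v,2})` for `v ∉ S`.  Intended proof:
`U := ∏_{v ∈ S, v ∤ p} K_v(c_v) × ∏_{v ∉ S or v ∣ p} GL₂(𝒪_v)` with `c_v ≥` the conductor exponent of `Π_v` is an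
`S`-good `TameLevel` with `bad = S`; `Π' := Π^∨ ⊗ |det|^{1/2}` is regular C-algebraic, i.e. COHOMOLOGICAL (Clozel1990
Lemme 3.14), so by Eichler–Shimura–Harder (Harder1987; Franke1998 / Borel for the comparison with `(𝔤,K)`-cohomology;
cuspidal ⇒ interior) its finite part contributes to `H^i(X_{U_r}, V_λ ⊗ ℂ)`, `i ∈ {1,2}`, with `U_r`-fixed vectors
(`r` large absorbs the level of `Π` at `p`); its spherical eigenvalues are algebraic integers, `t_{v,1} = q_v^{1/2}
e₁(α⁻¹q_v^{-1/2})·… = e₁(α⁻¹)`, `q_v t_{v,2} = e₂(α⁻¹)` — exactly the normalisation of `IsAssociated`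
(`heckeFrobPoly`; `Negative.BorelAndEisenstein.trace_det_of_charpoly_eq_heckeFrobPoly`); transporting by `ι⁻¹`,
reducing the integral lattice `V_λ(𝒪)` modulo `p^s` and trivialising it on the principal congruence subgroup of level
`p^s` at `v ∣ p` puts the reduced eigensystem in `H^i(X_{U_{r'}}, ℤ/p^s)` for `r' ≫ s` (Emerton2006 §2.2,
"completed cohomology sees all weights"; Scholze2015 §V.4 at finite level), compatibly in `(r', s)`, whence a continuous
`x : 𝕋(𝒰) = closure of the spherical algebra in ∏ End(H^i(X_{U_r}, ℤ/p^s)) → 𝒪 ⊂ ℚ̄_p`.  WHY IT MIGHT FAIL: only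
Lean depth (no Eichler–Shimura–Harder / Franke comparison for the tree's `levelCohomology`, no local systems `V_λ` on the
group-cohomology model, integrality of cohomological eigensystems); mathematically folklore.  [Harder1987; Franke1998;
Clozel1990 §3; Emerton2006 §2.2–2.3; Scholze2015 §V.4; GeeNewton2020 §2.1–§3.3; CalegariEmerton2011 §2;
triage r1-3 cross-cutting note 2 (file D1 once)] -/
def S.stub_cuspidalCohomologicalPoint : Prop :=
  Literature.NumberTheory.Automorphic.bianchi_cuspidal_regularLAlgebraic_eigenclassExists →
  Literature.NumberTheory.Automorphic.algebraicWeightEigenclass_continuousPoint →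
  ∀ (F : Type) [Field F] [NumberField F], IsTotallyComplex F → Module.finrank ℚ F = 2 →
    ∀ (p : ℕ) [Fact p.Prime] (hcpt : isCompact_glFiniteIntegralLevel 2 F) (ι : PadicAlgCl p ≃+* ℂ)
      (πF : CuspidalAutomorphicRepData 2 F hcpt) (T : InfinityType F 2),
    πF.1.HasInfinityType T → T.IsLAlgebraic → T.IsRegular →
    ∀ (S : Set (HeightOneSpectrum (𝓞 F))), S.Finite →
    (∀ v : HeightOneSpectrum (𝓞 F), (p : 𝓞 F) ∈ v.asIdeal → v ∈ S) →
    ∀ (r : FramedGaloisRep F (PadicAlgCl p) 2),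
    (∀ v ∉ S, Summit.Langlands.SatakeFrobCompatibleAt ι πF.1 r v) →
    ∃ 𝒰 : TameLevel 2 F p, 𝒰.bad = S ∧ 𝒰.IsPadicallyAutomorphic r

/-- **HasCousin** (`5 ≤ p` ∧ a twist-free COUSIN of the datum `ρ₀`, big-image-cousin's `Cousin` verbatim plus ellipticity):
an elliptic curve `E/F` with `P, Q ∈ E[p]`, `⟨P⟩` Galois-stable realising the residual pair ON THE NOSE (`σP = aP`, `σQ = bP + dQ`,
`(ρ₀σ)₀₀ ≡ a`, `(ρ₀σ)₁₁ ≡ d`), `P` inertia-fixed and `E` of good reduction at every `v ∣ p`, good reduction at every residually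
unramified `v ≠ q`, `v ∤ p` (ONE auxiliary place `q`), `SL₂(𝔽₃) ⊆ im ρ̄_{E,3}` (Caraiani–Newton Cor 6.1.1 input) and `V_pE`
irreducible.  [folklore; card big-image-cousin] -/
def HasCousin (F : Type) [Field F] [NumberField F] (p : ℕ) [Fact p.Prime]
    (O : ValuationSubring (PadicAlgCl p))
    (ρ₀ : absoluteGaloisGroup F →* Matrix.GeneralLinearGroup (Fin 2) O) : Prop :=
  5 ≤ p ∧ ∃ (E : WeierstrassCurve F) (_ : E.IsElliptic) (P Q : E.geomTorsion p) (q : IsDedekindDomain.HeightOneSpectrum (NumberField.RingOfIntegers F)),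
        P ≠ 0 ∧ (∀ a : ℤ, Q ≠ a • P) ∧
        (∀ σ : Field.absoluteGaloisGroup F, ∃ a b d : ℤ, σ • P = a • P ∧ σ • Q = b • P + d • Q ∧
          ((ρ₀ σ).val 0 0 - a : O) ∈ IsLocalRing.maximalIdeal O ∧ ((ρ₀ σ).val 1 1 - d : O) ∈ IsLocalRing.maximalIdeal O) ∧
        (∀ v : IsDedekindDomain.HeightOneSpectrum (NumberField.RingOfIntegers F), (p : NumberField.RingOfIntegers F) ∈ v.asIdeal →
          (∀ 𝔓 ∈ v.primesAbove, ∀ σ ∈ 𝔓.inertia (Field.absoluteGaloisGroup F), σ • P = P) ∧ E.HasGoodReductionAt v) ∧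
        (∀ v : IsDedekindDomain.HeightOneSpectrum (NumberField.RingOfIntegers F), v ≠ q → (p : NumberField.RingOfIntegers F) ∉ v.asIdeal →
          (∀ 𝔓 ∈ v.primesAbove, ∀ σ ∈ 𝔓.inertia (Field.absoluteGaloisGroup F),
            ((ρ₀ σ).val 0 0 - 1 : O) ∈ IsLocalRing.maximalIdeal O ∧ ((ρ₀ σ).val 1 1 - 1 : O) ∈ IsLocalRing.maximalIdeal O) →
          E.HasGoodReductionAt v) ∧
        (∃ ρ₃ : Literature.NumberTheory.GaloisRepresentations.FramedGaloisRep F (ZMod 3) 2, E.IsTorsionGaloisRep 3 ρ₃ ∧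
          ∀ g : Matrix.SpecialLinearGroup (Fin 2) (ZMod 3), ∃ σ, ρ₃ σ = Matrix.SpecialLinearGroup.toGL g) ∧
        (E.framedTateGaloisRep p).toGaloisRep.IsIrreducible

/-- **STUB S7a — `cousinGaloisPackage` (GRAFT of big-image-cousin K2, Galois side; size L; conditional on the
Serre–Tate / ordinary-structure facts for `T_pE` at good ordinary places).**  From cousin data `(E, P, Q, q)` of `ρ₀`:
`r := V_pE` framed on a `ℤ_p`-basis of `T_pE` lifting `(P, Q)` (a conjugate `Pfr·ρ_{E,p}·Pfr⁻¹` of the tree's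
`E.framedTateGaloisRep p`), its integral model `r₀ ∈ GL₂(ℤ_p) ⊆ GL₂(O)` residually upper triangular with the ordered diagonal of
`ρ₀` (the two congruences of the cousin datum), `r` irreducible (transport of `V_pE` irreducible along `FramedRep.conj`),
ORIENTED-ordinary of weight `(k', m') = (2, 1)` at every `v ∣ p` (good + `P` inertia-fixed ⟹ ordinary [Serre 1972 Prop 12];
inertia acts by `ε` on `T_p(Ê)` and trivially on the étale quotient [Serre 1972 §1.11 / Silverman VII + formal groups]; the
connected line reduces to `E[p]⁰ ≠ ⟨P̄⟩` since `ω|_{I_v} ≠ 1` (`e ≤ 2 < p - 1`), so in the frame `(P̃, Q̃)` its primitive generator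
`(α, β)` has `β ∈ ℤ_pˣ`: `‖Q₀₀‖ ≤ ‖Q₁₀‖` — equivalently the landed `Negative.oriented_of_unitRoot_congr_toLocal` with unit root `≡
χ̄_a`), `S := {v ∣ p} ∪ {q} ∪ {residually ramified places of ρ₀}` finite (the residual characters of `ρ₀` are those of `E[p]`,
ramified only at bad places of `E` and `v ∣ p`), `r` unramified and `E` good off `S` (`isUnramifiedAt_framedTateGaloisRep`), and
the level clause by definition of `S`. [Serre1972 §1.11–1.12; SilvermanAEC2009 VII; card big-image-cousin K2] -/
def S.stub_cousinGaloisPackage : Prop :=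
  Literature.NumberTheory.EllipticCurves.ellipticOrdinaryReduction_tateModule_filtration →
  Literature.NumberTheory.EllipticCurves.ordinaryReduction_of_inertiaFixed_pTorsion →
    ∀ (F : Type) [Field F] [NumberField F], NumberField.IsTotallyComplex F → Module.finrank ℚ F = 2 →
      ∀ (p : ℕ) [Fact p.Prime], 5 ≤ p → ∀ (O : ValuationSubring (PadicAlgCl p)),
      O = (Valued.v : Valuation (PadicAlgCl p) NNReal).valuationSubring →
      ∀ (ρ₀ : Field.absoluteGaloisGroup F →* Matrix.GeneralLinearGroup (Fin 2) O)
        (E : WeierstrassCurve F) [E.IsElliptic] (P Q : E.geomTorsion p) (q : IsDedekindDomain.HeightOneSpectrum (NumberField.RingOfIntegers F)),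
      P ≠ 0 → (∀ a : ℤ, Q ≠ a • P) →
      (∀ σ : Field.absoluteGaloisGroup F, ∃ a b d : ℤ, σ • P = a • P ∧ σ • Q = b • P + d • Q ∧
          ((ρ₀ σ).val 0 0 - a : O) ∈ IsLocalRing.maximalIdeal O ∧ ((ρ₀ σ).val 1 1 - d : O) ∈ IsLocalRing.maximalIdeal O) →
      (∀ v : IsDedekindDomain.HeightOneSpectrum (NumberField.RingOfIntegers F), (p : NumberField.RingOfIntegers F) ∈ v.asIdeal →
          (∀ 𝔓 ∈ v.primesAbove, ∀ σ ∈ 𝔓.inertia (Field.absoluteGaloisGroup F), σ • P = P) ∧ E.HasGoodReductionAt v) →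
      (∀ v : IsDedekindDomain.HeightOneSpectrum (NumberField.RingOfIntegers F), v ≠ q → (p : NumberField.RingOfIntegers F) ∉ v.asIdeal →
          (∀ 𝔓 ∈ v.primesAbove, ∀ σ ∈ 𝔓.inertia (Field.absoluteGaloisGroup F),
            ((ρ₀ σ).val 0 0 - 1 : O) ∈ IsLocalRing.maximalIdeal O ∧ ((ρ₀ σ).val 1 1 - 1 : O) ∈ IsLocalRing.maximalIdeal O) →
          E.HasGoodReductionAt v) →
      (E.framedTateGaloisRep p).toGaloisRep.IsIrreducible →
      ∃ (r : Literature.NumberTheory.GaloisRepresentations.FramedGaloisRep F (PadicAlgCl p) 2)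
        (r₀ : Field.absoluteGaloisGroup F →* Matrix.GeneralLinearGroup (Fin 2) O)
        (Pfr : Matrix.GeneralLinearGroup (Fin 2) (PadicAlgCl p)) (S : Set (IsDedekindDomain.HeightOneSpectrum (NumberField.RingOfIntegers F))),
        r = Literature.NumberTheory.GaloisRepresentations.FramedRep.conj Pfr (E.framedTateGaloisRep p) ∧
        r.toGaloisRep.IsIrreducible ∧ r.HasUpperTriangularIntegralModel r₀ ∧
        (∀ g, ((r₀ g).val 0 0 - (ρ₀ g).val 0 0 : O) ∈ IsLocalRing.maximalIdeal O ∧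
          ((r₀ g).val 1 1 - (ρ₀ g).val 1 1 : O) ∈ IsLocalRing.maximalIdeal O) ∧
        (∃ k : ℕ, 2 ≤ k ∧ ∃ m : ℕ, 0 < m ∧ ∀ v : IsDedekindDomain.HeightOneSpectrum (NumberField.RingOfIntegers F), (p : NumberField.RingOfIntegers F) ∈ v.asIdeal →
          ∃ Q : Matrix.GeneralLinearGroup (Fin 2) (PadicAlgCl p),
            Valued.v (Q.val 0 0) ≤ Valued.v (Q.val 1 0) ∧
            ∀ σ, (Q⁻¹ * r.toLocal v σ * Q).val 1 0 = 0 ∧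
              (σ ∈ Literature.NumberTheory.GaloisRepresentations.absInertia (v.adicCompletion F) →
                (Q⁻¹ * r.toLocal v σ * Q).val 1 1 ^ m = 1 ∧
                (Q⁻¹ * r.toLocal v σ * Q).val 0 0 ^ m =
                  algebraMap (Padic p) (PadicAlgCl p)
                    (((Literature.NumberTheory.GaloisRepresentations.GaloisRep.cyclotomicCharacter (v.adicCompletion F) p σ).val : PadicInt p) :
                      Padic p) ^ ((k - 1) * m))) ∧
        S.Finite ∧ (∀ v : IsDedekindDomain.HeightOneSpectrum (NumberField.RingOfIntegers F), (p : NumberField.RingOfIntegers F) ∈ v.asIdeal → v ∈ S) ∧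
        (∀ v ∉ S, r.IsUnramifiedAt v) ∧ (∀ v ∉ S, E.HasGoodReductionAt v) ∧
        (∀ v : IsDedekindDomain.HeightOneSpectrum (NumberField.RingOfIntegers F), v ≠ q → (p : NumberField.RingOfIntegers F) ∉ v.asIdeal →
          (∀ 𝔓 ∈ v.primesAbove, ∀ σ ∈ 𝔓.inertia (Field.absoluteGaloisGroup F),
            ((ρ₀ σ).val 0 0 - 1 : O) ∈ IsLocalRing.maximalIdeal O ∧ ((ρ₀ σ).val 1 1 - 1 : O) ∈ IsLocalRing.maximalIdeal O) →
          v ∉ S)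

/-- **STUB S7b — `cousinAutomorphic` (GRAFT of big-image-cousin S + the automorphic half of K2; size M modulo ONE named
fact: Caraiani–Newton 2023 Cor 6.1.1(1)/Thm 7.1(2), arXiv:2301.10509 pp. 87, 91 — every `E/F`, `F` imaginary quadratic, with
`SL₂(𝔽₃) ⊆ im ρ̄_{E,3}` is MODULAR, read with local–global compatibility at the good places: a cuspidal `π` of parallel weight 2,
i.e. of the regular L-algebraic infinity type, Satake–Frobenius compatible with `V_pE` at EVERY good `w ∤ p`).**  For such `E`,
`ι`, a frame-conjugate `r` of `E.framedTateGaloisRep p` and a finite `S ⊇ {v ∣ p}` off which `E` has good reduction: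
`∀ hcpt, ∃ πF T'`, regular L-algebraic, with `SatakeFrobCompatibleAt ι πF r v` at every `v ∉ S` (conj-invariance of
`IsUnramifiedAt`/`HasFrobCharpolyAt`: `isUnramifiedAt_conj_iff`, `hasFrobCharpolyAt_framedTateGaloisRep_iff`; normalisation
`X² - a_wX + q_w` = `arithFrobPolyOfSatake ι q 1 α`, cf. `IsModularEllipticCurve`, `CaraianiNewton2023_modularity` which is the
weaker all-curves-when-`X₀(15)(F)`-finite fact). [CaraianiNewton2023 Cor 6.1.1, Thm 7.1; card big-image-cousin S/K2] -/
def S.stub_cousinAutomorphic : Prop :=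
  Literature.NumberTheory.Automorphic.CaraianiNewton2023_cor611_modular →
    ∀ (F : Type) [Field F] [NumberField F], NumberField.IsTotallyComplex F → Module.finrank ℚ F = 2 →
      ∀ (p : ℕ) [Fact p.Prime] (ι : PadicAlgCl p ≃+* ℂ) (E : WeierstrassCurve F) [E.IsElliptic],
      (∃ ρ₃ : Literature.NumberTheory.GaloisRepresentations.FramedGaloisRep F (ZMod 3) 2, E.IsTorsionGaloisRep 3 ρ₃ ∧
          ∀ g : Matrix.SpecialLinearGroup (Fin 2) (ZMod 3), ∃ σ, ρ₃ σ = Matrix.SpecialLinearGroup.toGL g) →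
      ∀ (r : Literature.NumberTheory.GaloisRepresentations.FramedGaloisRep F (PadicAlgCl p) 2)
        (Pfr : Matrix.GeneralLinearGroup (Fin 2) (PadicAlgCl p)),
      r = Literature.NumberTheory.GaloisRepresentations.FramedRep.conj Pfr (E.framedTateGaloisRep p) →
      ∀ (S : Set (IsDedekindDomain.HeightOneSpectrum (NumberField.RingOfIntegers F))), S.Finite →
      (∀ v : IsDedekindDomain.HeightOneSpectrum (NumberField.RingOfIntegers F), (p : NumberField.RingOfIntegers F) ∈ v.asIdeal → v ∈ S) →
      (∀ v ∉ S, E.HasGoodReductionAt v) →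
      ∀ hcpt : Literature.NumberTheory.Automorphic.isCompact_glFiniteIntegralLevel 2 F,
        ∃ (πF : Literature.NumberTheory.Automorphic.CuspidalAutomorphicRepData 2 F hcpt) (T' : Literature.NumberTheory.Automorphic.InfinityType F 2),
          πF.1.HasInfinityType T' ∧ T'.IsLAlgebraic ∧ T'.IsRegular ∧
          ∀ v ∉ S, Summit.Langlands.SatakeFrobCompatibleAt ι πF.1 r v

/-- **HasTwistedCousin** (v5; `5 ≤ p` ∧ a cousin UP TO A FINITE-ORDER TWIST).  A continuous finite-order character
`ν : Γ_F → ℚ̄_pˣ` (`ν^n = 1`), the untwisted residual datum `ρ₀' = ν⁻¹ ρ₀` (given explicitly, entrywise: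
`(ρ₀ σ)ᵢⱼ = ν(σ) (ρ₀' σ)ᵢⱼ`), and a cousin `(E, P, Q, q)` of `ρ₀'` in the sense of `HasCousin` (the pair of `ρ₀'` is
realised ON THE NOSE by `E[p] ⊇ ⟨P⟩`, `P` inertia-fixed and `E` good at `v ∣ p`, `E` good at the residually-unramified
places `≠ q` of `ρ₀'`, `SL₂(𝔽₃) ⊆ im ρ̄_{E,3}`, `V_pE` irreducible), with `ν` UNRAMIFIED at every residually-unramified place
`v ≠ q`, `v ∤ p` of `ρ₀` (so that the one-`q` level clause survives the twist).  `HasCousin` is the case `ν = 1`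
(`hasTwistedCousin_of_hasCousin`).  The seed for such data is `r = ν ⊗ V_pE` (S7a + S7c) with `πF = π_E ⊗ (χ_ν ∘ det)`
(S7b + S7d) and the dictionary S5.  [folklore; card big-image-cousin P2 "twist-needing elliptic data"] -/
def HasTwistedCousin (F : Type) [Field F] [NumberField F] (p : ℕ) [Fact p.Prime]
    (O : ValuationSubring (PadicAlgCl p))
    (ρ₀ : absoluteGaloisGroup F →* Matrix.GeneralLinearGroup (Fin 2) O) : Prop :=
  5 ≤ p ∧ ∃ (ν : Field.absoluteGaloisGroup F →ₜ* (PadicAlgCl p)ˣ) (n : ℕ)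
      (ρ₀' : Field.absoluteGaloisGroup F →* Matrix.GeneralLinearGroup (Fin 2) O)
      (E : WeierstrassCurve F) (_ : E.IsElliptic) (P Q : E.geomTorsion p) (q : IsDedekindDomain.HeightOneSpectrum (NumberField.RingOfIntegers F)),
        0 < n ∧ (∀ σ, ν σ ^ n = 1) ∧
        (∀ σ (i j : Fin 2), ((ρ₀ σ).val i j : PadicAlgCl p) = ((ν σ : (PadicAlgCl p)ˣ) : PadicAlgCl p) * ((ρ₀' σ).val i j : PadicAlgCl p)) ∧
        P ≠ 0 ∧ (∀ a : ℤ, Q ≠ a • P) ∧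
        (∀ σ : Field.absoluteGaloisGroup F, ∃ a b d : ℤ, σ • P = a • P ∧ σ • Q = b • P + d • Q ∧
          ((ρ₀' σ).val 0 0 - a : O) ∈ IsLocalRing.maximalIdeal O ∧ ((ρ₀' σ).val 1 1 - d : O) ∈ IsLocalRing.maximalIdeal O) ∧
        (∀ v : IsDedekindDomain.HeightOneSpectrum (NumberField.RingOfIntegers F), (p : NumberField.RingOfIntegers F) ∈ v.asIdeal →
          (∀ 𝔓 ∈ v.primesAbove, ∀ σ ∈ 𝔓.inertia (Field.absoluteGaloisGroup F), σ • P = P) ∧ E.HasGoodReductionAt v) ∧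
        (∀ v : IsDedekindDomain.HeightOneSpectrum (NumberField.RingOfIntegers F), v ≠ q → (p : NumberField.RingOfIntegers F) ∉ v.asIdeal →
          (∀ 𝔓 ∈ v.primesAbove, ∀ σ ∈ 𝔓.inertia (Field.absoluteGaloisGroup F),
            ((ρ₀' σ).val 0 0 - 1 : O) ∈ IsLocalRing.maximalIdeal O ∧ ((ρ₀' σ).val 1 1 - 1 : O) ∈ IsLocalRing.maximalIdeal O) →
          E.HasGoodReductionAt v) ∧
        (∃ ρ₃ : Literature.NumberTheory.GaloisRepresentations.FramedGaloisRep F (ZMod 3) 2, E.IsTorsionGaloisRep 3 ρ₃ ∧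
          ∀ g : Matrix.SpecialLinearGroup (Fin 2) (ZMod 3), ∃ σ, ρ₃ σ = Matrix.SpecialLinearGroup.toGL g) ∧
        (E.framedTateGaloisRep p).toGaloisRep.IsIrreducible ∧
        (∀ v : IsDedekindDomain.HeightOneSpectrum (NumberField.RingOfIntegers F), v ≠ q → (p : NumberField.RingOfIntegers F) ∉ v.asIdeal →
          (∀ 𝔓 ∈ v.primesAbove, ∀ σ ∈ 𝔓.inertia (Field.absoluteGaloisGroup F),
            ((ρ₀ σ).val 0 0 - 1 : O) ∈ IsLocalRing.maximalIdeal O ∧ ((ρ₀ σ).val 1 1 - 1 : O) ∈ IsLocalRing.maximalIdeal O) →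
          ∀ 𝔓 ∈ v.primesAbove, ∀ σ ∈ 𝔓.inertia (Field.absoluteGaloisGroup F), ν σ = 1)

/-- **HasWideCousin** (v6; a twisted cousin certified by Caraiani–Newton Cor. 6.1.1 AS PRINTED, at any odd `p`).  As `HasTwistedCousin`
but (i) `5 ≤ p` is replaced by the two LOCAL facts the Galois package actually uses at each `v ∣ p` — `e(v ∣ p) < p - 1` (Mathlib
`Ideal.ramificationIdx`) and `ω|_{I_v} ≠ 1` (an element of the local inertia group on which the cyclotomic character is `≢ 1 mod p`) — both
automatic for `p ≥ 5` over a quadratic field (landed: `Cousin.ramificationIdx_le_finrank_rat`,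
`Cousin.exists_mem_absInertia_toZModPow_cyclotomicCharacter_ne_one`) and true at `p = 3` iff `3` is unramified in `F`; (ii) the cousin `E` is
non-CM with `ρ̄_{E,3}|_{G_{F(ζ₃)}}` OR `ρ̄_{E,5}|_{G_{F(ζ₅)}}` absolutely irreducible (`ModPImageAbsIrreducibleOverCyclotomic E 3 ∨ … E 5`,
hypotheses (1)/(2) of Cor. 6.1.1 verbatim) instead of `SL₂(𝔽₃) ⊆ im ρ̄_{E,3}`.  Seeds: S7e + S7c + S7f + S7d + S5. [folklore] -/
def HasWideCousin (F : Type) [Field F] [NumberField F] (p : ℕ) [Fact p.Prime]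
    (O : ValuationSubring (PadicAlgCl p))
    (ρ₀ : absoluteGaloisGroup F →* Matrix.GeneralLinearGroup (Fin 2) O) : Prop :=
  ∃ (ν : Field.absoluteGaloisGroup F →ₜ* (PadicAlgCl p)ˣ) (n : ℕ)
      (ρ₀' : Field.absoluteGaloisGroup F →* Matrix.GeneralLinearGroup (Fin 2) O)
      (E : WeierstrassCurve F) (_ : E.IsElliptic) (P Q : E.geomTorsion p) (q : IsDedekindDomain.HeightOneSpectrum (NumberField.RingOfIntegers F)),
        0 < n ∧ (∀ σ, ν σ ^ n = 1) ∧
        (∀ σ (i j : Fin 2), ((ρ₀ σ).val i j : PadicAlgCl p) = ((ν σ : (PadicAlgCl p)ˣ) : PadicAlgCl p) * ((ρ₀' σ).val i j : PadicAlgCl p)) ∧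
        P ≠ 0 ∧ (∀ a : ℤ, Q ≠ a • P) ∧
        (∀ σ : Field.absoluteGaloisGroup F, ∃ a b d : ℤ, σ • P = a • P ∧ σ • Q = b • P + d • Q ∧
          ((ρ₀' σ).val 0 0 - a : O) ∈ IsLocalRing.maximalIdeal O ∧ ((ρ₀' σ).val 1 1 - d : O) ∈ IsLocalRing.maximalIdeal O) ∧
        (∀ v : IsDedekindDomain.HeightOneSpectrum (NumberField.RingOfIntegers F), (p : NumberField.RingOfIntegers F) ∈ v.asIdeal →
          (∀ 𝔓 ∈ v.primesAbove, ∀ σ ∈ 𝔓.inertia (Field.absoluteGaloisGroup F), σ • P = P) ∧ E.HasGoodReductionAt v ∧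
          v.asIdeal.ramificationIdx ℤ < p - 1 ∧
          ∃ σ ∈ Literature.NumberTheory.GaloisRepresentations.absInertia (v.adicCompletion F),
            PadicInt.toZModPow 1 ((Literature.NumberTheory.GaloisRepresentations.GaloisRep.cyclotomicCharacter (v.adicCompletion F) p σ : ℤ_[p]ˣ) : ℤ_[p]) ≠ 1) ∧
        (∀ v : IsDedekindDomain.HeightOneSpectrum (NumberField.RingOfIntegers F), v ≠ q → (p : NumberField.RingOfIntegers F) ∉ v.asIdeal →
          (∀ 𝔓 ∈ v.primesAbove, ∀ σ ∈ 𝔓.inertia (Field.absoluteGaloisGroup F),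
            ((ρ₀' σ).val 0 0 - 1 : O) ∈ IsLocalRing.maximalIdeal O ∧ ((ρ₀' σ).val 1 1 - 1 : O) ∈ IsLocalRing.maximalIdeal O) →
          E.HasGoodReductionAt v) ∧
        ¬ E.HasCM ∧
        (Literature.NumberTheory.Automorphic.ModPImageAbsIrreducibleOverCyclotomic E 3 ∨
          @Literature.NumberTheory.Automorphic.ModPImageAbsIrreducibleOverCyclotomic F _ E 5 ⟨Nat.prime_five⟩) ∧
        (E.framedTateGaloisRep p).toGaloisRep.IsIrreducible ∧
        (∀ v : IsDedekindDomain.HeightOneSpectrum (NumberField.RingOfIntegers F), v ≠ q → (p : NumberField.RingOfIntegers F) ∉ v.asIdeal →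
          (∀ 𝔓 ∈ v.primesAbove, ∀ σ ∈ 𝔓.inertia (Field.absoluteGaloisGroup F),
            ((ρ₀ σ).val 0 0 - 1 : O) ∈ IsLocalRing.maximalIdeal O ∧ ((ρ₀ σ).val 1 1 - 1 : O) ∈ IsLocalRing.maximalIdeal O) →
          ∀ 𝔓 ∈ v.primesAbove, ∀ σ ∈ 𝔓.inertia (Field.absoluteGaloisGroup F), ν σ = 1)

/-- **STUB S7c — `twistGaloisTransport` (v5; pure frame algebra, size M; provable now, no named fact).**  Transport of a
Galois package along a finite-order scalar twist.  Data: `ρ₀ = ν · ρ₀'` entrywise (`ν : Γ_F → ℚ̄_pˣ` continuous, `ν^n = 1`),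
`ρ₀` an integral model of some `ρ` unramified almost everywhere (only used to make the residually-ramified set of `ρ₀`
finite), and a package for `ρ₀'`: `r'` irreducible with integral model `r₀'` of the ordered residual diagonal of `ρ₀'`,
oriented-ordinary frames of type `(k, m)` at every `v ∣ p`, unramified off a finite `S ⊇ {v ∣ p}` obeying the one-`q`
level clause for `ρ₀'`; and `ν` unramified at the residually-unramified places `v ≠ q`, `v ∤ p` of `ρ₀`.  Conclusion:
`r := ν ⊗ r'` (`FramedRep.twist`, `coe_twist_apply`), `r₀ := ν · r₀'` (`RestrictTwist.exists_integral_twist`; `ν` is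
unit-valued since `ν^n = 1`) is irreducible (`isIrreducible_of_coe_eq_smul` with `φ = id`), residually upper triangular
with the ordered diagonal of `ρ₀` (`ν(r₀')ᵢᵢ - (ρ₀)ᵢᵢ = ν((r₀')ᵢᵢ - (ρ₀')ᵢᵢ)`), oriented-ordinary of type `(k, m·n)` in
the SAME frames `Q` (scalars are central: `conj_twist_frame` / `scalar_mul_val_apply`; `(νθ₂)^{mn} = 1`,
`(νθ₁)^{mn} = ε^{(k-1)mn}`), unramified off the finite set `S' := S ∪ {q} ∪ {residually ramified places of ρ₀}`
(finite by `hunr`: `ρ` unramified at `v` ⇒ `ρ₀(I) = 1` ⇒ residually unramified), `ν` unramified off `S'`, and the level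
clause for `ρ₀` holds for `S'` (at a residually-unramified `v ≠ q`, `v ∤ p` of `ρ₀`, `ν|_I = 1` so `ρ₀'` is residually
unramified there too, hence `v ∉ S`).  [folklore; cf. the landed `RestrictTwist.orientedOrdinary_twist_restrict`,
`isUnramifiedAt_twist_restrict` (case `K = F`)] -/
def S.stub_twistGaloisTransport : Prop :=
    ∀ (F : Type) [Field F] [NumberField F] (p : ℕ) [Fact p.Prime] (O : ValuationSubring (PadicAlgCl p)),
      O = (Valued.v : Valuation (PadicAlgCl p) NNReal).valuationSubring →
      ∀ (ρ : Literature.NumberTheory.GaloisRepresentations.FramedGaloisRep F (PadicAlgCl p) 2)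
        (ρ₀ ρ₀' : Field.absoluteGaloisGroup F →* Matrix.GeneralLinearGroup (Fin 2) O)
        (ν : Field.absoluteGaloisGroup F →ₜ* (PadicAlgCl p)ˣ) (n : ℕ),
      (∀ᶠ v in Filter.cofinite, ρ.IsUnramifiedAt v) → ρ.HasUpperTriangularIntegralModel ρ₀ →
      0 < n → (∀ σ, ν σ ^ n = 1) →
      (∀ σ (i j : Fin 2), ((ρ₀ σ).val i j : PadicAlgCl p) = ((ν σ : (PadicAlgCl p)ˣ) : PadicAlgCl p) * ((ρ₀' σ).val i j : PadicAlgCl p)) →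
      ∀ (r' : Literature.NumberTheory.GaloisRepresentations.FramedGaloisRep F (PadicAlgCl p) 2)
        (r₀' : Field.absoluteGaloisGroup F →* Matrix.GeneralLinearGroup (Fin 2) O)
        (q : IsDedekindDomain.HeightOneSpectrum (NumberField.RingOfIntegers F))
        (S : Set (IsDedekindDomain.HeightOneSpectrum (NumberField.RingOfIntegers F))) (k m : ℕ),
      r'.toGaloisRep.IsIrreducible → r'.HasUpperTriangularIntegralModel r₀' →
      (∀ g, ((r₀' g).val 0 0 - (ρ₀' g).val 0 0 : O) ∈ IsLocalRing.maximalIdeal O ∧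
        ((r₀' g).val 1 1 - (ρ₀' g).val 1 1 : O) ∈ IsLocalRing.maximalIdeal O) →
      0 < m →
      (∀ v : IsDedekindDomain.HeightOneSpectrum (NumberField.RingOfIntegers F), (p : NumberField.RingOfIntegers F) ∈ v.asIdeal →
        ∃ Q : Matrix.GeneralLinearGroup (Fin 2) (PadicAlgCl p),
          Valued.v (Q.val 0 0) ≤ Valued.v (Q.val 1 0) ∧
          ∀ σ, (Q⁻¹ * r'.toLocal v σ * Q).val 1 0 = 0 ∧
            (σ ∈ Literature.NumberTheory.GaloisRepresentations.absInertia (v.adicCompletion F) →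
              (Q⁻¹ * r'.toLocal v σ * Q).val 1 1 ^ m = 1 ∧
              (Q⁻¹ * r'.toLocal v σ * Q).val 0 0 ^ m =
                algebraMap (Padic p) (PadicAlgCl p)
                  (((Literature.NumberTheory.GaloisRepresentations.GaloisRep.cyclotomicCharacter (v.adicCompletion F) p σ).val : PadicInt p) :
                    Padic p) ^ ((k - 1) * m))) →
      S.Finite → (∀ v : IsDedekindDomain.HeightOneSpectrum (NumberField.RingOfIntegers F), (p : NumberField.RingOfIntegers F) ∈ v.asIdeal → v ∈ S) →
      (∀ v ∉ S, r'.IsUnramifiedAt v) →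
      (∀ v : IsDedekindDomain.HeightOneSpectrum (NumberField.RingOfIntegers F), v ≠ q → (p : NumberField.RingOfIntegers F) ∉ v.asIdeal →
        (∀ 𝔓 ∈ v.primesAbove, ∀ σ ∈ 𝔓.inertia (Field.absoluteGaloisGroup F),
          ((ρ₀' σ).val 0 0 - 1 : O) ∈ IsLocalRing.maximalIdeal O ∧ ((ρ₀' σ).val 1 1 - 1 : O) ∈ IsLocalRing.maximalIdeal O) →
        v ∉ S) →
      (∀ v : IsDedekindDomain.HeightOneSpectrum (NumberField.RingOfIntegers F), v ≠ q → (p : NumberField.RingOfIntegers F) ∉ v.asIdeal →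
        (∀ 𝔓 ∈ v.primesAbove, ∀ σ ∈ 𝔓.inertia (Field.absoluteGaloisGroup F),
          ((ρ₀ σ).val 0 0 - 1 : O) ∈ IsLocalRing.maximalIdeal O ∧ ((ρ₀ σ).val 1 1 - 1 : O) ∈ IsLocalRing.maximalIdeal O) →
        ∀ 𝔓 ∈ v.primesAbove, ∀ σ ∈ 𝔓.inertia (Field.absoluteGaloisGroup F), ν σ = 1) →
      ∃ (r : Literature.NumberTheory.GaloisRepresentations.FramedGaloisRep F (PadicAlgCl p) 2)
        (r₀ : Field.absoluteGaloisGroup F →* Matrix.GeneralLinearGroup (Fin 2) O)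
        (S' : Set (IsDedekindDomain.HeightOneSpectrum (NumberField.RingOfIntegers F))),
        (∀ σ, (r σ).val = ((ν σ : (PadicAlgCl p)ˣ) : PadicAlgCl p) • (r' σ).val) ∧
        r.toGaloisRep.IsIrreducible ∧ r.HasUpperTriangularIntegralModel r₀ ∧
        (∀ g, ((r₀ g).val 0 0 - (ρ₀ g).val 0 0 : O) ∈ IsLocalRing.maximalIdeal O ∧
          ((r₀ g).val 1 1 - (ρ₀ g).val 1 1 : O) ∈ IsLocalRing.maximalIdeal O) ∧
        (∀ v : IsDedekindDomain.HeightOneSpectrum (NumberField.RingOfIntegers F), (p : NumberField.RingOfIntegers F) ∈ v.asIdeal →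
          ∃ Q : Matrix.GeneralLinearGroup (Fin 2) (PadicAlgCl p),
            Valued.v (Q.val 0 0) ≤ Valued.v (Q.val 1 0) ∧
            ∀ σ, (Q⁻¹ * r.toLocal v σ * Q).val 1 0 = 0 ∧
              (σ ∈ Literature.NumberTheory.GaloisRepresentations.absInertia (v.adicCompletion F) →
                (Q⁻¹ * r.toLocal v σ * Q).val 1 1 ^ (m * n) = 1 ∧
                (Q⁻¹ * r.toLocal v σ * Q).val 0 0 ^ (m * n) =
                  algebraMap (Padic p) (PadicAlgCl p)
                    (((Literature.NumberTheory.GaloisRepresentations.GaloisRep.cyclotomicCharacter (v.adicCompletion F) p σ).val : PadicInt p) :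
                      Padic p) ^ ((k - 1) * (m * n)))) ∧
        S'.Finite ∧ S ⊆ S' ∧
        (∀ v : IsDedekindDomain.HeightOneSpectrum (NumberField.RingOfIntegers F), (p : NumberField.RingOfIntegers F) ∈ v.asIdeal → v ∈ S') ∧
        (∀ v ∉ S', r.IsUnramifiedAt v) ∧
        (∀ v ∉ S', ∀ 𝔓 ∈ v.primesAbove, ∀ σ ∈ 𝔓.inertia (Field.absoluteGaloisGroup F), ν σ = 1) ∧
        (∀ v : IsDedekindDomain.HeightOneSpectrum (NumberField.RingOfIntegers F), v ≠ q → (p : NumberField.RingOfIntegers F) ∉ v.asIdeal →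
          (∀ 𝔓 ∈ v.primesAbove, ∀ σ ∈ 𝔓.inertia (Field.absoluteGaloisGroup F),
            ((ρ₀ σ).val 0 0 - 1 : O) ∈ IsLocalRing.maximalIdeal O ∧ ((ρ₀ σ).val 1 1 - 1 : O) ∈ IsLocalRing.maximalIdeal O) →
          v ∉ S')

/-- **STUB S7d — `twistAutomorphicTransport` (v5; size S; provable now from the tree's PROVED class-field-theoretic twist
machinery, exactly the twist half of the landed S4 rewire p94876).**  For `F` a number field, `πF` cuspidal on `GL₂(𝔸_F)` with
a regular L-algebraic infinity type `T`, Satake–Frobenius compatible with `r'` at every `v ∉ S`, a continuous finite-order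
`ν : Γ_F → ℚ̄_pˣ`, `r = ν ⊗ r'` (entrywise), and `S' ⊇ S` off which `r` and `ν` are unramified: `πF' := πF ⊗ (χ_ν ∘ det)`
for the finite-order Hecke character `χ_ν` of `ν` (`exists_heckeCharacter_of_finiteOrder`, global class field theory, proved
in the tree) is cuspidal (`CuspidalAutomorphicRepData.twist`) of the same infinity type (`HasArchParameter.twist`) and
Satake–Frobenius compatible with `r` at every `v ∉ S'` (`satakeFrobCompatibleAt_twist`). [folklore] -/
def S.stub_twistAutomorphicTransport : Prop :=
    ∀ (F : Type) [Field F] [NumberField F] (p : ℕ) [Fact p.Prime]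
      (hcpt : Literature.NumberTheory.Automorphic.isCompact_glFiniteIntegralLevel 2 F) (ι : PadicAlgCl p ≃+* ℂ)
      (πF : Literature.NumberTheory.Automorphic.CuspidalAutomorphicRepData 2 F hcpt) (T : Literature.NumberTheory.Automorphic.InfinityType F 2),
      πF.1.HasInfinityType T → T.IsLAlgebraic → T.IsRegular →
      ∀ (r' r : Literature.NumberTheory.GaloisRepresentations.FramedGaloisRep F (PadicAlgCl p) 2)
        (ν : Field.absoluteGaloisGroup F →ₜ* (PadicAlgCl p)ˣ),
      (∃ n : ℕ, 0 < n ∧ ∀ σ, ν σ ^ n = 1) →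
      (∀ σ, (r σ).val = ((ν σ : (PadicAlgCl p)ˣ) : PadicAlgCl p) • (r' σ).val) →
      ∀ (S S' : Set (IsDedekindDomain.HeightOneSpectrum (NumberField.RingOfIntegers F))), S ⊆ S' →
      (∀ v ∉ S, Summit.Langlands.SatakeFrobCompatibleAt ι πF.1 r' v) →
      (∀ v ∉ S', r.IsUnramifiedAt v) →
      (∀ v ∉ S', ∀ 𝔓 ∈ v.primesAbove, ∀ σ ∈ 𝔓.inertia (Field.absoluteGaloisGroup F), ν σ = 1) →
      ∃ (πF' : Literature.NumberTheory.Automorphic.CuspidalAutomorphicRepData 2 F hcpt) (T' : Literature.NumberTheory.Automorphic.InfinityType F 2),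
        πF'.1.HasInfinityType T' ∧ T'.IsLAlgebraic ∧ T'.IsRegular ∧
        ∀ v ∉ S', Summit.Langlands.SatakeFrobCompatibleAt ι πF'.1 r v

/-- **STUB S7e — `cousinGaloisPackageWide` (v6; = the landed S7a with `5 ≤ p` replaced by its two local consequences as HYPOTHESES at
each `v ∣ p`: `e(v ∣ p) < p - 1` and `∃ σ ∈ I_{F_v}, ε(σ) ≢ 1 (mod p)`; size S given S7a's proof — delete the two derived `have`s).**
Conditional on the same two Serre 1972 facts. [Serre1972 §1.11–1.12; SilvermanAEC2009 VII] -/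
def S.stub_cousinGaloisPackageWide : Prop :=
  Literature.NumberTheory.EllipticCurves.ellipticOrdinaryReduction_tateModule_filtration →
  Literature.NumberTheory.EllipticCurves.ordinaryReduction_of_inertiaFixed_pTorsion →
    ∀ (F : Type) [Field F] [NumberField F], NumberField.IsTotallyComplex F → Module.finrank ℚ F = 2 →
      ∀ (p : ℕ) [Fact p.Prime] (O : ValuationSubring (PadicAlgCl p)),
      O = (Valued.v : Valuation (PadicAlgCl p) NNReal).valuationSubring →
      ∀ (ρ₀ : Field.absoluteGaloisGroup F →* Matrix.GeneralLinearGroup (Fin 2) O)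
        (E : WeierstrassCurve F) [E.IsElliptic] (P Q : E.geomTorsion p) (q : IsDedekindDomain.HeightOneSpectrum (NumberField.RingOfIntegers F)),
      P ≠ 0 → (∀ a : ℤ, Q ≠ a • P) →
      (∀ σ : Field.absoluteGaloisGroup F, ∃ a b d : ℤ, σ • P = a • P ∧ σ • Q = b • P + d • Q ∧
          ((ρ₀ σ).val 0 0 - a : O) ∈ IsLocalRing.maximalIdeal O ∧ ((ρ₀ σ).val 1 1 - d : O) ∈ IsLocalRing.maximalIdeal O) →
      (∀ v : IsDedekindDomain.HeightOneSpectrum (NumberField.RingOfIntegers F), (p : NumberField.RingOfIntegers F) ∈ v.asIdeal →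
          (∀ 𝔓 ∈ v.primesAbove, ∀ σ ∈ 𝔓.inertia (Field.absoluteGaloisGroup F), σ • P = P) ∧ E.HasGoodReductionAt v ∧
          v.asIdeal.ramificationIdx ℤ < p - 1 ∧
          ∃ σ ∈ Literature.NumberTheory.GaloisRepresentations.absInertia (v.adicCompletion F),
            PadicInt.toZModPow 1 ((Literature.NumberTheory.GaloisRepresentations.GaloisRep.cyclotomicCharacter (v.adicCompletion F) p σ : ℤ_[p]ˣ) : ℤ_[p]) ≠ 1) →
      (∀ v : IsDedekindDomain.HeightOneSpectrum (NumberField.RingOfIntegers F), v ≠ q → (p : NumberField.RingOfIntegers F) ∉ v.asIdeal →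
          (∀ 𝔓 ∈ v.primesAbove, ∀ σ ∈ 𝔓.inertia (Field.absoluteGaloisGroup F),
            ((ρ₀ σ).val 0 0 - 1 : O) ∈ IsLocalRing.maximalIdeal O ∧ ((ρ₀ σ).val 1 1 - 1 : O) ∈ IsLocalRing.maximalIdeal O) →
          E.HasGoodReductionAt v) →
      (E.framedTateGaloisRep p).toGaloisRep.IsIrreducible →
      ∃ (r : Literature.NumberTheory.GaloisRepresentations.FramedGaloisRep F (PadicAlgCl p) 2)
        (r₀ : Field.absoluteGaloisGroup F →* Matrix.GeneralLinearGroup (Fin 2) O)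
        (Pfr : Matrix.GeneralLinearGroup (Fin 2) (PadicAlgCl p)) (S : Set (IsDedekindDomain.HeightOneSpectrum (NumberField.RingOfIntegers F))),
        r = Literature.NumberTheory.GaloisRepresentations.FramedRep.conj Pfr (E.framedTateGaloisRep p) ∧
        r.toGaloisRep.IsIrreducible ∧ r.HasUpperTriangularIntegralModel r₀ ∧
        (∀ g, ((r₀ g).val 0 0 - (ρ₀ g).val 0 0 : O) ∈ IsLocalRing.maximalIdeal O ∧
          ((r₀ g).val 1 1 - (ρ₀ g).val 1 1 : O) ∈ IsLocalRing.maximalIdeal O) ∧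
        (∃ k : ℕ, 2 ≤ k ∧ ∃ m : ℕ, 0 < m ∧ ∀ v : IsDedekindDomain.HeightOneSpectrum (NumberField.RingOfIntegers F), (p : NumberField.RingOfIntegers F) ∈ v.asIdeal →
          ∃ Q : Matrix.GeneralLinearGroup (Fin 2) (PadicAlgCl p),
            Valued.v (Q.val 0 0) ≤ Valued.v (Q.val 1 0) ∧
            ∀ σ, (Q⁻¹ * r.toLocal v σ * Q).val 1 0 = 0 ∧
              (σ ∈ Literature.NumberTheory.GaloisRepresentations.absInertia (v.adicCompletion F) →
                (Q⁻¹ * r.toLocal v σ * Q).val 1 1 ^ m = 1 ∧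
                (Q⁻¹ * r.toLocal v σ * Q).val 0 0 ^ m =
                  algebraMap (Padic p) (PadicAlgCl p)
                    (((Literature.NumberTheory.GaloisRepresentations.GaloisRep.cyclotomicCharacter (v.adicCompletion F) p σ).val : PadicInt p) :
                      Padic p) ^ ((k - 1) * m))) ∧
        S.Finite ∧ (∀ v : IsDedekindDomain.HeightOneSpectrum (NumberField.RingOfIntegers F), (p : NumberField.RingOfIntegers F) ∈ v.asIdeal → v ∈ S) ∧
        (∀ v ∉ S, r.IsUnramifiedAt v) ∧ (∀ v ∉ S, E.HasGoodReductionAt v) ∧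
        (∀ v : IsDedekindDomain.HeightOneSpectrum (NumberField.RingOfIntegers F), v ≠ q → (p : NumberField.RingOfIntegers F) ∉ v.asIdeal →
          (∀ 𝔓 ∈ v.primesAbove, ∀ σ ∈ 𝔓.inertia (Field.absoluteGaloisGroup F),
            ((ρ₀ σ).val 0 0 - 1 : O) ∈ IsLocalRing.maximalIdeal O ∧ ((ρ₀ σ).val 1 1 - 1 : O) ∈ IsLocalRing.maximalIdeal O) →
          v ∉ S)

/-- **STUB S7f — `cousinAutomorphicWide` (v6; = the landed S7b with Caraiani–Newton Cor. 6.1.1 AS PRINTED: non-CM `E/F` with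
`ρ̄_{E,3}|_{G_{F(ζ₃)}}` or `ρ̄_{E,5}|_{G_{F(ζ₅)}}` absolutely irreducible is modular — prepended UNFOLDED as the first hypothesis; the worker states
it inline as the named fact `CaraianiNewton2023_cor611_nonCM_printed` [cite: CaraianiNewton2023, Cor. 6.1.1 p. 87, Lemma 6.1.3 p. 88], cf. the
tree's `CaraianiNewton2023_cor611_modular_of_cor611_nonCM` whose hypothesis (A) is its 3-adic half; size S given S7b's proof).** -/
def S.stub_cousinAutomorphicWide : Prop :=
  (∀ (F : Type) [Field F] [NumberField F], NumberField.IsTotallyComplex F → Module.finrank ℚ F = 2 →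
    ∀ (E : WeierstrassCurve F) [E.IsElliptic], ¬ E.HasCM →
      (Literature.NumberTheory.Automorphic.ModPImageAbsIrreducibleOverCyclotomic E 3 ∨
        @Literature.NumberTheory.Automorphic.ModPImageAbsIrreducibleOverCyclotomic F _ E 5 ⟨Nat.prime_five⟩) →
      ∃ (hF : Literature.NumberTheory.Automorphic.isCompact_glFiniteIntegralLevel 2 F)
        (π : Literature.NumberTheory.Automorphic.CuspidalAutomorphicRepData 2 F hF),
        π.1.HasWeightZero ∧
          ∀ w : IsDedekindDomain.HeightOneSpectrum (NumberField.RingOfIntegers F), E.HasGoodReductionAt w →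
            π.1.HasHeckePolynomialAt w
              ((Literature.NumberTheory.Automorphic.frobPoly (E.frobeniusTraceAt w) w.residueCard).map (Int.castRingHom ℂ))) →
    ∀ (F : Type) [Field F] [NumberField F], NumberField.IsTotallyComplex F → Module.finrank ℚ F = 2 →
      ∀ (p : ℕ) [Fact p.Prime] (ι : PadicAlgCl p ≃+* ℂ) (E : WeierstrassCurve F) [E.IsElliptic],
      ¬ E.HasCM →
      (Literature.NumberTheory.Automorphic.ModPImageAbsIrreducibleOverCyclotomic E 3 ∨
        @Literature.NumberTheory.Automorphic.ModPImageAbsIrreducibleOverCyclotomic F _ E 5 ⟨Nat.prime_five⟩) →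
      ∀ (r : Literature.NumberTheory.GaloisRepresentations.FramedGaloisRep F (PadicAlgCl p) 2)
        (Pfr : Matrix.GeneralLinearGroup (Fin 2) (PadicAlgCl p)),
      r = Literature.NumberTheory.GaloisRepresentations.FramedRep.conj Pfr (E.framedTateGaloisRep p) →
      ∀ (S : Set (IsDedekindDomain.HeightOneSpectrum (NumberField.RingOfIntegers F))), S.Finite →
      (∀ v : IsDedekindDomain.HeightOneSpectrum (NumberField.RingOfIntegers F), (p : NumberField.RingOfIntegers F) ∈ v.asIdeal → v ∈ S) →
      (∀ v ∉ S, E.HasGoodReductionAt v) →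
      ∀ hcpt : Literature.NumberTheory.Automorphic.isCompact_glFiniteIntegralLevel 2 F,
        ∃ (πF : Literature.NumberTheory.Automorphic.CuspidalAutomorphicRepData 2 F hcpt) (T' : Literature.NumberTheory.Automorphic.InfinityType F 2),
          πF.1.HasInfinityType T' ∧ T'.IsLAlgebraic ∧ T'.IsRegular ∧
          ∀ v ∉ S, Summit.Langlands.SatakeFrobCompatibleAt ι πF.1 r v

/-- **STUB S6'''' — `genuineCoreSeed` (v6: the CONCEDED COMPLEMENT after the twisted- and wide-cousin grafts — NOT a lemma of this
line; v5's S6''' `genuineResidueSeed` minus `HasWideCousin`).**  The crux VERBATIM on `¬ DescendsOdd ∧ ¬ HasTwistedCousin ∧ ¬ HasWideCousin`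
(`HasCousin ⊆ HasTwistedCousin`; spelled with the three regime predicates BY NAME — their unfolded texts are the defs above): `p = 3` genuine pairs,
genuine pairs of non-elliptic type up to twist (`det ρ̄ · ω⁻¹` not the square of a character unramified at the residually
unramified places but one), and elliptic-type-up-to-twist pairs whose cousin SUPPLY fails (big-image-cousin K1: false as
typed at `p = 7`, Disproof §8G; at `p = 5` a one-floating-prime `S`-unit condition on the twisted `X₁(5)`-conic, per-datum
searchable, no uniform theorem).  EXHAUSTION OF SOURCES (why this is crux-sized, lead c1): every `r` over `F` that present
mathematics certifies automorphic is (i) a twist of a base change from `ℚ` — then either `r̄|_{Γ_F}` has a DESCENDED ratio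
(`ρ̄'` reducible) or `ρ̄' ≅ Ind_F^ℚ ψ̄` is `F`-dihedral (Clifford), and the latter is MIXED-oriented at split `p` (the
unramified constituents above `v` and `v̄` are `ψ̄_v` and `ψ̄^c_{v̄}`, i.e. `χ̄_a` at one place and `χ̄_b` at the other)
and non-ordinary or non-distinguished at inert `p` (`Ind ψ̄|_{D_p}` reducible ⟺ `ψ̄_v = ψ̄^c_v` ⟺ ratio trivial on `D_v`);
(ii) an automorphic induction — never of Skinner–Wiles ordinary type (both inertial characters `ε^a·finite`, Disproof §8B);
(iii) `V_pE` of an elliptic curve over `F` made modular by Caraiani–Newton Cor. 6.1.1 — a (twisted) cousin in the wide sense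
(the typed `HasTwistedCousin` uses the tree's narrower rendering `SL₂(𝔽₃) ⊆ im ρ̄_{E,3}` of the printed hypothesis (1)
"`ρ̄_{E,3}|_{G_{F(ζ₃)}}` absolutely irreducible", and omits hypothesis (2) (the 5-adic one, needed for `p = 3` cousins, together
with `e(v ∣ 3) < 2`); widening it to the printed Cor. 6.1.1 is a named-fact upgrade plus the landed S7a with `5 ≤ p` replaced by
`e(v ∣ p) < p - 1 ∧ ω|_{I_v} ≠ 1`, not new mathematics — recorded for the planner, not attempted in v5).  So the residue is, up
to that bookkeeping, exactly the set of pairs needing a NEW existence theorem for genuine Bianchi eigenforms with prescribed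
reducible `ρ̄` and one auxiliary place (Fretwell–Roberts is `ℚ`/totally-real only; the disprover's census §8E is its standing
falsifier), plus the elliptic-type pairs whose cousin SUPPLY fails.  Size: open problem. -/
def S.stub_genuineCoreSeed : Prop :=
    ∀ (F : Type) [Field F] [NumberField F], NumberField.IsTotallyComplex F → Module.finrank ℚ F = 2 →
      ∀ (p : ℕ) [Fact p.Prime], p ≠ 2 → ∀ (O : ValuationSubring (PadicAlgCl p)),
      O = (Valued.v : Valuation (PadicAlgCl p) NNReal).valuationSubring →
      ∀ (ρ : Literature.NumberTheory.GaloisRepresentations.FramedGaloisRep F (PadicAlgCl p) 2)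
        (ρ₀ : Field.absoluteGaloisGroup F →* Matrix.GeneralLinearGroup (Fin 2) O),
      ρ.toGaloisRep.IsIrreducible → (∀ᶠ v in Filter.cofinite, ρ.IsUnramifiedAt v) →
      ρ.HasUpperTriangularIntegralModel ρ₀ →
      (∃ k : ℕ, 2 ≤ k ∧ ∃ m : ℕ, 0 < m ∧ ∀ v : IsDedekindDomain.HeightOneSpectrum (NumberField.RingOfIntegers F), (p : NumberField.RingOfIntegers F) ∈ v.asIdeal →
        Literature.NumberTheory.GaloisRepresentations.IsPDistinguishedAt ρ₀ v ∧ ∃ Q : Matrix.GeneralLinearGroup (Fin 2) (PadicAlgCl p),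
          Valued.v (Q.val 0 0) ≤ Valued.v (Q.val 1 0) ∧
          ∀ σ, (Q⁻¹ * ρ.toLocal v σ * Q).val 1 0 = 0 ∧
            (σ ∈ Literature.NumberTheory.GaloisRepresentations.absInertia (v.adicCompletion F) →
              (Q⁻¹ * ρ.toLocal v σ * Q).val 1 1 ^ m = 1 ∧
              (Q⁻¹ * ρ.toLocal v σ * Q).val 0 0 ^ m =
                algebraMap (Padic p) (PadicAlgCl p)
                  (((Literature.NumberTheory.GaloisRepresentations.GaloisRep.cyclotomicCharacter (v.adicCompletion F) p σ).val : PadicInt p) :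
                    Padic p) ^ ((k - 1) * m))) →
      ¬ DescendsOdd F p O ρ₀ → ¬ HasTwistedCousin F p O ρ₀ → ¬ HasWideCousin F p O ρ₀ →
      ∃ (𝒰 : Literature.NumberTheory.Automorphic.BigHeckeGLn.TameLevel 2 F p) (r : Literature.NumberTheory.GaloisRepresentations.FramedGaloisRep F (PadicAlgCl p) 2)
        (r₀ : Field.absoluteGaloisGroup F →* Matrix.GeneralLinearGroup (Fin 2) O)
        (q : IsDedekindDomain.HeightOneSpectrum (NumberField.RingOfIntegers F)),
        r.toGaloisRep.IsIrreducible ∧ 𝒰.IsPadicallyAutomorphic r ∧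
        r.HasUpperTriangularIntegralModel r₀ ∧
        (∀ g, ((r₀ g).val 0 0 - (ρ₀ g).val 0 0 : O) ∈ IsLocalRing.maximalIdeal O ∧
          ((r₀ g).val 1 1 - (ρ₀ g).val 1 1 : O) ∈ IsLocalRing.maximalIdeal O) ∧
        (∃ k : ℕ, 2 ≤ k ∧ ∃ m : ℕ, 0 < m ∧ ∀ v : IsDedekindDomain.HeightOneSpectrum (NumberField.RingOfIntegers F), (p : NumberField.RingOfIntegers F) ∈ v.asIdeal →
          ∃ Q : Matrix.GeneralLinearGroup (Fin 2) (PadicAlgCl p),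
            Valued.v (Q.val 0 0) ≤ Valued.v (Q.val 1 0) ∧
            ∀ σ, (Q⁻¹ * r.toLocal v σ * Q).val 1 0 = 0 ∧
              (σ ∈ Literature.NumberTheory.GaloisRepresentations.absInertia (v.adicCompletion F) →
                (Q⁻¹ * r.toLocal v σ * Q).val 1 1 ^ m = 1 ∧
                (Q⁻¹ * r.toLocal v σ * Q).val 0 0 ^ m =
                  algebraMap (Padic p) (PadicAlgCl p)
                    (((Literature.NumberTheory.GaloisRepresentations.GaloisRep.cyclotomicCharacter (v.adicCompletion F) p σ).val : PadicInt p) :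
                      Padic p) ^ ((k - 1) * m))) ∧
        (∀ v : IsDedekindDomain.HeightOneSpectrum (NumberField.RingOfIntegers F), v ≠ q → (p : NumberField.RingOfIntegers F) ∉ v.asIdeal →
          (∀ 𝔓 ∈ v.primesAbove, ∀ σ ∈ 𝔓.inertia (Field.absoluteGaloisGroup F),
            ((ρ₀ σ).val 0 0 - 1 : O) ∈ IsLocalRing.maximalIdeal O ∧ ((ρ₀ σ).val 1 1 - 1 : O) ∈ IsLocalRing.maximalIdeal O) →
          v ∉ 𝒰.bad)


/-- **The line's NAMED-FACT OBLIGATIONS** (published theorems absent from the tree, stated as Literature named facts by the stub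
workers and ACCEPTED through the gate; each has a page-level locator in its Literature docstring): S2'' — Billerey–Menares 2016 Thm 2.2 (odd-`l` form),
Hida *MFG* Thm 3.26 (1) / (2, with the unit root) / (3)(a), Gelbart 1975 Thm 5.19 (`Literature/NumberTheory/EllipticCurves/EisensteinNewformLevelRaising.lean`);
S4 — NONE any more (its three base-change facts were PROMOTED to the route crux `QuadraticBaseChangeGalois`, registered as
`stub_quadraticBaseChangeGalois`); S5 —
Eichler–Shimura–Harder/Franke/Clozel occurrence and Emerton/Scholze finite-level ⟹ continuous point (`Literature/NumberTheory/Automorphic/BianchiCuspidalEigenclass.lean`);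
S7a — Serre 1972 §1.11–1.12 / Greenberg: ordinary filtration of `T_pE`, inertia-fixed `p`-torsion ⟹ ordinary (`Literature/NumberTheory/EllipticCurves/OrdinaryReductionTateModule.lean`);
S7b — Caraiani–Newton 2023 Cor 6.1.1(1) (`Literature/NumberTheory/Automorphic/CaraianiNewtonResidualImageModularity.lean`).
S7f (v6) — Caraiani–Newton Cor. 6.1.1 AS PRINTED for non-CM curves (`CaraianiNewton2023_cor611_nonCM_printed`, unfolded here as the ELEVENTH conjunct until
the gate relocates the worker's inline def).  Their conjunction is an OPEN OBLIGATION of the line (dischargeable only by `X_holds` theorems, D-0014),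
registered as the stub `stub_lineFacts` so that the skeleton's hypotheses are exactly its declared stubs; the line's result is CONDITIONAL on it. -/
def S.lineFacts : Prop :=
  Literature.NumberTheory.EllipticCurves.BillereyMenares2016_thm22_exists_newform_odd ∧
  Literature.NumberTheory.EllipticCurves.Hida2000_thm326_exists_galoisRep ∧
  Literature.NumberTheory.EllipticCurves.Hida2000_thm326_ordinary_unitRoot ∧
  Literature.NumberTheory.EllipticCurves.Hida2000_thm326_inertia_of_level ∧
  Literature.NumberTheory.EllipticCurves.Gelbart1975_exists_cuspidalRepData_LAlgebraic ∧
  Literature.NumberTheory.Automorphic.bianchi_cuspidal_regularLAlgebraic_eigenclassExists ∧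
  Literature.NumberTheory.Automorphic.algebraicWeightEigenclass_continuousPoint ∧
  Literature.NumberTheory.EllipticCurves.ellipticOrdinaryReduction_tateModule_filtration ∧
  Literature.NumberTheory.EllipticCurves.ordinaryReduction_of_inertiaFixed_pTorsion ∧
  Literature.NumberTheory.Automorphic.CaraianiNewton2023_cor611_modular ∧
  (∀ (F : Type) [Field F] [NumberField F], NumberField.IsTotallyComplex F → Module.finrank ℚ F = 2 →
    ∀ (E : WeierstrassCurve F) [E.IsElliptic], ¬ E.HasCM →
      (Literature.NumberTheory.Automorphic.ModPImageAbsIrreducibleOverCyclotomic E 3 ∨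
        @Literature.NumberTheory.Automorphic.ModPImageAbsIrreducibleOverCyclotomic F _ E 5 ⟨Nat.prime_five⟩) →
      ∃ (hF : Literature.NumberTheory.Automorphic.isCompact_glFiniteIntegralLevel 2 F)
        (π : Literature.NumberTheory.Automorphic.CuspidalAutomorphicRepData 2 F hF),
        π.1.HasWeightZero ∧
          ∀ w : IsDedekindDomain.HeightOneSpectrum (NumberField.RingOfIntegers F), E.HasGoodReductionAt w →
            π.1.HasHeckePolynomialAt w
              ((Literature.NumberTheory.Automorphic.frobPoly (E.frobeniusTraceAt w) w.residueCard).map (Int.castRingHom ℂ)))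

/-! ## 2. The registered stubs (`sorry` = open; S3-Nu closed by the landed theorem) -/

/-- **stub_distinguishedDescendsQ** — CLOSED: landed p92288 (wave 2). -/
theorem stub_distinguishedDescendsQ :
    ∀ (F : Type) [Field F] [NumberField F] (p : ℕ) [Fact p.Prime] (O : ValuationSubring (PadicAlgCl p)),
      O = (Valued.v : Valuation (PadicAlgCl p) NNReal).valuationSubring →
      ∀ (ρ : Literature.NumberTheory.GaloisRepresentations.FramedGaloisRep F (PadicAlgCl p) 2)
        (ρ₀ : Field.absoluteGaloisGroup F →* Matrix.GeneralLinearGroup (Fin 2) O),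
      ρ.HasUpperTriangularIntegralModel ρ₀ →
      (∀ v : IsDedekindDomain.HeightOneSpectrum (NumberField.RingOfIntegers F), (p : NumberField.RingOfIntegers F) ∈ v.asIdeal →
        Literature.NumberTheory.GaloisRepresentations.IsPDistinguishedAt ρ₀ v) →
      ∀ (η : Field.absoluteGaloisGroup ℚ →ₜ* (PadicAlgCl p)ˣ),
      (∀ τ, Valued.v ((η τ : (PadicAlgCl p)ˣ) : PadicAlgCl p) = 1) →
      (∀ σ : Field.absoluteGaloisGroup F,
        Valued.v (((η (Literature.NumberTheory.GaloisRepresentations.absGaloisRestrict ℚ F σ) : (PadicAlgCl p)ˣ) : PadicAlgCl p) *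
            ((ρ₀ σ).val 0 0 : PadicAlgCl p) - ((ρ₀ σ).val 1 1 : PadicAlgCl p)) < 1) →
      ∀ w : IsDedekindDomain.HeightOneSpectrum (NumberField.RingOfIntegers ℚ), (p : NumberField.RingOfIntegers ℚ) ∈ w.asIdeal →
        ∃ 𝔓 ∈ w.primesAbove, ∃ σ : Field.absoluteGaloisGroup ℚ, (∀ x ∈ 𝔓, σ • x ∈ 𝔓) ∧
          ¬ Valued.v (((η σ : (PadicAlgCl p)ˣ) : PadicAlgCl p) - 1) < 1 :=
  Summit.Langlands.Langlands.Theorems.SkinnerWilesDefectOne.EisensteinProModularSeed.stub_distinguishedDescendsQ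

/-- **stub_inertSupplyPrimeSqAll** — CLOSED: `inertSupplyPrimeSq_all` (item-15158 prover, from the landed S1' p92220, every prime `p`). -/
theorem stub_inertSupplyPrimeSqAll :

    ∀ (F : Type) [Field F] [NumberField F], NumberField.IsTotallyComplex F → Module.finrank ℚ F = 2 →
      ∀ (p : ℕ) [Fact p.Prime],
      ∀ (η : Field.absoluteGaloisGroup ℚ →ₜ* (PadicAlgCl p)ˣ),
      (∀ τ, Valued.v ((η τ : (PadicAlgCl p)ˣ) : PadicAlgCl p) = 1) →
      (∀ c : Field.absoluteGaloisGroup ℚ, Literature.NumberTheory.GaloisRepresentations.IsComplexConjugation (Rat.castHom ℝ) c →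
        Valued.v (((η c : (PadicAlgCl p)ˣ) : PadicAlgCl p) + 1) < 1) →
      ∃ M : ℕ, M.Prime ∧ M ≠ p ∧ (Ideal.span {(M : NumberField.RingOfIntegers F)}).IsPrime ∧
        (∀ w : IsDedekindDomain.HeightOneSpectrum (NumberField.RingOfIntegers ℚ), (M : NumberField.RingOfIntegers ℚ) ∈ w.asIdeal → ∀ 𝔓 ∈ w.primesAbove,
          ∀ σ ∈ 𝔓.inertia (Field.absoluteGaloisGroup ℚ),
            Valued.v (((η σ : (PadicAlgCl p)ˣ) : PadicAlgCl p) - 1) < 1) ∧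
        (∀ w : IsDedekindDomain.HeightOneSpectrum (NumberField.RingOfIntegers ℚ), (M : NumberField.RingOfIntegers ℚ) ∈ w.asIdeal → ∀ 𝔓 ∈ w.primesAbove,
          ∀ σ : Field.absoluteGaloisGroup ℚ, IsArithFrobAt (NumberField.RingOfIntegers ℚ) σ 𝔓 →
            Valued.v (((η σ : (PadicAlgCl p)ˣ) : PadicAlgCl p) + 1) < 1) ∧
        M % (p ^ 2) = p ^ 2 - 1 :=
  Summit.Langlands.Langlands.Theorems.SkinnerWilesDefectOne.SeedOfQuadraticBaseChange.inertSupplyPrimeSq_all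

/-- **stub_eisensteinPackageQOdd** — CLOSED CONDITIONALLY (five named facts prepended, Billerey–Menares in its odd-`l` form): `eisensteinPackageQ_odd`
(item-15158 prover, re-running the landed S2' p94046 for every odd `p`). -/
theorem stub_eisensteinPackageQOdd :

    Literature.NumberTheory.EllipticCurves.BillereyMenares2016_thm22_exists_newform_odd → Literature.NumberTheory.EllipticCurves.Hida2000_thm326_exists_galoisRep →
    Literature.NumberTheory.EllipticCurves.Hida2000_thm326_ordinary_unitRoot → Literature.NumberTheory.EllipticCurves.Hida2000_thm326_inertia_of_level →
    Literature.NumberTheory.EllipticCurves.Gelbart1975_exists_cuspidalRepData_LAlgebraic →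
    ∀ (p : ℕ) [Fact p.Prime], p ≠ 2 → ∀ (O : ValuationSubring (PadicAlgCl p)),
      O = (Valued.v : Valuation (PadicAlgCl p) NNReal).valuationSubring →
      ∀ (η : Field.absoluteGaloisGroup ℚ →ₜ* (PadicAlgCl p)ˣ) (M : ℕ),
      (∀ τ, Valued.v ((η τ : (PadicAlgCl p)ˣ) : PadicAlgCl p) = 1) →
      (∀ c : Field.absoluteGaloisGroup ℚ, Literature.NumberTheory.GaloisRepresentations.IsComplexConjugation (Rat.castHom ℝ) c →
        Valued.v (((η c : (PadicAlgCl p)ˣ) : PadicAlgCl p) + 1) < 1) →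
      (∀ w : IsDedekindDomain.HeightOneSpectrum (NumberField.RingOfIntegers ℚ), (p : NumberField.RingOfIntegers ℚ) ∈ w.asIdeal →
        ∃ 𝔓 ∈ w.primesAbove, ∃ σ : Field.absoluteGaloisGroup ℚ, (∀ x ∈ 𝔓, σ • x ∈ 𝔓) ∧
          ¬ Valued.v (((η σ : (PadicAlgCl p)ˣ) : PadicAlgCl p) - 1) < 1) →
      M.Prime → M ≠ p →
      (∀ w : IsDedekindDomain.HeightOneSpectrum (NumberField.RingOfIntegers ℚ), (M : NumberField.RingOfIntegers ℚ) ∈ w.asIdeal → ∀ 𝔓 ∈ w.primesAbove,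
        ∀ σ ∈ 𝔓.inertia (Field.absoluteGaloisGroup ℚ),
          Valued.v (((η σ : (PadicAlgCl p)ˣ) : PadicAlgCl p) - 1) < 1) →
      (∀ w : IsDedekindDomain.HeightOneSpectrum (NumberField.RingOfIntegers ℚ), (M : NumberField.RingOfIntegers ℚ) ∈ w.asIdeal → ∀ 𝔓 ∈ w.primesAbove,
        ∀ σ : Field.absoluteGaloisGroup ℚ, IsArithFrobAt (NumberField.RingOfIntegers ℚ) σ 𝔓 →
          Valued.v (((η σ : (PadicAlgCl p)ˣ) : PadicAlgCl p) + 1) < 1) →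
      M % (p ^ 2) = p ^ 2 - 1 →
      ∃ (k : ℕ) (ρ' : Literature.NumberTheory.GaloisRepresentations.FramedGaloisRep ℚ (PadicAlgCl p) 2)
        (ρ'₀ : Field.absoluteGaloisGroup ℚ →* Matrix.GeneralLinearGroup (Fin 2) O),
        2 ≤ k ∧ ρ'.toGaloisRep.IsIrreducible ∧ ρ'.HasUpperTriangularIntegralModel ρ'₀ ∧
        (∀ g, ((ρ'₀ g).val 0 0 - 1 : O) ∈ IsLocalRing.maximalIdeal O ∧
          Valued.v (((ρ'₀ g).val 1 1 : PadicAlgCl p) - ((η g : (PadicAlgCl p)ˣ) : PadicAlgCl p)) < 1) ∧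
        (∀ w : IsDedekindDomain.HeightOneSpectrum (NumberField.RingOfIntegers ℚ), (p : NumberField.RingOfIntegers ℚ) ∈ w.asIdeal →
          ∃ Q : Matrix.GeneralLinearGroup (Fin 2) (PadicAlgCl p),
            Valued.v (Q.val 0 0) ≤ Valued.v (Q.val 1 0) ∧
            ∀ σ, (Q⁻¹ * ρ'.toLocal w σ * Q).val 1 0 = 0 ∧
              (σ ∈ Literature.NumberTheory.GaloisRepresentations.absInertia (w.adicCompletion ℚ) →
                (Q⁻¹ * ρ'.toLocal w σ * Q).val 1 1 = 1 ∧
                (Q⁻¹ * ρ'.toLocal w σ * Q).val 0 0 =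
                  algebraMap (Padic p) (PadicAlgCl p)
                    (((Literature.NumberTheory.GaloisRepresentations.GaloisRep.cyclotomicCharacter (w.adicCompletion ℚ) p σ).val : PadicInt p) :
                      Padic p) ^ (k - 1))) ∧
        (∀ w : IsDedekindDomain.HeightOneSpectrum (NumberField.RingOfIntegers ℚ), (M : NumberField.RingOfIntegers ℚ) ∉ w.asIdeal → (p : NumberField.RingOfIntegers ℚ) ∉ w.asIdeal →
          ∀ 𝔓 ∈ w.primesAbove, ∀ σ ∈ 𝔓.inertia (Field.absoluteGaloisGroup ℚ),
            Valued.v (((η σ : (PadicAlgCl p)ˣ) : PadicAlgCl p) - 1) < 1 → ρ' σ = 1) ∧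
        ∀ hcpt : Literature.NumberTheory.Automorphic.isCompact_glFiniteIntegralLevel 2 ℚ,
          ∃ (ι : PadicAlgCl p ≃+* ℂ) (π : Literature.NumberTheory.Automorphic.CuspidalAutomorphicRepData 2 ℚ hcpt) (T : Literature.NumberTheory.Automorphic.InfinityType ℚ 2),
            π.1.HasInfinityType T ∧ T.IsLAlgebraic ∧ T.IsRegular ∧
            ∀ᶠ w in Filter.cofinite, Summit.Langlands.SatakeFrobCompatibleAt ι π.1 ρ' w :=
  Summit.Langlands.Langlands.Theorems.SkinnerWilesDefectOne.SeedOfQuadraticBaseChange.eisensteinPackageQ_odd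

/-- **stub_restrictTwistGaloisPackageNu** — CLOSED (S3 + `ν` unramified off `S`): landed p90619. -/
theorem stub_restrictTwistGaloisPackageNu :
    ∀ (F : Type) [Field F] [NumberField F], NumberField.IsTotallyComplex F → Module.finrank ℚ F = 2 →
      ∀ (p : ℕ) [Fact p.Prime] (O : ValuationSubring (PadicAlgCl p)),
      O = (Valued.v : Valuation (PadicAlgCl p) NNReal).valuationSubring →
      ∀ (ρ : Literature.NumberTheory.GaloisRepresentations.FramedGaloisRep F (PadicAlgCl p) 2)
        (ρ₀ : Field.absoluteGaloisGroup F →* Matrix.GeneralLinearGroup (Fin 2) O),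
      (∀ᶠ v in Filter.cofinite, ρ.IsUnramifiedAt v) → ρ.HasUpperTriangularIntegralModel ρ₀ →
      (∀ v : IsDedekindDomain.HeightOneSpectrum (NumberField.RingOfIntegers F), (p : NumberField.RingOfIntegers F) ∈ v.asIdeal → Literature.NumberTheory.GaloisRepresentations.IsPDistinguishedAt ρ₀ v) →
      ∀ (η : Field.absoluteGaloisGroup ℚ →ₜ* (PadicAlgCl p)ˣ) (M k : ℕ)
        (ρ' : Literature.NumberTheory.GaloisRepresentations.FramedGaloisRep ℚ (PadicAlgCl p) 2)
        (ρ'₀ : Field.absoluteGaloisGroup ℚ →* Matrix.GeneralLinearGroup (Fin 2) O),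
      (∀ τ, Valued.v ((η τ : (PadicAlgCl p)ˣ) : PadicAlgCl p) = 1) →
      (∀ σ : Field.absoluteGaloisGroup F,
        Valued.v (((η (Literature.NumberTheory.GaloisRepresentations.absGaloisRestrict ℚ F σ) : (PadicAlgCl p)ˣ) : PadicAlgCl p) *
            ((ρ₀ σ).val 0 0 : PadicAlgCl p) - ((ρ₀ σ).val 1 1 : PadicAlgCl p)) < 1) →
      M.Prime → (Ideal.span {(M : NumberField.RingOfIntegers F)}).IsPrime → 2 ≤ k →
      ρ'.toGaloisRep.IsIrreducible → ρ'.HasUpperTriangularIntegralModel ρ'₀ →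
      (∀ g, ((ρ'₀ g).val 0 0 - 1 : O) ∈ IsLocalRing.maximalIdeal O ∧
        Valued.v (((ρ'₀ g).val 1 1 : PadicAlgCl p) - ((η g : (PadicAlgCl p)ˣ) : PadicAlgCl p)) < 1) →
      (∀ w : IsDedekindDomain.HeightOneSpectrum (NumberField.RingOfIntegers ℚ), (p : NumberField.RingOfIntegers ℚ) ∈ w.asIdeal →
        ∃ Q : Matrix.GeneralLinearGroup (Fin 2) (PadicAlgCl p),
          Valued.v (Q.val 0 0) ≤ Valued.v (Q.val 1 0) ∧
          ∀ σ, (Q⁻¹ * ρ'.toLocal w σ * Q).val 1 0 = 0 ∧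
            (σ ∈ Literature.NumberTheory.GaloisRepresentations.absInertia (w.adicCompletion ℚ) →
              (Q⁻¹ * ρ'.toLocal w σ * Q).val 1 1 = 1 ∧
              (Q⁻¹ * ρ'.toLocal w σ * Q).val 0 0 =
                algebraMap (Padic p) (PadicAlgCl p)
                  (((Literature.NumberTheory.GaloisRepresentations.GaloisRep.cyclotomicCharacter (w.adicCompletion ℚ) p σ).val : PadicInt p) :
                    Padic p) ^ (k - 1))) →
      (∀ w : IsDedekindDomain.HeightOneSpectrum (NumberField.RingOfIntegers ℚ), (M : NumberField.RingOfIntegers ℚ) ∉ w.asIdeal → (p : NumberField.RingOfIntegers ℚ) ∉ w.asIdeal →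
        ∀ 𝔓 ∈ w.primesAbove, ∀ σ ∈ 𝔓.inertia (Field.absoluteGaloisGroup ℚ),
          Valued.v (((η σ : (PadicAlgCl p)ˣ) : PadicAlgCl p) - 1) < 1 → ρ' σ = 1) →
      ∃ (r : Literature.NumberTheory.GaloisRepresentations.FramedGaloisRep F (PadicAlgCl p) 2)
        (r₀ : Field.absoluteGaloisGroup F →* Matrix.GeneralLinearGroup (Fin 2) O)
        (ν : Field.absoluteGaloisGroup F →ₜ* (PadicAlgCl p)ˣ) (q : IsDedekindDomain.HeightOneSpectrum (NumberField.RingOfIntegers F))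
        (S : Set (IsDedekindDomain.HeightOneSpectrum (NumberField.RingOfIntegers F))),
        (∃ n : ℕ, 0 < n ∧ ∀ σ, ν σ ^ n = 1) ∧
        (∀ σ, (r σ).val = ((ν σ : (PadicAlgCl p)ˣ) : PadicAlgCl p) • (ρ' (Literature.NumberTheory.GaloisRepresentations.absGaloisRestrict ℚ F σ)).val) ∧
        r.toGaloisRep.IsIrreducible ∧ r.HasUpperTriangularIntegralModel r₀ ∧
        (∀ g, ((r₀ g).val 0 0 - (ρ₀ g).val 0 0 : O) ∈ IsLocalRing.maximalIdeal O ∧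
          ((r₀ g).val 1 1 - (ρ₀ g).val 1 1 : O) ∈ IsLocalRing.maximalIdeal O) ∧
        (∃ k' : ℕ, 2 ≤ k' ∧ ∃ m : ℕ, 0 < m ∧ ∀ v : IsDedekindDomain.HeightOneSpectrum (NumberField.RingOfIntegers F), (p : NumberField.RingOfIntegers F) ∈ v.asIdeal →
          ∃ Q : Matrix.GeneralLinearGroup (Fin 2) (PadicAlgCl p),
            Valued.v (Q.val 0 0) ≤ Valued.v (Q.val 1 0) ∧
            ∀ σ, (Q⁻¹ * r.toLocal v σ * Q).val 1 0 = 0 ∧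
              (σ ∈ Literature.NumberTheory.GaloisRepresentations.absInertia (v.adicCompletion F) →
                (Q⁻¹ * r.toLocal v σ * Q).val 1 1 ^ m = 1 ∧
                (Q⁻¹ * r.toLocal v σ * Q).val 0 0 ^ m =
                  algebraMap (Padic p) (PadicAlgCl p)
                    (((Literature.NumberTheory.GaloisRepresentations.GaloisRep.cyclotomicCharacter (v.adicCompletion F) p σ).val : PadicInt p) :
                      Padic p) ^ ((k' - 1) * m))) ∧
        S.Finite ∧ (∀ v : IsDedekindDomain.HeightOneSpectrum (NumberField.RingOfIntegers F), (p : NumberField.RingOfIntegers F) ∈ v.asIdeal → v ∈ S) ∧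
        (∀ v ∉ S, r.IsUnramifiedAt v) ∧
        (∀ v ∉ S, ∀ 𝔓 ∈ v.primesAbove, ∀ σ ∈ 𝔓.inertia (Field.absoluteGaloisGroup F), ν σ = 1) ∧
        (∀ v : IsDedekindDomain.HeightOneSpectrum (NumberField.RingOfIntegers F), v ≠ q → (p : NumberField.RingOfIntegers F) ∉ v.asIdeal →
          (∀ 𝔓 ∈ v.primesAbove, ∀ σ ∈ 𝔓.inertia (Field.absoluteGaloisGroup F),
            ((ρ₀ σ).val 0 0 - 1 : O) ∈ IsLocalRing.maximalIdeal O ∧ ((ρ₀ σ).val 1 1 - 1 : O) ∈ IsLocalRing.maximalIdeal O) →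
          v ∉ S) :=
  Summit.Langlands.Langlands.Theorems.SkinnerWilesDefectOne.EisensteinProModularSeed.stub_restrictTwistGaloisPackageNu

/-- **stub_quadraticBaseChangeGalois** — the ROUTE CRUX `QuadraticBaseChangeGalois` (stmt-Langlands-15156, rank 5) BY NAME: Langlands'
quadratic base change for `GL₂` from `ℚ` to a quadratic `F` in Galois-compatible form — the route-choice planners' PROMOTION of the
three base-change named facts S4 used to carry (route rev 15, 2026-08-16); an open route obligation, registered here as the line's input. -/
theorem stub_quadraticBaseChangeGalois :
    Summit.Langlands.Langlands.Theses.SkinnerWilesDefectOne.QuadraticBaseChangeGalois := by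
  sorry

/-- **stub_quadraticBaseChangeTwist** — CLOSED from `stub_quadraticBaseChangeGalois` ALONE (rewire p94876,
`SeedOfQuadraticBaseChange.stub_quadraticBaseChangeTwist_of_quadraticBaseChangeGalois`; no base-change fact left in the cone;
the fact-conditional landing p90411 is superseded). -/
theorem stub_quadraticBaseChangeTwist :
    ∀ (F : Type) [Field F] [NumberField F], NumberField.IsTotallyComplex F → Module.finrank ℚ F = 2 → ∀ (p : ℕ) [Fact p.Prime] (hcptQ : Literature.NumberTheory.Automorphic.isCompact_glFiniteIntegralLevel 2 ℚ) (ι : PadicAlgCl p ≃+* ℂ) (π : Literature.NumberTheory.Automorphic.CuspidalAutomorphicRepData 2 ℚ hcptQ) (T : Literature.NumberTheory.Automorphic.InfinityType ℚ 2), π.1.HasInfinityType T → T.IsLAlgebraic → T.IsRegular → ∀ (ρ' : Literature.NumberTheory.GaloisRepresentations.FramedGaloisRep ℚ (PadicAlgCl p) 2), (∀ᶠ w in Filter.cofinite, Summit.Langlands.SatakeFrobCompatibleAt ι π.1 ρ' w) → ∀ (ν : Field.absoluteGaloisGroup F →ₜ* (PadicAlgCl p)ˣ), (∃ n : ℕ,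 0 < n ∧ ∀ σ, ν σ ^ n = 1) → ∀ (r : Literature.NumberTheory.GaloisRepresentations.FramedGaloisRep F (PadicAlgCl p) 2), (∀ σ, (r σ).val = ((ν σ : (PadicAlgCl p)ˣ) : PadicAlgCl p) • (ρ' (Literature.NumberTheory.GaloisRepresentations.absGaloisRestrict ℚ F σ)).val) → r.toGaloisRep.IsIrreducible → ∀ (S : Set (IsDedekindDomain.HeightOneSpectrum (NumberField.RingOfIntegers F))), S.Finite → (∀ v : IsDedekindDomain.HeightOneSpectrum (NumberField.RingOfIntegers F), (p : NumberField.RingOfIntegers F) ∈ v.asIdeal → v ∈ S) → (∀ v ∉ S, r.IsUnramifiedAt v) → (∀ v ∉ S, ∀ 𝔓 ∈ v.primesAbove, ∀ σ ∈ 𝔓.inertia (Field.absoluteGaloisGroup F), ν σ = 1) → ∀ hcptF : Literature.NumberTheory.Automorphic.isCompact_glFiniteIntegralLevel 2 F, ∃ (πF : Literature.NumberTheory.Automorphic.CuspidalAutomorphicRepData 2 F hcptF) (T' : Literature.NumberTheory.Automorphic.InfinityType F 2), πF.1.HasInfinityType T' ∧ T'.IsLAlgebraic ∧ T'.IsRegular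 ∧ ∀ v ∉ S, Summit.Langlands.SatakeFrobCompatibleAt ι πF.1 r v :=
  Summit.Langlands.Langlands.Theorems.SkinnerWilesDefectOne.SeedOfQuadraticBaseChange.stub_quadraticBaseChangeTwist_of_quadraticBaseChangeGalois stub_quadraticBaseChangeGalois

/-- **stub_cuspidalCohomologicalPoint** — CLOSED CONDITIONALLY (two named facts prepended): landed p87504 (facts p87412). -/
theorem stub_cuspidalCohomologicalPoint :
    Literature.NumberTheory.Automorphic.bianchi_cuspidal_regularLAlgebraic_eigenclassExists → Literature.NumberTheory.Automorphic.algebraicWeightEigenclass_continuousPoint →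
    ∀ (F : Type) [Field F] [NumberField F], NumberField.IsTotallyComplex F → Module.finrank ℚ F = 2 →
      ∀ (p : ℕ) [Fact p.Prime] (hcpt : Literature.NumberTheory.Automorphic.isCompact_glFiniteIntegralLevel 2 F) (ι : PadicAlgCl p ≃+* ℂ)
        (πF : Literature.NumberTheory.Automorphic.CuspidalAutomorphicRepData 2 F hcpt) (T : Literature.NumberTheory.Automorphic.InfinityType F 2),
      πF.1.HasInfinityType T → T.IsLAlgebraic → T.IsRegular →
      ∀ (S : Set (IsDedekindDomain.HeightOneSpectrum (NumberField.RingOfIntegers F))), S.Finite →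
      (∀ v : IsDedekindDomain.HeightOneSpectrum (NumberField.RingOfIntegers F), (p : NumberField.RingOfIntegers F) ∈ v.asIdeal → v ∈ S) →
      ∀ (r : Literature.NumberTheory.GaloisRepresentations.FramedGaloisRep F (PadicAlgCl p) 2),
      (∀ v ∉ S, Summit.Langlands.SatakeFrobCompatibleAt ι πF.1 r v) →
      ∃ 𝒰 : Literature.NumberTheory.Automorphic.BigHeckeGLn.TameLevel 2 F p, 𝒰.bad = S ∧ 𝒰.IsPadicallyAutomorphic r :=
  Summit.Langlands.Langlands.Theorems.SkinnerWilesDefectOne.EisensteinProModularSeed.stub_cuspidalCohomologicalPoint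

/-- **stub_lineFacts** — the ten NAMED FACTS of S2''/S5/S7a/S7b as one registered obligation (statement = `S.lineFacts`; open: literature debt). -/
theorem stub_lineFacts :
    Literature.NumberTheory.EllipticCurves.BillereyMenares2016_thm22_exists_newform_odd ∧ Literature.NumberTheory.EllipticCurves.Hida2000_thm326_exists_galoisRep ∧ Literature.NumberTheory.EllipticCurves.Hida2000_thm326_ordinary_unitRoot ∧ Literature.NumberTheory.EllipticCurves.Hida2000_thm326_inertia_of_level ∧ Literature.NumberTheory.EllipticCurves.Gelbart1975_exists_cuspidalRepData_LAlgebraic ∧ Literature.NumberTheory.Automorphic.bianchi_cuspidal_regularLAlgebraic_eigenclassExists ∧ Literature.NumberTheory.Automorphic.algebraicWeightEigenclass_continuousPoint ∧ Literature.NumberTheory.EllipticCurves.ellipticOrdinaryReduction_tateModule_filtration ∧ Literature.NumberTheory.EllipticCurves.ordinaryReduction_of_inertiaFixed_pTorsion ∧ Literature.NumberTheory.Automorphic.CaraianiNewton2023_cor611_modular ∧ (∀ (F : Type) [Field F] [NumberField F], NumberField.IsTotallyComplex F → Module.finrank ℚ F = 2 →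
      ∀ (E : WeierstrassCurve F) [E.IsElliptic], ¬ E.HasCM →
        (Literature.NumberTheory.Automorphic.ModPImageAbsIrreducibleOverCyclotomic E 3 ∨
          @Literature.NumberTheory.Automorphic.ModPImageAbsIrreducibleOverCyclotomic F _ E 5 ⟨Nat.prime_five⟩) →
        ∃ (hF : Literature.NumberTheory.Automorphic.isCompact_glFiniteIntegralLevel 2 F)
          (π : Literature.NumberTheory.Automorphic.CuspidalAutomorphicRepData 2 F hF),
          π.1.HasWeightZero ∧
            ∀ w : IsDedekindDomain.HeightOneSpectrum (NumberField.RingOfIntegers F), E.HasGoodReductionAt w →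
              π.1.HasHeckePolynomialAt w
                ((Literature.NumberTheory.Automorphic.frobPoly (E.frobeniusTraceAt w) w.residueCard).map (Int.castRingHom ℂ))) := by
  sorry

/-- **stub_cousinGaloisPackage** — LANDED p96064 (wave 3; CONDITIONAL on the two Serre 1972 ordinary-structure facts p96063; aux p95908/p95910);
CLOSED by the landed theorem. -/
theorem stub_cousinGaloisPackage :
    Literature.NumberTheory.EllipticCurves.ellipticOrdinaryReduction_tateModule_filtration → Literature.NumberTheory.EllipticCurves.ordinaryReduction_of_inertiaFixed_pTorsion →
    ∀ (F : Type) [Field F] [NumberField F], NumberField.IsTotallyComplex F → Module.finrank ℚ F = 2 →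
      ∀ (p : ℕ) [Fact p.Prime], 5 ≤ p → ∀ (O : ValuationSubring (PadicAlgCl p)),
      O = (Valued.v : Valuation (PadicAlgCl p) NNReal).valuationSubring →
      ∀ (ρ₀ : Field.absoluteGaloisGroup F →* Matrix.GeneralLinearGroup (Fin 2) O)
        (E : WeierstrassCurve F) [E.IsElliptic] (P Q : E.geomTorsion p) (q : IsDedekindDomain.HeightOneSpectrum (NumberField.RingOfIntegers F)),
      P ≠ 0 → (∀ a : ℤ, Q ≠ a • P) →
      (∀ σ : Field.absoluteGaloisGroup F, ∃ a b d : ℤ, σ • P = a • P ∧ σ • Q = b • P + d • Q ∧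
          ((ρ₀ σ).val 0 0 - a : O) ∈ IsLocalRing.maximalIdeal O ∧ ((ρ₀ σ).val 1 1 - d : O) ∈ IsLocalRing.maximalIdeal O) →
      (∀ v : IsDedekindDomain.HeightOneSpectrum (NumberField.RingOfIntegers F), (p : NumberField.RingOfIntegers F) ∈ v.asIdeal →
          (∀ 𝔓 ∈ v.primesAbove, ∀ σ ∈ 𝔓.inertia (Field.absoluteGaloisGroup F), σ • P = P) ∧ E.HasGoodReductionAt v) →
      (∀ v : IsDedekindDomain.HeightOneSpectrum (NumberField.RingOfIntegers F), v ≠ q → (p : NumberField.RingOfIntegers F) ∉ v.asIdeal →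
          (∀ 𝔓 ∈ v.primesAbove, ∀ σ ∈ 𝔓.inertia (Field.absoluteGaloisGroup F),
            ((ρ₀ σ).val 0 0 - 1 : O) ∈ IsLocalRing.maximalIdeal O ∧ ((ρ₀ σ).val 1 1 - 1 : O) ∈ IsLocalRing.maximalIdeal O) →
          E.HasGoodReductionAt v) →
      (E.framedTateGaloisRep p).toGaloisRep.IsIrreducible →
      ∃ (r : Literature.NumberTheory.GaloisRepresentations.FramedGaloisRep F (PadicAlgCl p) 2)
        (r₀ : Field.absoluteGaloisGroup F →* Matrix.GeneralLinearGroup (Fin 2) O)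
        (Pfr : Matrix.GeneralLinearGroup (Fin 2) (PadicAlgCl p)) (S : Set (IsDedekindDomain.HeightOneSpectrum (NumberField.RingOfIntegers F))),
        r = Literature.NumberTheory.GaloisRepresentations.FramedRep.conj Pfr (E.framedTateGaloisRep p) ∧
        r.toGaloisRep.IsIrreducible ∧ r.HasUpperTriangularIntegralModel r₀ ∧
        (∀ g, ((r₀ g).val 0 0 - (ρ₀ g).val 0 0 : O) ∈ IsLocalRing.maximalIdeal O ∧
          ((r₀ g).val 1 1 - (ρ₀ g).val 1 1 : O) ∈ IsLocalRing.maximalIdeal O) ∧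
        (∃ k : ℕ, 2 ≤ k ∧ ∃ m : ℕ, 0 < m ∧ ∀ v : IsDedekindDomain.HeightOneSpectrum (NumberField.RingOfIntegers F), (p : NumberField.RingOfIntegers F) ∈ v.asIdeal →
          ∃ Q : Matrix.GeneralLinearGroup (Fin 2) (PadicAlgCl p),
            Valued.v (Q.val 0 0) ≤ Valued.v (Q.val 1 0) ∧
            ∀ σ, (Q⁻¹ * r.toLocal v σ * Q).val 1 0 = 0 ∧
              (σ ∈ Literature.NumberTheory.GaloisRepresentations.absInertia (v.adicCompletion F) →
                (Q⁻¹ * r.toLocal v σ * Q).val 1 1 ^ m = 1 ∧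
                (Q⁻¹ * r.toLocal v σ * Q).val 0 0 ^ m =
                  algebraMap (Padic p) (PadicAlgCl p)
                    (((Literature.NumberTheory.GaloisRepresentations.GaloisRep.cyclotomicCharacter (v.adicCompletion F) p σ).val : PadicInt p) :
                      Padic p) ^ ((k - 1) * m))) ∧
        S.Finite ∧ (∀ v : IsDedekindDomain.HeightOneSpectrum (NumberField.RingOfIntegers F), (p : NumberField.RingOfIntegers F) ∈ v.asIdeal → v ∈ S) ∧
        (∀ v ∉ S, r.IsUnramifiedAt v) ∧ (∀ v ∉ S, E.HasGoodReductionAt v) ∧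
        (∀ v : IsDedekindDomain.HeightOneSpectrum (NumberField.RingOfIntegers F), v ≠ q → (p : NumberField.RingOfIntegers F) ∉ v.asIdeal →
          (∀ 𝔓 ∈ v.primesAbove, ∀ σ ∈ 𝔓.inertia (Field.absoluteGaloisGroup F),
            ((ρ₀ σ).val 0 0 - 1 : O) ∈ IsLocalRing.maximalIdeal O ∧ ((ρ₀ σ).val 1 1 - 1 : O) ∈ IsLocalRing.maximalIdeal O) →
          v ∉ S) :=
  Summit.Langlands.Langlands.Theorems.SkinnerWilesDefectOne.EisensteinProModularSeed.stub_cousinGaloisPackage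

/-- **stub_cousinAutomorphic** — CLOSED CONDITIONALLY (`CaraianiNewton2023_cor611_modular` prepended): landed p95253 (wave 3; fact p95252). -/
theorem stub_cousinAutomorphic :
    Literature.NumberTheory.Automorphic.CaraianiNewton2023_cor611_modular →
    ∀ (F : Type) [Field F] [NumberField F], NumberField.IsTotallyComplex F → Module.finrank ℚ F = 2 →
      ∀ (p : ℕ) [Fact p.Prime] (ι : PadicAlgCl p ≃+* ℂ) (E : WeierstrassCurve F) [E.IsElliptic],
      (∃ ρ₃ : Literature.NumberTheory.GaloisRepresentations.FramedGaloisRep F (ZMod 3) 2, E.IsTorsionGaloisRep 3 ρ₃ ∧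
          ∀ g : Matrix.SpecialLinearGroup (Fin 2) (ZMod 3), ∃ σ, ρ₃ σ = Matrix.SpecialLinearGroup.toGL g) →
      ∀ (r : Literature.NumberTheory.GaloisRepresentations.FramedGaloisRep F (PadicAlgCl p) 2)
        (Pfr : Matrix.GeneralLinearGroup (Fin 2) (PadicAlgCl p)),
      r = Literature.NumberTheory.GaloisRepresentations.FramedRep.conj Pfr (E.framedTateGaloisRep p) →
      ∀ (S : Set (IsDedekindDomain.HeightOneSpectrum (NumberField.RingOfIntegers F))), S.Finite →
      (∀ v : IsDedekindDomain.HeightOneSpectrum (NumberField.RingOfIntegers F), (p : NumberField.RingOfIntegers F) ∈ v.asIdeal → v ∈ S) →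
      (∀ v ∉ S, E.HasGoodReductionAt v) →
      ∀ hcpt : Literature.NumberTheory.Automorphic.isCompact_glFiniteIntegralLevel 2 F,
        ∃ (πF : Literature.NumberTheory.Automorphic.CuspidalAutomorphicRepData 2 F hcpt) (T' : Literature.NumberTheory.Automorphic.InfinityType F 2),
          πF.1.HasInfinityType T' ∧ T'.IsLAlgebraic ∧ T'.IsRegular ∧
          ∀ v ∉ S, Summit.Langlands.SatakeFrobCompatibleAt ι πF.1 r v :=
  Summit.Langlands.Langlands.Theorems.SkinnerWilesDefectOne.EisensteinProModularSeed.stub_cousinAutomorphic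

/-- **stub_twistGaloisTransport** (S7c, v5) — CLOSED: landed p103537 (wave 1, worker; tree file
`…EisensteinProModularSeedTwistGaloisTransport.lean`, 339 lines, fact-free; `_fq` twin = this statement verbatim). -/
theorem stub_twistGaloisTransport :
    ∀ (F : Type) [Field F] [NumberField F] (p : ℕ) [Fact p.Prime] (O : ValuationSubring (PadicAlgCl p)),
      O = (Valued.v : Valuation (PadicAlgCl p) NNReal).valuationSubring →
      ∀ (ρ : Literature.NumberTheory.GaloisRepresentations.FramedGaloisRep F (PadicAlgCl p) 2)
        (ρ₀ ρ₀' : Field.absoluteGaloisGroup F →* Matrix.GeneralLinearGroup (Fin 2) O)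
        (ν : Field.absoluteGaloisGroup F →ₜ* (PadicAlgCl p)ˣ) (n : ℕ),
      (∀ᶠ v in Filter.cofinite, ρ.IsUnramifiedAt v) → ρ.HasUpperTriangularIntegralModel ρ₀ →
      0 < n → (∀ σ, ν σ ^ n = 1) →
      (∀ σ (i j : Fin 2), ((ρ₀ σ).val i j : PadicAlgCl p) = ((ν σ : (PadicAlgCl p)ˣ) : PadicAlgCl p) * ((ρ₀' σ).val i j : PadicAlgCl p)) →
      ∀ (r' : Literature.NumberTheory.GaloisRepresentations.FramedGaloisRep F (PadicAlgCl p) 2)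
        (r₀' : Field.absoluteGaloisGroup F →* Matrix.GeneralLinearGroup (Fin 2) O)
        (q : IsDedekindDomain.HeightOneSpectrum (NumberField.RingOfIntegers F))
        (S : Set (IsDedekindDomain.HeightOneSpectrum (NumberField.RingOfIntegers F))) (k m : ℕ),
      r'.toGaloisRep.IsIrreducible → r'.HasUpperTriangularIntegralModel r₀' →
      (∀ g, ((r₀' g).val 0 0 - (ρ₀' g).val 0 0 : O) ∈ IsLocalRing.maximalIdeal O ∧
        ((r₀' g).val 1 1 - (ρ₀' g).val 1 1 : O) ∈ IsLocalRing.maximalIdeal O) →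
      0 < m →
      (∀ v : IsDedekindDomain.HeightOneSpectrum (NumberField.RingOfIntegers F), (p : NumberField.RingOfIntegers F) ∈ v.asIdeal →
        ∃ Q : Matrix.GeneralLinearGroup (Fin 2) (PadicAlgCl p),
          Valued.v (Q.val 0 0) ≤ Valued.v (Q.val 1 0) ∧
          ∀ σ, (Q⁻¹ * r'.toLocal v σ * Q).val 1 0 = 0 ∧
            (σ ∈ Literature.NumberTheory.GaloisRepresentations.absInertia (v.adicCompletion F) →
              (Q⁻¹ * r'.toLocal v σ * Q).val 1 1 ^ m = 1 ∧
              (Q⁻¹ * r'.toLocal v σ * Q).val 0 0 ^ m =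
                algebraMap (Padic p) (PadicAlgCl p)
                  (((Literature.NumberTheory.GaloisRepresentations.GaloisRep.cyclotomicCharacter (v.adicCompletion F) p σ).val : PadicInt p) :
                    Padic p) ^ ((k - 1) * m))) →
      S.Finite → (∀ v : IsDedekindDomain.HeightOneSpectrum (NumberField.RingOfIntegers F), (p : NumberField.RingOfIntegers F) ∈ v.asIdeal → v ∈ S) →
      (∀ v ∉ S, r'.IsUnramifiedAt v) →
      (∀ v : IsDedekindDomain.HeightOneSpectrum (NumberField.RingOfIntegers F), v ≠ q → (p : NumberField.RingOfIntegers F) ∉ v.asIdeal →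
        (∀ 𝔓 ∈ v.primesAbove, ∀ σ ∈ 𝔓.inertia (Field.absoluteGaloisGroup F),
          ((ρ₀' σ).val 0 0 - 1 : O) ∈ IsLocalRing.maximalIdeal O ∧ ((ρ₀' σ).val 1 1 - 1 : O) ∈ IsLocalRing.maximalIdeal O) →
        v ∉ S) →
      (∀ v : IsDedekindDomain.HeightOneSpectrum (NumberField.RingOfIntegers F), v ≠ q → (p : NumberField.RingOfIntegers F) ∉ v.asIdeal →
        (∀ 𝔓 ∈ v.primesAbove, ∀ σ ∈ 𝔓.inertia (Field.absoluteGaloisGroup F),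
          ((ρ₀ σ).val 0 0 - 1 : O) ∈ IsLocalRing.maximalIdeal O ∧ ((ρ₀ σ).val 1 1 - 1 : O) ∈ IsLocalRing.maximalIdeal O) →
        ∀ 𝔓 ∈ v.primesAbove, ∀ σ ∈ 𝔓.inertia (Field.absoluteGaloisGroup F), ν σ = 1) →
      ∃ (r : Literature.NumberTheory.GaloisRepresentations.FramedGaloisRep F (PadicAlgCl p) 2)
        (r₀ : Field.absoluteGaloisGroup F →* Matrix.GeneralLinearGroup (Fin 2) O)
        (S' : Set (IsDedekindDomain.HeightOneSpectrum (NumberField.RingOfIntegers F))),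
        (∀ σ, (r σ).val = ((ν σ : (PadicAlgCl p)ˣ) : PadicAlgCl p) • (r' σ).val) ∧
        r.toGaloisRep.IsIrreducible ∧ r.HasUpperTriangularIntegralModel r₀ ∧
        (∀ g, ((r₀ g).val 0 0 - (ρ₀ g).val 0 0 : O) ∈ IsLocalRing.maximalIdeal O ∧
          ((r₀ g).val 1 1 - (ρ₀ g).val 1 1 : O) ∈ IsLocalRing.maximalIdeal O) ∧
        (∀ v : IsDedekindDomain.HeightOneSpectrum (NumberField.RingOfIntegers F), (p : NumberField.RingOfIntegers F) ∈ v.asIdeal →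
          ∃ Q : Matrix.GeneralLinearGroup (Fin 2) (PadicAlgCl p),
            Valued.v (Q.val 0 0) ≤ Valued.v (Q.val 1 0) ∧
            ∀ σ, (Q⁻¹ * r.toLocal v σ * Q).val 1 0 = 0 ∧
              (σ ∈ Literature.NumberTheory.GaloisRepresentations.absInertia (v.adicCompletion F) →
                (Q⁻¹ * r.toLocal v σ * Q).val 1 1 ^ (m * n) = 1 ∧
                (Q⁻¹ * r.toLocal v σ * Q).val 0 0 ^ (m * n) =
                  algebraMap (Padic p) (PadicAlgCl p)
                    (((Literature.NumberTheory.GaloisRepresentations.GaloisRep.cyclotomicCharacter (v.adicCompletion F) p σ).val : PadicInt p) :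
                      Padic p) ^ ((k - 1) * (m * n)))) ∧
        S'.Finite ∧ S ⊆ S' ∧
        (∀ v : IsDedekindDomain.HeightOneSpectrum (NumberField.RingOfIntegers F), (p : NumberField.RingOfIntegers F) ∈ v.asIdeal → v ∈ S') ∧
        (∀ v ∉ S', r.IsUnramifiedAt v) ∧
        (∀ v ∉ S', ∀ 𝔓 ∈ v.primesAbove, ∀ σ ∈ 𝔓.inertia (Field.absoluteGaloisGroup F), ν σ = 1) ∧
        (∀ v : IsDedekindDomain.HeightOneSpectrum (NumberField.RingOfIntegers F), v ≠ q → (p : NumberField.RingOfIntegers F) ∉ v.asIdeal →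
          (∀ 𝔓 ∈ v.primesAbove, ∀ σ ∈ 𝔓.inertia (Field.absoluteGaloisGroup F),
            ((ρ₀ σ).val 0 0 - 1 : O) ∈ IsLocalRing.maximalIdeal O ∧ ((ρ₀ σ).val 1 1 - 1 : O) ∈ IsLocalRing.maximalIdeal O) →
          v ∉ S') :=
  Summit.Langlands.Langlands.Theorems.SkinnerWilesDefectOne.EisensteinProModularSeed.stub_twistGaloisTransport_fq

/-- **stub_twistAutomorphicTransport** (S7d, v5) — CLOSED: landed p106056 (wave 1, worker; resubmission of p104849 bounced by a gate
restart; tree file `…EisensteinProModularSeedTwistAutomorphicTransport.lean`, fact-free). -/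
theorem stub_twistAutomorphicTransport :
    ∀ (F : Type) [Field F] [NumberField F] (p : ℕ) [Fact p.Prime]
      (hcpt : Literature.NumberTheory.Automorphic.isCompact_glFiniteIntegralLevel 2 F) (ι : PadicAlgCl p ≃+* ℂ)
      (πF : Literature.NumberTheory.Automorphic.CuspidalAutomorphicRepData 2 F hcpt) (T : Literature.NumberTheory.Automorphic.InfinityType F 2),
      πF.1.HasInfinityType T → T.IsLAlgebraic → T.IsRegular →
      ∀ (r' r : Literature.NumberTheory.GaloisRepresentations.FramedGaloisRep F (PadicAlgCl p) 2)
        (ν : Field.absoluteGaloisGroup F →ₜ* (PadicAlgCl p)ˣ),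
      (∃ n : ℕ, 0 < n ∧ ∀ σ, ν σ ^ n = 1) →
      (∀ σ, (r σ).val = ((ν σ : (PadicAlgCl p)ˣ) : PadicAlgCl p) • (r' σ).val) →
      ∀ (S S' : Set (IsDedekindDomain.HeightOneSpectrum (NumberField.RingOfIntegers F))), S ⊆ S' →
      (∀ v ∉ S, Summit.Langlands.SatakeFrobCompatibleAt ι πF.1 r' v) →
      (∀ v ∉ S', r.IsUnramifiedAt v) →
      (∀ v ∉ S', ∀ 𝔓 ∈ v.primesAbove, ∀ σ ∈ 𝔓.inertia (Field.absoluteGaloisGroup F), ν σ = 1) →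
      ∃ (πF' : Literature.NumberTheory.Automorphic.CuspidalAutomorphicRepData 2 F hcpt) (T' : Literature.NumberTheory.Automorphic.InfinityType F 2),
        πF'.1.HasInfinityType T' ∧ T'.IsLAlgebraic ∧ T'.IsRegular ∧
        ∀ v ∉ S', Summit.Langlands.SatakeFrobCompatibleAt ι πF'.1 r v := by
  -- LANDED p106056: `exact Summit.Langlands.Langlands.Theorems.SkinnerWilesDefectOne.EisensteinProModularSeed.stub_twistAutomorphicTransport`
  -- (sorried only until the farm builds the module; re-enable the import above)
  sorry

/-- **stub_cousinGaloisPackageWide** (S7e, v6) — OPEN (waved; statement = `S.stub_cousinGaloisPackageWide` in the skeleton's short spelling). -/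
theorem stub_cousinGaloisPackageWide :
  Literature.NumberTheory.EllipticCurves.ellipticOrdinaryReduction_tateModule_filtration →
  Literature.NumberTheory.EllipticCurves.ordinaryReduction_of_inertiaFixed_pTorsion →
    ∀ (F : Type) [Field F] [NumberField F], NumberField.IsTotallyComplex F → Module.finrank ℚ F = 2 →
      ∀ (p : ℕ) [Fact p.Prime] (O : ValuationSubring (PadicAlgCl p)),
      O = (Valued.v : Valuation (PadicAlgCl p) NNReal).valuationSubring →
      ∀ (ρ₀ : absoluteGaloisGroup F →* Matrix.GeneralLinearGroup (Fin 2) O)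
        (E : WeierstrassCurve F) [E.IsElliptic] (P Q : E.geomTorsion p) (q : HeightOneSpectrum (𝓞 F)),
      P ≠ 0 → (∀ a : ℤ, Q ≠ a • P) →
      (∀ σ : absoluteGaloisGroup F, ∃ a b d : ℤ, σ • P = a • P ∧ σ • Q = b • P + d • Q ∧
          ((ρ₀ σ).val 0 0 - a : O) ∈ maximalIdeal O ∧ ((ρ₀ σ).val 1 1 - d : O) ∈ maximalIdeal O) →
      (∀ v : HeightOneSpectrum (𝓞 F), (p : 𝓞 F) ∈ v.asIdeal →
          (∀ 𝔓 ∈ v.primesAbove, ∀ σ ∈ 𝔓.inertia (absoluteGaloisGroup F), σ • P = P) ∧ E.HasGoodReductionAt v ∧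
          v.asIdeal.ramificationIdx ℤ < p - 1 ∧
          ∃ σ ∈ absInertia (v.adicCompletion F),
            PadicInt.toZModPow 1 ((GaloisRep.cyclotomicCharacter (v.adicCompletion F) p σ : ℤ_[p]ˣ) : ℤ_[p]) ≠ 1) →
      (∀ v : HeightOneSpectrum (𝓞 F), v ≠ q → (p : 𝓞 F) ∉ v.asIdeal →
          (∀ 𝔓 ∈ v.primesAbove, ∀ σ ∈ 𝔓.inertia (absoluteGaloisGroup F),
            ((ρ₀ σ).val 0 0 - 1 : O) ∈ maximalIdeal O ∧ ((ρ₀ σ).val 1 1 - 1 : O) ∈ maximalIdeal O) →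
          E.HasGoodReductionAt v) →
      (E.framedTateGaloisRep p).toGaloisRep.IsIrreducible →
      ∃ (r : FramedGaloisRep F (PadicAlgCl p) 2)
        (r₀ : absoluteGaloisGroup F →* Matrix.GeneralLinearGroup (Fin 2) O)
        (Pfr : Matrix.GeneralLinearGroup (Fin 2) (PadicAlgCl p)) (S : Set (HeightOneSpectrum (𝓞 F))),
        r = FramedRep.conj Pfr (E.framedTateGaloisRep p) ∧
        r.toGaloisRep.IsIrreducible ∧ r.HasUpperTriangularIntegralModel r₀ ∧
        (∀ g, ((r₀ g).val 0 0 - (ρ₀ g).val 0 0 : O) ∈ maximalIdeal O ∧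
          ((r₀ g).val 1 1 - (ρ₀ g).val 1 1 : O) ∈ maximalIdeal O) ∧
        (∃ k : ℕ, 2 ≤ k ∧ ∃ m : ℕ, 0 < m ∧ ∀ v : HeightOneSpectrum (𝓞 F), (p : 𝓞 F) ∈ v.asIdeal →
          ∃ Q : Matrix.GeneralLinearGroup (Fin 2) (PadicAlgCl p),
            Valued.v (Q.val 0 0) ≤ Valued.v (Q.val 1 0) ∧
            ∀ σ, (Q⁻¹ * r.toLocal v σ * Q).val 1 0 = 0 ∧
              (σ ∈ absInertia (v.adicCompletion F) →
                (Q⁻¹ * r.toLocal v σ * Q).val 1 1 ^ m = 1 ∧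
                (Q⁻¹ * r.toLocal v σ * Q).val 0 0 ^ m =
                  algebraMap (Padic p) (PadicAlgCl p)
                    (((GaloisRep.cyclotomicCharacter (v.adicCompletion F) p σ).val : PadicInt p) :
                      Padic p) ^ ((k - 1) * m))) ∧
        S.Finite ∧ (∀ v : HeightOneSpectrum (𝓞 F), (p : 𝓞 F) ∈ v.asIdeal → v ∈ S) ∧
        (∀ v ∉ S, r.IsUnramifiedAt v) ∧ (∀ v ∉ S, E.HasGoodReductionAt v) ∧
        (∀ v : HeightOneSpectrum (𝓞 F), v ≠ q → (p : 𝓞 F) ∉ v.asIdeal →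
          (∀ 𝔓 ∈ v.primesAbove, ∀ σ ∈ 𝔓.inertia (absoluteGaloisGroup F),
            ((ρ₀ σ).val 0 0 - 1 : O) ∈ maximalIdeal O ∧ ((ρ₀ σ).val 1 1 - 1 : O) ∈ maximalIdeal O) →
          v ∉ S) := by
  sorry

/-- **stub_cousinAutomorphicWide** (S7f, v6) — OPEN (waved; statement = `S.stub_cousinAutomorphicWide` in the skeleton's short spelling). -/
theorem stub_cousinAutomorphicWide :
  (∀ (F : Type) [Field F] [NumberField F], NumberField.IsTotallyComplex F → Module.finrank ℚ F = 2 →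
    ∀ (E : WeierstrassCurve F) [E.IsElliptic], ¬ E.HasCM →
      (ModPImageAbsIrreducibleOverCyclotomic E 3 ∨
        @ModPImageAbsIrreducibleOverCyclotomic F _ E 5 ⟨Nat.prime_five⟩) →
      ∃ (hF : isCompact_glFiniteIntegralLevel 2 F)
        (π : CuspidalAutomorphicRepData 2 F hF),
        π.1.HasWeightZero ∧
          ∀ w : HeightOneSpectrum (𝓞 F), E.HasGoodReductionAt w →
            π.1.HasHeckePolynomialAt w
              ((frobPoly (E.frobeniusTraceAt w) w.residueCard).map (Int.castRingHom ℂ))) →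
    ∀ (F : Type) [Field F] [NumberField F], NumberField.IsTotallyComplex F → Module.finrank ℚ F = 2 →
      ∀ (p : ℕ) [Fact p.Prime] (ι : PadicAlgCl p ≃+* ℂ) (E : WeierstrassCurve F) [E.IsElliptic],
      ¬ E.HasCM →
      (ModPImageAbsIrreducibleOverCyclotomic E 3 ∨
        @ModPImageAbsIrreducibleOverCyclotomic F _ E 5 ⟨Nat.prime_five⟩) →
      ∀ (r : FramedGaloisRep F (PadicAlgCl p) 2)
        (Pfr : Matrix.GeneralLinearGroup (Fin 2) (PadicAlgCl p)),
      r = FramedRep.conj Pfr (E.framedTateGaloisRep p) →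
      ∀ (S : Set (HeightOneSpectrum (𝓞 F))), S.Finite →
      (∀ v : HeightOneSpectrum (𝓞 F), (p : 𝓞 F) ∈ v.asIdeal → v ∈ S) →
      (∀ v ∉ S, E.HasGoodReductionAt v) →
      ∀ hcpt : isCompact_glFiniteIntegralLevel 2 F,
        ∃ (πF : CuspidalAutomorphicRepData 2 F hcpt) (T' : InfinityType F 2),
          πF.1.HasInfinityType T' ∧ T'.IsLAlgebraic ∧ T'.IsRegular ∧
          ∀ v ∉ S, Summit.Langlands.SatakeFrobCompatibleAt ι πF.1 r v := by
  sorry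

/-- **stub_genuineCoreSeed** (S6'''', v6) — the CONCEDED COMPLEMENT (open problem; the lead's stub; statement = `S.stub_genuineCoreSeed`). -/
theorem stub_genuineCoreSeed :
    ∀ (F : Type) [Field F] [NumberField F], NumberField.IsTotallyComplex F → Module.finrank ℚ F = 2 →
      ∀ (p : ℕ) [Fact p.Prime], p ≠ 2 → ∀ (O : ValuationSubring (PadicAlgCl p)),
      O = (Valued.v : Valuation (PadicAlgCl p) NNReal).valuationSubring →
      ∀ (ρ : FramedGaloisRep F (PadicAlgCl p) 2)
        (ρ₀ : absoluteGaloisGroup F →* Matrix.GeneralLinearGroup (Fin 2) O),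
      ρ.toGaloisRep.IsIrreducible → (∀ᶠ v in cofinite, ρ.IsUnramifiedAt v) →
      ρ.HasUpperTriangularIntegralModel ρ₀ →
      (∃ k : ℕ, 2 ≤ k ∧ ∃ m : ℕ, 0 < m ∧ ∀ v : HeightOneSpectrum (𝓞 F), (p : 𝓞 F) ∈ v.asIdeal →
        IsPDistinguishedAt ρ₀ v ∧ ∃ Q : Matrix.GeneralLinearGroup (Fin 2) (PadicAlgCl p),
          Valued.v (Q.val 0 0) ≤ Valued.v (Q.val 1 0) ∧
          ∀ σ, (Q⁻¹ * ρ.toLocal v σ * Q).val 1 0 = 0 ∧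
            (σ ∈ absInertia (v.adicCompletion F) →
              (Q⁻¹ * ρ.toLocal v σ * Q).val 1 1 ^ m = 1 ∧
              (Q⁻¹ * ρ.toLocal v σ * Q).val 0 0 ^ m =
                algebraMap (Padic p) (PadicAlgCl p)
                  (((GaloisRep.cyclotomicCharacter (v.adicCompletion F) p σ).val : PadicInt p) :
                    Padic p) ^ ((k - 1) * m))) →
      ¬ DescendsOdd F p O ρ₀ → ¬ HasTwistedCousin F p O ρ₀ → ¬ HasWideCousin F p O ρ₀ →
      ∃ (𝒰 : BigHeckeGLn.TameLevel 2 F p) (r : FramedGaloisRep F (PadicAlgCl p) 2)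
        (r₀ : absoluteGaloisGroup F →* Matrix.GeneralLinearGroup (Fin 2) O)
        (q : HeightOneSpectrum (𝓞 F)),
        r.toGaloisRep.IsIrreducible ∧ 𝒰.IsPadicallyAutomorphic r ∧
        r.HasUpperTriangularIntegralModel r₀ ∧
        (∀ g, ((r₀ g).val 0 0 - (ρ₀ g).val 0 0 : O) ∈ maximalIdeal O ∧
          ((r₀ g).val 1 1 - (ρ₀ g).val 1 1 : O) ∈ maximalIdeal O) ∧
        (∃ k : ℕ, 2 ≤ k ∧ ∃ m : ℕ, 0 < m ∧ ∀ v : HeightOneSpectrum (𝓞 F), (p : 𝓞 F) ∈ v.asIdeal →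
          ∃ Q : Matrix.GeneralLinearGroup (Fin 2) (PadicAlgCl p),
            Valued.v (Q.val 0 0) ≤ Valued.v (Q.val 1 0) ∧
            ∀ σ, (Q⁻¹ * r.toLocal v σ * Q).val 1 0 = 0 ∧
              (σ ∈ absInertia (v.adicCompletion F) →
                (Q⁻¹ * r.toLocal v σ * Q).val 1 1 ^ m = 1 ∧
                (Q⁻¹ * r.toLocal v σ * Q).val 0 0 ^ m =
                  algebraMap (Padic p) (PadicAlgCl p)
                    (((GaloisRep.cyclotomicCharacter (v.adicCompletion F) p σ).val : PadicInt p) :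
                      Padic p) ^ ((k - 1) * m))) ∧
        (∀ v : HeightOneSpectrum (𝓞 F), v ≠ q → (p : 𝓞 F) ∉ v.asIdeal →
          (∀ 𝔓 ∈ v.primesAbove, ∀ σ ∈ 𝔓.inertia (absoluteGaloisGroup F),
            ((ρ₀ σ).val 0 0 - 1 : O) ∈ maximalIdeal O ∧ ((ρ₀ σ).val 1 1 - 1 : O) ∈ maximalIdeal O) →
          v ∉ 𝒰.bad)
 := by
  sorry


/-! ## 3. The glue on the odd-descended regime (proved): S1' + S0 + S2' + S3-Nu + S4 + S5 ⟹ the conclusion, from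
`(hunr, hmod, p-distinguishedness)` alone (Disproof §3 `crux_of_pairSeed`) -/

/-- **The odd-descended regime.**  For `F` imaginary quadratic, `p` prime, `O = 𝒪_{ℚ̄_p}` and ANY continuous `ρ` with a residually
upper-triangular integral model `ρ₀`, unramified a.e. and `p`-distinguished at `v ∣ p`: if the residual ratio descends oddly
(`DescendsOdd`), the crux's conclusion holds for `ρ₀`. -/
theorem seed_of_descendsOdd
    (f₁ : Literature.NumberTheory.EllipticCurves.BillereyMenares2016_thm22_exists_newform_odd)
    (f₂ : Literature.NumberTheory.EllipticCurves.Hida2000_thm326_exists_galoisRep)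
    (f₃ : Literature.NumberTheory.EllipticCurves.Hida2000_thm326_ordinary_unitRoot)
    (f₄ : Literature.NumberTheory.EllipticCurves.Hida2000_thm326_inertia_of_level)
    (f₅ : Literature.NumberTheory.EllipticCurves.Gelbart1975_exists_cuspidalRepData_LAlgebraic)
    (e₁ : Literature.NumberTheory.Automorphic.bianchi_cuspidal_regularLAlgebraic_eigenclassExists)
    (e₂ : Literature.NumberTheory.Automorphic.algebraicWeightEigenclass_continuousPoint)
    (h₀ : S.stub_distinguishedDescendsQ) (h₁ : S.stub_inertSupplyPrimeSqAll)
    (h₂ : S.stub_eisensteinPackageQOdd) (h₃ : S.stub_restrictTwistGaloisPackageNu)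
    (h₄ : S.stub_quadraticBaseChangeTwist) (h₅ : S.stub_cuspidalCohomologicalPoint)
    (F : Type) [Field F] [NumberField F] (hF : IsTotallyComplex F) (hdeg : Module.finrank ℚ F = 2)
    (p : ℕ) [Fact p.Prime] (O : ValuationSubring (PadicAlgCl p))
    (hO : O = (Valued.v : Valuation (PadicAlgCl p) NNReal).valuationSubring)
    (ρ : FramedGaloisRep F (PadicAlgCl p) 2) (ρ₀ : absoluteGaloisGroup F →* Matrix.GeneralLinearGroup (Fin 2) O)
    (hunr : ∀ᶠ v in cofinite, ρ.IsUnramifiedAt v) (hmod : ρ.HasUpperTriangularIntegralModel ρ₀)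
    (hdist : ∀ v : HeightOneSpectrum (𝓞 F), (p : 𝓞 F) ∈ v.asIdeal → IsPDistinguishedAt ρ₀ v)
    (hP : DescendsOdd F p O ρ₀) :
    ∃ (𝒰 : TameLevel 2 F p) (r : FramedGaloisRep F (PadicAlgCl p) 2)
      (r₀ : absoluteGaloisGroup F →* Matrix.GeneralLinearGroup (Fin 2) O)
      (q : HeightOneSpectrum (𝓞 F)),
      r.toGaloisRep.IsIrreducible ∧ 𝒰.IsPadicallyAutomorphic r ∧
      r.HasUpperTriangularIntegralModel r₀ ∧
      (∀ g, ((r₀ g).val 0 0 - (ρ₀ g).val 0 0 : O) ∈ maximalIdeal O ∧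
        ((r₀ g).val 1 1 - (ρ₀ g).val 1 1 : O) ∈ maximalIdeal O) ∧
      (∃ k : ℕ, 2 ≤ k ∧ ∃ m : ℕ, 0 < m ∧ ∀ v : HeightOneSpectrum (𝓞 F), (p : 𝓞 F) ∈ v.asIdeal →
        ∃ Q : Matrix.GeneralLinearGroup (Fin 2) (PadicAlgCl p),
          Valued.v (Q.val 0 0) ≤ Valued.v (Q.val 1 0) ∧
          ∀ σ, (Q⁻¹ * r.toLocal v σ * Q).val 1 0 = 0 ∧
            (σ ∈ absInertia (v.adicCompletion F) →
              (Q⁻¹ * r.toLocal v σ * Q).val 1 1 ^ m = 1 ∧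
              (Q⁻¹ * r.toLocal v σ * Q).val 0 0 ^ m =
                algebraMap (Padic p) (PadicAlgCl p)
                  (((GaloisRep.cyclotomicCharacter (v.adicCompletion F) p σ).val : PadicInt p) :
                    Padic p) ^ ((k - 1) * m))) ∧
      (∀ v : HeightOneSpectrum (𝓞 F), v ≠ q → (p : 𝓞 F) ∉ v.asIdeal →
        (∀ 𝔓 ∈ v.primesAbove, ∀ σ ∈ 𝔓.inertia (absoluteGaloisGroup F),
          ((ρ₀ σ).val 0 0 - 1 : O) ∈ maximalIdeal O ∧ ((ρ₀ σ).val 1 1 - 1 : O) ∈ maximalIdeal O) →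
        v ∉ 𝒰.bad) := by
  obtain ⟨hp2, η, hU, hD, hodd⟩ := hP
  -- S1'': a level-raising prime `M ≡ -1 (mod p²)` (every prime `p`), inert in `F`, with `η̄(Frob_M) = -1`
  obtain ⟨M, hMp, hMne, hMinert, hMunr, hMfrob, hMsq⟩ := h₁ F hF hdeg p η hU hodd
  -- S0: `p`-distinguishedness descends to `ℚ`
  have hdistQ := h₀ F p O hO ρ ρ₀ hmod hdist η hU hD
  -- S2'': the Eisenstein-congruent ordinary newform over `ℚ` (BM16 Thm 2.2, odd `l`) and its Galois package
  obtain ⟨k, ρ', ρ'₀, hk, hirr', hmod', hdiag', hord', hlev', hmodular⟩ :=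
    h₂ f₁ f₂ f₃ f₄ f₅ p hp2 O hO η M hU hodd hdistQ hMp hMne hMunr hMfrob hMsq
  -- S3-Nu: restrict to `Γ_F`, twist by the Teichmüller lift of `χ̄_a`, frames, level set `S`, the place `q`
  obtain ⟨r, r₀, ν, q, S, hν, hrν, hrirr, hrmod, hrdiag, hrord, hSfin, hSp, hSunr, hνS, hSlev⟩ :=
    h₃ F hF hdeg p O hO ρ ρ₀ hunr hmod hdist η M k ρ' ρ'₀ hU hD hMp hMinert hk hirr' hmod' hdiag' hord' hlev'
  -- S2''s modularity clause over `ℚ`, then S4: quadratic base change + twist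
  obtain ⟨ι, π, T, hT, hTL, hTR, hcompat⟩ := hmodular (isCompact_glFiniteIntegralLevel_holds 2 ℚ)
  obtain ⟨πF, T', hT', hT'L, hT'R, hcompatF⟩ :=
    h₄ F hF hdeg p (isCompact_glFiniteIntegralLevel_holds 2 ℚ) ι π T hT hTL hTR ρ' hcompat ν hν r hrν hrirr
      S hSfin hSp hSunr hνS (isCompact_glFiniteIntegralLevel_holds 2 F)
  -- S5: the dictionary — a continuous `ℚ̄_p`-point of `𝕋(𝒰)`, `𝒰.bad = S`
  obtain ⟨𝒰, hbad, hpa⟩ :=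
    h₅ e₁ e₂ F hF hdeg p (isCompact_glFiniteIntegralLevel_holds 2 F) ι πF T' hT' hT'L hT'R S hSfin hSp r hcompatF
  exact ⟨𝒰, r, r₀, q, hrirr, hpa, hrmod, hrdiag, hrord, fun v hvq hvp hur => hbad ▸ hSlev v hvq hvp hur⟩

/-- **The cousin regime** (graft of big-image-cousin K2 ∘ S, over the landed dictionary S5): for `F` imaginary quadratic and a datum
`ρ₀` with a twist-free cousin, the crux's conclusion holds — S7a (Galois package) + S7b (Caraiani–Newton automorphy) + S5. -/
theorem seed_of_cousin
    (e₁ : Literature.NumberTheory.Automorphic.bianchi_cuspidal_regularLAlgebraic_eigenclassExists)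
    (e₂ : Literature.NumberTheory.Automorphic.algebraicWeightEigenclass_continuousPoint)
    (s₁ : Literature.NumberTheory.EllipticCurves.ellipticOrdinaryReduction_tateModule_filtration)
    (s₂ : Literature.NumberTheory.EllipticCurves.ordinaryReduction_of_inertiaFixed_pTorsion)
    (c₁ : Literature.NumberTheory.Automorphic.CaraianiNewton2023_cor611_modular)
    (h₇ : S.stub_cousinGaloisPackage) (h₈ : S.stub_cousinAutomorphic) (h₅ : S.stub_cuspidalCohomologicalPoint)
    (F : Type) [Field F] [NumberField F] (hF : IsTotallyComplex F) (hdeg : Module.finrank ℚ F = 2)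
    (p : ℕ) [Fact p.Prime] (O : ValuationSubring (PadicAlgCl p))
    (hO : O = (Valued.v : Valuation (PadicAlgCl p) NNReal).valuationSubring)
    (ρ₀ : absoluteGaloisGroup F →* Matrix.GeneralLinearGroup (Fin 2) O)
    (hC : HasCousin F p O ρ₀) :
    ∃ (𝒰 : TameLevel 2 F p) (r : FramedGaloisRep F (PadicAlgCl p) 2)
      (r₀ : absoluteGaloisGroup F →* Matrix.GeneralLinearGroup (Fin 2) O)
      (q : HeightOneSpectrum (𝓞 F)),
      r.toGaloisRep.IsIrreducible ∧ 𝒰.IsPadicallyAutomorphic r ∧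
      r.HasUpperTriangularIntegralModel r₀ ∧
      (∀ g, ((r₀ g).val 0 0 - (ρ₀ g).val 0 0 : O) ∈ maximalIdeal O ∧
        ((r₀ g).val 1 1 - (ρ₀ g).val 1 1 : O) ∈ maximalIdeal O) ∧
      (∃ k : ℕ, 2 ≤ k ∧ ∃ m : ℕ, 0 < m ∧ ∀ v : HeightOneSpectrum (𝓞 F), (p : 𝓞 F) ∈ v.asIdeal →
        ∃ Q : Matrix.GeneralLinearGroup (Fin 2) (PadicAlgCl p),
          Valued.v (Q.val 0 0) ≤ Valued.v (Q.val 1 0) ∧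
          ∀ σ, (Q⁻¹ * r.toLocal v σ * Q).val 1 0 = 0 ∧
            (σ ∈ absInertia (v.adicCompletion F) →
              (Q⁻¹ * r.toLocal v σ * Q).val 1 1 ^ m = 1 ∧
              (Q⁻¹ * r.toLocal v σ * Q).val 0 0 ^ m =
                algebraMap (Padic p) (PadicAlgCl p)
                  (((GaloisRep.cyclotomicCharacter (v.adicCompletion F) p σ).val : PadicInt p) :
                    Padic p) ^ ((k - 1) * m))) ∧
      (∀ v : HeightOneSpectrum (𝓞 F), v ≠ q → (p : 𝓞 F) ∉ v.asIdeal →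
        (∀ 𝔓 ∈ v.primesAbove, ∀ σ ∈ 𝔓.inertia (absoluteGaloisGroup F),
          ((ρ₀ σ).val 0 0 - 1 : O) ∈ maximalIdeal O ∧ ((ρ₀ σ).val 1 1 - 1 : O) ∈ maximalIdeal O) →
        v ∉ 𝒰.bad) := by
  obtain ⟨hp5, E, hE, P, Q, q, hP, hQ, hact, hatp, hlev, hbig, hVirr⟩ := hC
  -- S7a: the Galois package of the cousin
  obtain ⟨r, r₀, Pfr, S, hr, hrirr, hrmod, hrdiag, hrord, hSfin, hSp, hSunr, hSgood, hSlev⟩ :=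
    h₇ s₁ s₂ F hF hdeg p hp5 O hO ρ₀ E P Q q hP hQ hact hatp hlev hVirr
  -- S7b: Caraiani–Newton automorphy of the cousin, Satake–Frobenius compatible with `r` off `S`
  obtain ⟨ι⟩ := PadicAlgCl.nonempty_ringEquiv_complex (p := p)
  obtain ⟨πF, T', hT', hT'L, hT'R, hcompatF⟩ :=
    h₈ c₁ F hF hdeg p ι E hbig r Pfr hr S hSfin hSp hSgood (isCompact_glFiniteIntegralLevel_holds 2 F)
  -- S5: the dictionary
  obtain ⟨𝒰, hbad, hpa⟩ :=
    h₅ e₁ e₂ F hF hdeg p (isCompact_glFiniteIntegralLevel_holds 2 F) ι πF T' hT' hT'L hT'R S hSfin hSp r hcompatF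
  exact ⟨𝒰, r, r₀, q, hrirr, hpa, hrmod, hrdiag, hrord, fun v hvq hvp hur => hbad ▸ hSlev v hvq hvp hur⟩

/-- `HasCousin ⊆ HasTwistedCousin` (take `ν = 1`, `n = 1`, `ρ₀' = ρ₀`). [folklore] -/
theorem hasTwistedCousin_of_hasCousin {F : Type} [Field F] [NumberField F] {p : ℕ} [Fact p.Prime]
    {O : ValuationSubring (PadicAlgCl p)}
    {ρ₀ : absoluteGaloisGroup F →* Matrix.GeneralLinearGroup (Fin 2) O}
    (h : HasCousin F p O ρ₀) : HasTwistedCousin F p O ρ₀ := by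
  obtain ⟨hp5, E, hE, P, Q, q, hP, hQ, hact, hatp, hlev, hbig, hVirr⟩ := h
  refine ⟨hp5, 1, 1, ρ₀, E, hE, P, Q, q, Nat.one_pos, fun σ => ?_, fun σ i j => ?_, hP, hQ, hact, hatp, hlev,
    hbig, hVirr, fun v _ _ _ 𝔓 _ σ _ => ?_⟩
  · rw [pow_one, ContinuousMonoidHom.coe_one, Pi.one_apply]
  · rw [ContinuousMonoidHom.coe_one, Pi.one_apply, Units.val_one, one_mul]
  · rw [ContinuousMonoidHom.coe_one, Pi.one_apply]

/-- **The twisted-cousin regime** (v5: graft of big-image-cousin K2 ∘ S UP TO A FINITE-ORDER TWIST, over the landed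
dictionary S5): for `F` imaginary quadratic and a datum `ρ₀` (an integral model of an a.e.-unramified `ρ`) with a twisted
cousin, the crux's conclusion holds — S7a (Galois package of the cousin of `ρ₀' = ν⁻¹ρ₀`) + S7b (Caraiani–Newton automorphy)
+ S7d (twist of the automorphic representation by `χ_ν`) + S7c (Galois transport along `ν`) + S5. -/
theorem seed_of_twistedCousin
    (e₁ : Literature.NumberTheory.Automorphic.bianchi_cuspidal_regularLAlgebraic_eigenclassExists)
    (e₂ : Literature.NumberTheory.Automorphic.algebraicWeightEigenclass_continuousPoint)
    (s₁ : Literature.NumberTheory.EllipticCurves.ellipticOrdinaryReduction_tateModule_filtration)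
    (s₂ : Literature.NumberTheory.EllipticCurves.ordinaryReduction_of_inertiaFixed_pTorsion)
    (c₁ : Literature.NumberTheory.Automorphic.CaraianiNewton2023_cor611_modular)
    (h₇ : S.stub_cousinGaloisPackage) (h₈ : S.stub_cousinAutomorphic) (h₅ : S.stub_cuspidalCohomologicalPoint)
    (h₉ : S.stub_twistGaloisTransport) (h₁₀ : S.stub_twistAutomorphicTransport)
    (F : Type) [Field F] [NumberField F] (hF : IsTotallyComplex F) (hdeg : Module.finrank ℚ F = 2)
    (p : ℕ) [Fact p.Prime] (O : ValuationSubring (PadicAlgCl p))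
    (hO : O = (Valued.v : Valuation (PadicAlgCl p) NNReal).valuationSubring)
    (ρ : FramedGaloisRep F (PadicAlgCl p) 2) (ρ₀ : absoluteGaloisGroup F →* Matrix.GeneralLinearGroup (Fin 2) O)
    (hunr : ∀ᶠ v in cofinite, ρ.IsUnramifiedAt v) (hmod : ρ.HasUpperTriangularIntegralModel ρ₀)
    (hT : HasTwistedCousin F p O ρ₀) :
    ∃ (𝒰 : TameLevel 2 F p) (r : FramedGaloisRep F (PadicAlgCl p) 2)
      (r₀ : absoluteGaloisGroup F →* Matrix.GeneralLinearGroup (Fin 2) O)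
      (q : HeightOneSpectrum (𝓞 F)),
      r.toGaloisRep.IsIrreducible ∧ 𝒰.IsPadicallyAutomorphic r ∧
      r.HasUpperTriangularIntegralModel r₀ ∧
      (∀ g, ((r₀ g).val 0 0 - (ρ₀ g).val 0 0 : O) ∈ maximalIdeal O ∧
        ((r₀ g).val 1 1 - (ρ₀ g).val 1 1 : O) ∈ maximalIdeal O) ∧
      (∃ k : ℕ, 2 ≤ k ∧ ∃ m : ℕ, 0 < m ∧ ∀ v : HeightOneSpectrum (𝓞 F), (p : 𝓞 F) ∈ v.asIdeal →
        ∃ Q : Matrix.GeneralLinearGroup (Fin 2) (PadicAlgCl p),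
          Valued.v (Q.val 0 0) ≤ Valued.v (Q.val 1 0) ∧
          ∀ σ, (Q⁻¹ * r.toLocal v σ * Q).val 1 0 = 0 ∧
            (σ ∈ absInertia (v.adicCompletion F) →
              (Q⁻¹ * r.toLocal v σ * Q).val 1 1 ^ m = 1 ∧
              (Q⁻¹ * r.toLocal v σ * Q).val 0 0 ^ m =
                algebraMap (Padic p) (PadicAlgCl p)
                  (((GaloisRep.cyclotomicCharacter (v.adicCompletion F) p σ).val : PadicInt p) :
                    Padic p) ^ ((k - 1) * m))) ∧
      (∀ v : HeightOneSpectrum (𝓞 F), v ≠ q → (p : 𝓞 F) ∉ v.asIdeal →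
        (∀ 𝔓 ∈ v.primesAbove, ∀ σ ∈ 𝔓.inertia (absoluteGaloisGroup F),
          ((ρ₀ σ).val 0 0 - 1 : O) ∈ maximalIdeal O ∧ ((ρ₀ σ).val 1 1 - 1 : O) ∈ maximalIdeal O) →
        v ∉ 𝒰.bad) := by
  obtain ⟨hp5, ν, n, ρ₀', E, hE, P, Q, q, hn, hνn, hrel, hP, hQ, hact, hatp, hlev, hbig, hVirr, hνunr⟩ := hT
  -- S7a: the Galois package of the cousin of `ρ₀'`
  obtain ⟨r', r₀', Pfr, S, hr', hr'irr, hr'mod, hr'diag, ⟨k, hk, m, hm, hr'ord⟩, hSfin, hSp, hSunr, hSgood, hSlev⟩ :=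
    h₇ s₁ s₂ F hF hdeg p hp5 O hO ρ₀' E P Q q hP hQ hact hatp hlev hVirr
  -- S7c: transport along `ν` (`r = ν ⊗ r'`, exponent `m·n`, level set `S'`)
  obtain ⟨r, r₀, S', hrr', hrirr, hrmod, hrdiag, hrord, hS'fin, hSS', hS'p, hS'unr, hνS', hS'lev⟩ :=
    h₉ F p O hO ρ ρ₀ ρ₀' ν n hunr hmod hn hνn hrel r' r₀' q S k m hr'irr hr'mod hr'diag hm hr'ord hSfin hSp hSunr
      hSlev hνunr
  -- S7b: Caraiani–Newton automorphy of the cousin, Satake–Frobenius compatible with `r'` off `S`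
  obtain ⟨ι⟩ := PadicAlgCl.nonempty_ringEquiv_complex (p := p)
  obtain ⟨πF, T', hT', hT'L, hT'R, hcompatF⟩ :=
    h₈ c₁ F hF hdeg p ι E hbig r' Pfr hr' S hSfin hSp hSgood (isCompact_glFiniteIntegralLevel_holds 2 F)
  -- S7d: twist the automorphic representation by the Hecke character of `ν`
  obtain ⟨πF', T'', hT'', hT''L, hT''R, hcompatF'⟩ :=
    h₁₀ F p (isCompact_glFiniteIntegralLevel_holds 2 F) ι πF T' hT' hT'L hT'R r' r ν ⟨n, hn, hνn⟩ hrr' S S' hSS'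
      hcompatF hS'unr hνS'
  -- S5: the dictionary
  obtain ⟨𝒰, hbad, hpa⟩ :=
    h₅ e₁ e₂ F hF hdeg p (isCompact_glFiniteIntegralLevel_holds 2 F) ι πF' T'' hT'' hT''L hT''R S' hS'fin hS'p r hcompatF'
  exact ⟨𝒰, r, r₀, q, hrirr, hpa, hrmod, hrdiag, ⟨k, hk, m * n, Nat.mul_pos hm hn, hrord⟩,
    fun v hvq hvp hur => hbad ▸ hS'lev v hvq hvp hur⟩

/-- **The wide-cousin regime** (v6: the twisted-cousin graft with Caraiani–Newton Cor. 6.1.1 as printed and the local hypotheses at `v ∣ p`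
explicit, so every odd `p`): S7e (Galois package of the cousin of `ρ₀'`) + S7c (transport along `ν`) + S7f (automorphy) + S7d (twist) + S5. -/
theorem seed_of_wideCousin
    (e₁ : Literature.NumberTheory.Automorphic.bianchi_cuspidal_regularLAlgebraic_eigenclassExists)
    (e₂ : Literature.NumberTheory.Automorphic.algebraicWeightEigenclass_continuousPoint)
    (s₁ : Literature.NumberTheory.EllipticCurves.ellipticOrdinaryReduction_tateModule_filtration)
    (s₂ : Literature.NumberTheory.EllipticCurves.ordinaryReduction_of_inertiaFixed_pTorsion)
    (c₂ : (∀ (F : Type) [Field F] [NumberField F], NumberField.IsTotallyComplex F → Module.finrank ℚ F = 2 →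
          ∀ (E : WeierstrassCurve F) [E.IsElliptic], ¬ E.HasCM →
            (Literature.NumberTheory.Automorphic.ModPImageAbsIrreducibleOverCyclotomic E 3 ∨
              @Literature.NumberTheory.Automorphic.ModPImageAbsIrreducibleOverCyclotomic F _ E 5 ⟨Nat.prime_five⟩) →
            ∃ (hF : Literature.NumberTheory.Automorphic.isCompact_glFiniteIntegralLevel 2 F)
              (π : Literature.NumberTheory.Automorphic.CuspidalAutomorphicRepData 2 F hF),
              π.1.HasWeightZero ∧
                ∀ w : IsDedekindDomain.HeightOneSpectrum (NumberField.RingOfIntegers F), E.HasGoodReductionAt w →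
                  π.1.HasHeckePolynomialAt w
                    ((Literature.NumberTheory.Automorphic.frobPoly (E.frobeniusTraceAt w) w.residueCard).map (Int.castRingHom ℂ))))
    (h₁₁ : S.stub_cousinGaloisPackageWide) (h₁₂ : S.stub_cousinAutomorphicWide) (h₅ : S.stub_cuspidalCohomologicalPoint)
    (h₉ : S.stub_twistGaloisTransport) (h₁₀ : S.stub_twistAutomorphicTransport)
    (F : Type) [Field F] [NumberField F] (hF : IsTotallyComplex F) (hdeg : Module.finrank ℚ F = 2)
    (p : ℕ) [Fact p.Prime] (O : ValuationSubring (PadicAlgCl p))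
    (hO : O = (Valued.v : Valuation (PadicAlgCl p) NNReal).valuationSubring)
    (ρ : FramedGaloisRep F (PadicAlgCl p) 2) (ρ₀ : absoluteGaloisGroup F →* Matrix.GeneralLinearGroup (Fin 2) O)
    (hunr : ∀ᶠ v in cofinite, ρ.IsUnramifiedAt v) (hmod : ρ.HasUpperTriangularIntegralModel ρ₀)
    (hW : HasWideCousin F p O ρ₀) :
    ∃ (𝒰 : TameLevel 2 F p) (r : FramedGaloisRep F (PadicAlgCl p) 2)
      (r₀ : absoluteGaloisGroup F →* Matrix.GeneralLinearGroup (Fin 2) O)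
      (q : HeightOneSpectrum (𝓞 F)),
      r.toGaloisRep.IsIrreducible ∧ 𝒰.IsPadicallyAutomorphic r ∧
      r.HasUpperTriangularIntegralModel r₀ ∧
      (∀ g, ((r₀ g).val 0 0 - (ρ₀ g).val 0 0 : O) ∈ maximalIdeal O ∧
        ((r₀ g).val 1 1 - (ρ₀ g).val 1 1 : O) ∈ maximalIdeal O) ∧
      (∃ k : ℕ, 2 ≤ k ∧ ∃ m : ℕ, 0 < m ∧ ∀ v : HeightOneSpectrum (𝓞 F), (p : 𝓞 F) ∈ v.asIdeal →
        ∃ Q : Matrix.GeneralLinearGroup (Fin 2) (PadicAlgCl p),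
          Valued.v (Q.val 0 0) ≤ Valued.v (Q.val 1 0) ∧
          ∀ σ, (Q⁻¹ * r.toLocal v σ * Q).val 1 0 = 0 ∧
            (σ ∈ absInertia (v.adicCompletion F) →
              (Q⁻¹ * r.toLocal v σ * Q).val 1 1 ^ m = 1 ∧
              (Q⁻¹ * r.toLocal v σ * Q).val 0 0 ^ m =
                algebraMap (Padic p) (PadicAlgCl p)
                  (((GaloisRep.cyclotomicCharacter (v.adicCompletion F) p σ).val : PadicInt p) :
                    Padic p) ^ ((k - 1) * m))) ∧
      (∀ v : HeightOneSpectrum (𝓞 F), v ≠ q → (p : 𝓞 F) ∉ v.asIdeal →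
        (∀ 𝔓 ∈ v.primesAbove, ∀ σ ∈ 𝔓.inertia (absoluteGaloisGroup F),
          ((ρ₀ σ).val 0 0 - 1 : O) ∈ maximalIdeal O ∧ ((ρ₀ σ).val 1 1 - 1 : O) ∈ maximalIdeal O) →
        v ∉ 𝒰.bad) := by
  obtain ⟨ν, n, ρ₀', E, hE, P, Q, q, hn, hνn, hrel, hP, hQ, hact, hatp, hlev, hCM, hbig, hVirr, hνunr⟩ := hW
  -- S7e: the Galois package of the cousin of `ρ₀'` (local hypotheses explicit)
  obtain ⟨r', r₀', Pfr, S, hr', hr'irr, hr'mod, hr'diag, ⟨k, hk, m, hm, hr'ord⟩, hSfin, hSp, hSunr, hSgood, hSlev⟩ :=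
    h₁₁ s₁ s₂ F hF hdeg p O hO ρ₀' E P Q q hP hQ hact hatp hlev hVirr
  -- S7c: transport along `ν`
  obtain ⟨r, r₀, S', hrr', hrirr, hrmod, hrdiag, hrord, hS'fin, hSS', hS'p, hS'unr, hνS', hS'lev⟩ :=
    h₉ F p O hO ρ ρ₀ ρ₀' ν n hunr hmod hn hνn hrel r' r₀' q S k m hr'irr hr'mod hr'diag hm hr'ord hSfin hSp hSunr
      hSlev hνunr
  -- S7f: Caraiani–Newton automorphy (printed hypotheses), Satake–Frobenius compatible with `r'` off `S`
  obtain ⟨ι⟩ := PadicAlgCl.nonempty_ringEquiv_complex (p := p)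
  obtain ⟨πF, T', hT', hT'L, hT'R, hcompatF⟩ :=
    h₁₂ c₂ F hF hdeg p ι E hCM hbig r' Pfr hr' S hSfin hSp hSgood (isCompact_glFiniteIntegralLevel_holds 2 F)
  -- S7d: twist the automorphic representation by the Hecke character of `ν`
  obtain ⟨πF', T'', hT'', hT''L, hT''R, hcompatF'⟩ :=
    h₁₀ F p (isCompact_glFiniteIntegralLevel_holds 2 F) ι πF T' hT' hT'L hT'R r' r ν ⟨n, hn, hνn⟩ hrr' S S' hSS'
      hcompatF hS'unr hνS'
  -- S5: the dictionary
  obtain ⟨𝒰, hbad, hpa⟩ :=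
    h₅ e₁ e₂ F hF hdeg p (isCompact_glFiniteIntegralLevel_holds 2 F) ι πF' T'' hT'' hT''L hT''R S' hS'fin hS'p r hcompatF'
  exact ⟨𝒰, r, r₀, q, hrirr, hpa, hrmod, hrdiag, ⟨k, hk, m * n, Nat.mul_pos hm hn, hrord⟩,
    fun v hvq hvp hur => hbad ▸ hS'lev v hvq hvp hur⟩

/-! ## 4. The composition: the stub statements imply the crux, BY NAME (no `sorry` of its own) -/

/-- **The line concludes the crux (v5).**  Case split on `DescendsOdd F p O ρ₀`: inside, `seed_of_descendsOdd`; outside, on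
`HasCousin` the v4 graft `seed_of_cousin`, on `HasTwistedCousin` the v5 graft `seed_of_twistedCousin`, on `HasWideCousin` the v6 graft
`seed_of_wideCousin`; outside all four, S6'''' (conceded) is the crux verbatim on `¬ DescendsOdd ∧ ¬ HasTwistedCousin ∧ ¬ HasWideCousin`. -/
theorem EisensteinProModularSeed_of (hf : S.lineFacts) (h₀ : S.stub_distinguishedDescendsQ) (h₁ : S.stub_inertSupplyPrimeSqAll)
    (h₂ : S.stub_eisensteinPackageQOdd) (h₃ : S.stub_restrictTwistGaloisPackageNu)
    (h₄ : S.stub_quadraticBaseChangeTwist) (h₅ : S.stub_cuspidalCohomologicalPoint)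
    (h₇ : S.stub_cousinGaloisPackage) (h₈ : S.stub_cousinAutomorphic)
    (h₉ : S.stub_twistGaloisTransport) (h₁₀ : S.stub_twistAutomorphicTransport)
    (h₁₁ : S.stub_cousinGaloisPackageWide) (h₁₂ : S.stub_cousinAutomorphicWide)
    (h₆ : S.stub_genuineCoreSeed) :
    Summit.Langlands.Langlands.Theses.SkinnerWilesDefectOne.EisensteinProModularSeed := by
  obtain ⟨f₁, f₂, f₃, f₄, f₅, e₁, e₂, s₁, s₂, c₁, c₂⟩ := hf
  intro F _ _ hF hdeg p _ hp O hO ρ ρ₀ hirr hunr hmod hloc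
  by_cases hP : DescendsOdd F p O ρ₀
  · have hdist : ∀ v : HeightOneSpectrum (𝓞 F), (p : 𝓞 F) ∈ v.asIdeal → IsPDistinguishedAt ρ₀ v := by
      obtain ⟨k₀, -, m₀, -, hloc'⟩ := hloc
      exact fun v hv => (hloc' v hv).1
    exact seed_of_descendsOdd f₁ f₂ f₃ f₄ f₅ e₁ e₂ h₀ h₁ h₂ h₃ h₄ h₅ F hF hdeg p O hO ρ ρ₀ hunr hmod hdist hP
  · by_cases hC : HasCousin F p O ρ₀
    · exact seed_of_cousin e₁ e₂ s₁ s₂ c₁ h₇ h₈ h₅ F hF hdeg p O hO ρ₀ hC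
    · by_cases hT : HasTwistedCousin F p O ρ₀
      · exact seed_of_twistedCousin e₁ e₂ s₁ s₂ c₁ h₇ h₈ h₅ h₉ h₁₀ F hF hdeg p O hO ρ ρ₀ hunr hmod hT
      · by_cases hW : HasWideCousin F p O ρ₀
        · exact seed_of_wideCousin e₁ e₂ s₁ s₂ c₂ h₁₁ h₁₂ h₅ h₉ h₁₀ F hF hdeg p O hO ρ ρ₀ hunr hmod hW
        · exact h₆ F hF hdeg p hp O hO ρ ρ₀ hirr hunr hmod hloc hP hT hW

/-- **The skeleton (v6)**: the crux modulo exactly the registered (sorried) stubs — `stub_quadraticBaseChangeGalois` (route crux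
stmt-Langlands-15156), `stub_lineFacts` (eleven published named facts, literature debt), the v6 stubs `stub_cousinGaloisPackageWide` /
`stub_cousinAutomorphicWide` (theorem-grade, waved; v5's S7c/S7d have landed) and `stub_genuineCoreSeed` (the conceded genuine core). -/
theorem EisensteinProModularSeed_proof :
    Summit.Langlands.Langlands.Theses.SkinnerWilesDefectOne.EisensteinProModularSeed :=
  EisensteinProModularSeed_of stub_lineFacts stub_distinguishedDescendsQ stub_inertSupplyPrimeSqAll stub_eisensteinPackageQOdd
    stub_restrictTwistGaloisPackageNu stub_quadraticBaseChangeTwist stub_cuspidalCohomologicalPoint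
    stub_cousinGaloisPackage stub_cousinAutomorphic stub_twistGaloisTransport stub_twistAutomorphicTransport
    stub_cousinGaloisPackageWide stub_cousinAutomorphicWide stub_genuineCoreSeed

end Summit.Langlands.Langlands.Cruxes.EisensteinProModularSeed.DescendRaiseBasechange

end
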